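import Mathlib
import Literature.NumberTheory.Transcendental.SixExponentialsSeveralVariablesAuxiliary
import Summits.AtomisticToContinuum.Crystallization.Theses.ChessboardParticlePlanes
import Summits.AtomisticToContinuum.Crystallization.Theorems.ChargedEnergyGap.Negative.Unconditional
import Summits.AtomisticToContinuum.Crystallization.Theorems.ChessboardParticlePlanesLjLaminarWindowsGoodCentre
import Summits.AtomisticToContinuum.Crystallization.Theorems.ChessboardParticlePlanesLjLaminarWindowsWindowFloor
import Summits.AtomisticToContinuum.Crystallization.Theorems.ChessboardParticlePlanesLjLaminarWindowsAveragingIntegrals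
import Summits.AtomisticToContinuum.Crystallization.Theorems.ChessboardParticlePlanesLjLaminarWindowsMinDistDefs
import Summits.AtomisticToContinuum.Crystallization.Theorems.ChessboardParticlePlanesLjLaminarWindowsForceBalance
import Summits.AtomisticToContinuum.Crystallization.Theorems.ChessboardParticlePlanesLjLaminarWindowsForceTheta
import Summits.AtomisticToContinuum.Crystallization.Theorems.ChessboardParticlePlanesLjLaminarWindowsForceClubsuit
import Summits.AtomisticToContinuum.Crystallization.Theorems.ChessboardParticlePlanesLjLaminarWindowsForceCapacity
import Summits.AtomisticToContinuum.Crystallization.Theorems.ChessboardParticlePlanesLjLaminarWindowsRemoval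
import Summits.AtomisticToContinuum.Crystallization.Theorems.ChessboardParticlePlanesLjLaminarWindowsShellBound
import Summits.AtomisticToContinuum.Crystallization.Theorems.ChessboardParticlePlanesLjLaminarWindowsPathCount
import Summits.AtomisticToContinuum.Crystallization.Theorems.ChessboardParticlePlanesLjLaminarWindowsGlueC5
import Summits.AtomisticToContinuum.Crystallization.Theorems.ChessboardParticlePlanesLjLaminarWindowsGlueC5GS
import Summits.AtomisticToContinuum.Crystallization.Theorems.ChessboardParticlePlanesLjLaminarWindowsSpikyGrowth
import Summits.AtomisticToContinuum.Crystallization.Theorems.ChessboardParticlePlanesLjLaminarWindowsSlabCount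
import Summits.AtomisticToContinuum.Crystallization.Theorems.ChessboardParticlePlanesLjLaminarWindowsCellCover
import Summits.AtomisticToContinuum.Crystallization.Theorems.ChessboardParticlePlanesLjLaminarWindowsCoinScaleRatio
import Summits.AtomisticToContinuum.Crystallization.Theorems.ChessboardParticlePlanesLjLaminarWindowsBssOfCoins
import Summits.AtomisticToContinuum.Crystallization.Theorems.ChessboardParticlePlanesLjLaminarWindowsCoreExtraction
import Summits.AtomisticToContinuum.Crystallization.Theorems.ChessboardParticlePlanesLjLaminarWindowsPairCharging
import Summits.AtomisticToContinuum.Crystallization.Theorems.ChessboardParticlePlanesLjLaminarWindowsThickCircle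
import Summits.AtomisticToContinuum.Crystallization.Theorems.ChessboardParticlePlanesLjLaminarWindowsTripleShell
import Summits.AtomisticToContinuum.Crystallization.Theorems.ChessboardParticlePlanesLjLaminarWindowsMassBound
import Summits.AtomisticToContinuum.Crystallization.Theorems.ChessboardParticlePlanesLjLaminarWindowsSparseAllSpiky
import Summits.AtomisticToContinuum.Crystallization.Theorems.ChessboardParticlePlanesLjLaminarWindowsNsfReduction
import Summits.AtomisticToContinuum.Crystallization.Theorems.ChessboardParticlePlanesLjLaminarWindowsGlueNSF
import Summits.AtomisticToContinuum.Crystallization.Theorems.ChessboardParticlePlanesLjLaminarWindowsResidual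
import Summits.AtomisticToContinuum.Crystallization.Theorems.ChessboardParticlePlanesLjLaminarWindowsCruxOfOneWindow
import Summits.AtomisticToContinuum.Crystallization.Theorems.ChessboardParticlePlanesLjLaminarWindowsLocalNonSpiky
import Summits.AtomisticToContinuum.Crystallization.Theorems.ChessboardParticlePlanesLjLaminarWindowsFarParticle
import Summits.AtomisticToContinuum.Crystallization.Theorems.ChessboardParticlePlanesLjLaminarWindowsSubWindow
import Summits.AtomisticToContinuum.Crystallization.Theorems.ChessboardParticlePlanesLjLaminarWindowsOneWindowOfLaminarityAt
import Summits.AtomisticToContinuum.Crystallization.Theorems.ChessboardParticlePlanesLjLaminarWindowsEnergyGapReduction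
import Summits.AtomisticToContinuum.Crystallization.Theorems.ChessboardParticlePlanesLjLaminarWindowsPeriodicGapReduction
import Literature.MathematicalPhysics.StatisticalMechanics.LennardJonesClusters
import Literature.MathematicalPhysics.StatisticalMechanics.LennardJonesThermodynamicLimitProofs
import Literature.MathematicalPhysics.StatisticalMechanics.Yuhjtman2015Proofs

/-!
# Skeleton line `Sketch` for crux `LjLaminarWindows` (stmt-AtomisticToContinuum-6711) — lead rev. 21 (c15)

(rev. 21, lead c15, 2026-08-17: unchanged composition and open stub S9♯ `stub_allGroundStatesOneWindow` (crux-equivalent); adds the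
periodisation step D1 (PerGap) ⇒ (Gap) as the registered stub `nonLaminarEnergyGap_of_periodicNonLaminarGap` — provable now, landed by
this seat — and the closing recipe (PerGap) ⇒ crux as an in-file `example` (tree: `LjLaminarWindowsSketch.LjLaminarWindows_of_periodicNonLaminarGap`): the purely variational door, a statement
about lattice sums of 7/10-separated everywhere-non-laminar periodic point sets; see `## Rev. 21` at the end.  Import closure: rev 20's +
`…LjLaminarWindowsEnergyGapReduction`.)

(rev. 20, lead c13, 2026-08-17: Lennard-Jones ground states EXIST for every `N` — tree theorem
`exists_isGroundState_lennardJones` (Blanc–Lewin 2015 §1.2) — so "frequently in `N` along EVERY sequence of ground states"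
is the same as "for infinitely many `N`, for EVERY `N`-particle ground state" (choice).  The single OPEN registered stub is
therefore the SEQUENCE-FREE form S9♯ `stub_allGroundStatesOneWindow`: "∀ η > 0, ∀ L, for infinitely many N, EVERY N-particle
LJ ground state has an η-laminar particle-centred closed L-window (some linear isometry `A`, some `3/4`-separated `T`)";
rev. 19's S9♭ `stub_oneWindowAllScales` is PROVED from it by restriction, and the crux implies S9♯ (`allGroundStates_of_crux`,
proved here), so crux ⇔ S9 ⇔ S9♭ ⇔ S9♯ — tree theorem `LjLaminarWindowsSketch.LjLaminarWindows_iff_allGroundStates`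
(Theorems/…LjLaminarWindowsAllGroundStates.lean, this seat).  The residual is a property of the SETS `GS_N` of ground states
at infinitely many particle numbers; the sequence in the crux carries no freedom.  What a refutation must exhibit: ONE
`η > 0`, ONE `L`, and for all large `N` ONE `N`-particle ground state with no `η`-laminar particle-centred closed `L`-window.
Composition unchanged: `LjLaminarWindows_of'''''`.)

(rev. 19, lead c12, 2026-08-17: the threshold radius `L₀` of the one-window residual is idle — laminarity of the
closed `L'`-ball around `xᵢ` is inherited by the concentric closed `L`-ball, `L ≤ L'`, same `A`, same `T` — so the
single OPEN registered stub is now the all-scales form S9♭ `stub_oneWindowAllScales`: "∀ ground-state sequences,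
∀ η > 0, ∀ L, frequently in N, some particle-centred closed L-window is η-laminar"; rev. 18's `stub_oneWindow` (S9)
is PROVED from it in one line (`L₀ := 0`) and the crux implies S9♭ (`oneWindowAllScales_of_crux`, proved here), so
crux ⇔ S9 ⇔ S9♭ — tree theorem `LjLaminarWindowsSketch.LjLaminarWindows_iff_oneWindowAllScales`
(Theorems/…LjLaminarWindowsOneWindowAllScales.lean, this seat).  What a refutation must exhibit is now one line:
ONE ground-state sequence, ONE `η > 0`, ONE radius `L` with, for all large `N`, NO `η`-laminar particle-centred
closed `L`-window.  Composition unchanged: `LjLaminarWindows_of'''''`.)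

(rev. 18 = rev. 17 with ALL FIVE provable stubs LANDED and imported (lead c11, 2026-08-17, one wave + lead):
`stub_cruxOfOneWindow` p135891 (lead), `stub_localNonSpiky` p135965, `stub_farParticle` p135977, `stub_subWindow` p135999,
`stub_oneWindow_of_laminarityAt` p136026 (workers).  ONE sorry left: `stub_oneWindow` — one `η`-laminar particle-centred window
per large radius, frequently in `N` — which the crux itself implies (`oneWindow_of_crux`): tree theorem
`LjLaminarWindowsSketch.LjLaminarWindows_iff_oneWindow` (Theorems/…LjLaminarWindowsOneWindow.lean).  The residual is minimal.)

Previous header (rev. 17):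

(rev. 17 = rev. 16 RESHAPED at the last stub once more (lead c11, 2026-08-17): the density form of the residual
(`stub_laminarityAt`: frequently in `N`, fewer than `δ N` non-`(η, L)`-laminar particles for EVERY `δ > 0`) is an
artefact of the pigeonhole "laminar ∩ non-spiky" in `stub_glueNSF`.  The landed NSF machinery is LOCAL
(`stub_massBound` + `stub_sparseAllSpiky`: a `θ`-non-spiky particle within `2L²` of ANY particle that sees a particle
beyond `2L`), and laminarity is inherited by sub-windows (translate the height set).  Hence the single OPEN registered
stub is now `stub_oneWindow` — ONE `η`-laminar particle-centred window at every large radius, frequently in `N`,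
i.e. LITERALLY the laminarity clause of the crux with the separation and energy clauses deleted — which is implied BY
the crux (`oneWindow_of_crux`, proved below), so the line's residual is now provably minimal: the crux is EQUIVALENT to
it.  Provable registered stubs of rev. 17 (wave + lead): `stub_localNonSpiky`, `stub_farParticle`, `stub_subWindow`,
`stub_oneWindow_of_laminarityAt` (rev. 16's residual ⇒ rev. 17's), and the glue `stub_cruxOfOneWindow`; composition
`LjLaminarWindows_of'''''`.  Rev. 16's `stub_laminarityAt` survives as the hypothesis `hLamAt` of two `example`s.)

Previous header (rev. 16):

(rev. 16 = rev. 15 RESHAPED at the last stub (lead c10, 2026-08-17): the landed glue consumes laminarity only at thickness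
`t = η`, radius `R = L` and only frequently in `N`, so the single OPEN registered stub is now the exact residual
`stub_laminarityAt` (for each `η > 0`, along every ground-state sequence, for all large `L` and every `δ > 0`, frequently in
`N` fewer than `δ N` particles have a non-`(η, L)`-laminar window) instead of the verbatim board item stmt-14293, which
implies it (`laminarityAt_of_laminarity`, proved below; the crux stays blocked-on 14293).  Second registered stub
`stub_cruxOfLaminarityAt` (residual ⇒ crux body; PROVABLE NOW = `glueNSF_at` of the lead's helper file
`Theorems/ChessboardParticlePlanesLjLaminarWindowsResidual.lean`, which also proves the UNCONDITIONAL `η ≥ 3/8` case of the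
crux body, `ljLaminarWindows_of_three_eighths_le`).  Composition `LjLaminarWindows_of''''`; the older compositions take the
statement of 14293 as the hypothesis `hLam`.)

Previous header (rev. 15):


(rev. 15 = rev. 14a with ALL SIX provable stubs of the NSF branch LANDED and imported: `stub_thickCircle` p130347,
`stub_tripleShell` p131377, `stub_massBound` p132052, `stub_nsfReduction` p132235, `stub_glueNSF` p132395 (wave 1, workers),
`stub_sparseAllSpiky` (lead; helpers …SparseAllSpikyA p132616, …B p132622, …C p132966).  ONE sorry left: `stub_laminarity` ≡ board
item stmt-14293.  NSF is a theorem (`nsf_holds`); the crux follows from 14293 alone (composition `LjLaminarWindows_of'''`; tree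
theorem `LjLaminarWindowsSketch.LjLaminarWindows_of_laminarity` in Theorems/…LjLaminarWindowsNSF.lean).)

Previous header (rev. 14):


(rev. 14 = rev. 13 with the seven c6 modules IMPORTED (local copies dropped) + the NSF branch of lead c8:
`bonferroni` (proved), registered provable stubs `stub_thickCircle`, `stub_tripleShell`, `stub_massBound`, `stub_sparseAllSpiky`,
`stub_nsfReduction`, `stub_glueNSF`, compositions `nsf_holds` and `LjLaminarWindows_of'''` — crux ⇐ 14293 ∧ NSF, and
NSF ⇐ the four geometric stubs, all provable now (plan in the section docstring `## Rev. 14`).  Registered stubs (7):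
`stub_laminarity` (≡ 14293, board item) and the six above; C6a4 `stub_fewSmallPartners` is demoted to the
hypothesis `hFew` of c6's chain (rev. 14a).)

Previous header (rev. 13):


(rev. 13 = rev. 10 + waves 1–3 of lead c6 LANDED: C6b–C6f p124433 p124519 p124649 p124781 p124689, C6a1
p125289, C6a3 p125819; registered OPEN stubs: `stub_laminarity` (≡ 14293), `stub_fewSmallPartners` (C6a4, THE BET:
pointwise coin structure of a uniformly spiky core).  Crux ⇐ 14293 ∧ C6a4.)

Previous header (rev. 10):

(rev. 10 = lead c6, 2026-08-16: the landed `stub_glueC5GS` (p122563) imported; the bet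
`stub_boundedSpikes` (BSS) of rev. 8/9 is now PROVED modulo the single-scale coin-structure theorem
`stub_coinStructure` (C6a) by the cross-scale accounting C6b–C6f (all provable now, registered for the
wave); `stub_noFoam` (board item 13453) and `stub_boundedSpikesGS` are no longer registered — the former
is the hypothesis of `LjLaminarWindows_of_noFoam`, the latter follows from BSS.  Registered OPEN stubs
of rev. 10: `stub_laminarity` (≡ board item 14293), `stub_coinStructure` (THE BET), `stub_spikyGrowth`,
`stub_slabCount`, `stub_cellCover`, `stub_coinScaleRatio`, `stub_bssOfCoins`.  Crux ⇐ 14293 ∧ C6a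
(`LjLaminarWindows_of'`).  Rev. 7–9 (lead c5): rev. 6 + the LANDED cohesion-side sub-goals
`stub_chemicalPotential` / `stub_removalRecord` (p121130), `stub_windowRemoval` (p121733), `stub_shellBound`
(p122286), `stub_pathCount` (p122231), `stub_glueC5` (p122311), `stub_glueC5GS` (p122563).)

Previous header (rev. 6):

Route `ChessboardParticlePlanes`, sub-problem `Crystallization`.  Continuation lead
`prover-line-stmt-AtomisticToContinuum-6711-c1-0` (2026-08-16), on top of rev. 3/4 of lead
`prover-line-stmt-AtomisticToContinuum-6711-0` (composition PROVED; helpers landed: `goodCentre`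
p103339, `windowFloor` p103349, `windowTransfer` p103566 / `stub_windowTransfer` p106066,
`averagingIntegrals` p103618 — all in namespace `…Theorems.LjLaminarWindowsSketch`, imported here).

Registered stubs of rev. 6 (TWO open: `stub_laminarity`, `stub_noFoam`; the five minimal-distance stubs of rev. 5 and their assembly `stub_minDistance07` are landed):

* `stub_laminarity` (OPEN; = item stmt-AtomisticToContinuum-14293 `LaminarSixThreeThree.LjLaminarity`
  verbatim): a.e. laminarity of LJ ground states;
* `stub_noFoam` (OPEN; = item stmt-AtomisticToContinuum-13453 `SurfaceTensionNoFoam.NoFoam` verbatim);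
* the MINIMAL-DISTANCE programme (provable now; replaces rev. 4's `stub_minDistance07`, which was one
  stub too big for one worker): every Lennard-Jones ground state is `7/10`-separated, by a
  FORCE-BALANCE sharpening of Yuhjtman's one-centre argument (`0.684`):
  - `stub_forceBalance` — removal + insertion + criticality in `x_p` at a pair `(p, q)`:
    `∑_{k ≠ p,q} (h(r_pk) + t|h'(r_pk)|) ≥ 1 - h(a) + t h'(a)` for every `t ≥ 0`;
  - `stub_forceTheta : ForceThetaFacts` — one-variable facts about the majorant `thetaF` of the
    charged minus-energy `kF = h + (1/25)|h'|` (convexity of `v thetaF v`, `kF ≤ thetaF`, bounds,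
    `∫_{0.64}^R v² thetaF ≤ 28/25`);
  - `stub_forceClubsuit : ForceClubsuitFacts` — the near-cut-off inequality (♣);
  - `stub_forceCapacity : ForceThetaFacts → ForceClubsuitFacts → ForceCapacity` — the 3-D packing
    argument `∑ kF(‖z_i‖) ≤ (84/25)/c³` for `2c`-separated points (Yuhjtman Prop. 5 transcribed);
  - `stub_forceFinalIneq : ForceFinalIneq` — `24·(28/25)/a³ < 1 - h(a) + h'(a)/25` on `[0.684, 0.7]`;
  composed by the PROVED `minDistance07_of` (closest pair, `c = a/2`, Yuhjtman's `a > 0.684`).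
  The definitions `hLJ'`, `kF`, `AF`, `BF`, `thetaF`, `thetaFcut`, `gamF` and the four `Force*` statement
  `Prop`s are those of `Theorems/ChessboardParticlePlanesLjLaminarWindowsMinDistDefs.lean` (landed p111755);
  all five minimal-distance stubs LANDED (p112273, p114329, p114893, p115454, p111755), assembled as
  `LjLaminarWindowsSketch.stub_minDistance07` (p115815) — every LJ ground state is `7/10`-separated.

`composition` (rev. 3, verbatim) turns laminarity + separation density + no-foam + the four landed
helpers into the crux; `sepDensity_of_minDistance07` feeds it the (now empty) separation-bad set;
`LjLaminarWindows_of` is the ONLY theorem concluding the crux by name.  Numerics behind every constant: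
lead folder `work/numerics/` (exact rational arithmetic; Bernstein-positive certificates).
Disproof.lean: absent (2026-08-16T17:00Z).
-/

noncomputable section

open scoped BigOperators
open MeasureTheory Metric Filter Topology
open Literature.MathematicalPhysics.StatisticalMechanics
open Literature.MathematicalPhysics.StatisticalMechanics.Yuhjtman2015
open Summit.AtomisticToContinuum.Crystallization.Theorems.ChargedEnergyGapNegative



namespace Summit.AtomisticToContinuum.Crystallization.Cruxes.LjLaminarWindows.Sketch

open Summit.AtomisticToContinuum.Crystallization.Theorems
open Summit.AtomisticToContinuum.Crystallization.Theorems.LjLaminarWindowsSketch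
  (hLJ' kF AF BF thetaF thetaFcut gamF ForceThetaFacts ForceClubsuitFacts ForceCapacity ForceFinalIneq)

/-! ## Helper lemmas (lead, proved) -/

/-- `|V_LJ(r)| ≤ (δ⁻⁶/12 + 1/6)·r⁻⁶` for `r ≥ δ > 0`. [folklore] -/
theorem abs_lennardJones_le_of_le {δ r : ℝ} (hδ : 0 < δ) (hr : δ ≤ r) :
    |lennardJones r| ≤ (δ⁻¹ ^ 6 / 12 + 1 / 6) * r⁻¹ ^ 6 := by
  have hr0 : 0 < r := lt_of_lt_of_le hδ hr
  have hi0 : 0 ≤ r⁻¹ := inv_nonneg.2 hr0.le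
  have h6 : r⁻¹ ^ 6 ≤ δ⁻¹ ^ 6 := pow_le_pow_left₀ hi0 ((inv_le_inv₀ hr0 hδ).2 hr) 6
  have hp : 0 ≤ r⁻¹ ^ 6 := pow_nonneg hi0 6
  have h12 : r⁻¹ ^ 12 = r⁻¹ ^ 6 * r⁻¹ ^ 6 := by ring
  have hprod : r⁻¹ ^ 6 * r⁻¹ ^ 6 ≤ δ⁻¹ ^ 6 * r⁻¹ ^ 6 := mul_le_mul_of_nonneg_right h6 hp
  unfold lennardJones
  rw [h12, abs_le]
  constructor <;> nlinarith [mul_nonneg hp hp]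

/-- Row sums of `|V_LJ|` over a `δ`-separated configuration of `ℝ³` are bounded by
`M(δ) = (δ⁻⁶/12 + 1/6)·250·δ⁻⁶` (shell sum `sum_inv_pow_six_le`). [folklore] -/
theorem row_abs_lennardJones_le {N : ℕ} (x : Fin N → E3) {δ : ℝ} (hδ : 0 < δ)
    (hsep : ∀ k l : Fin N, k ≠ l → δ ≤ dist (x k) (x l)) (j : Fin N) :
    ∑ k ∈ Finset.univ.erase j, |lennardJones (dist (x j) (x k))| ≤
      (δ⁻¹ ^ 6 / 12 + 1 / 6) * (250 * δ⁻¹ ^ 6) := by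
  have h6 := sum_inv_pow_six_le x hδ hsep j
  have hc : 0 ≤ δ⁻¹ ^ 6 / 12 + 1 / 6 := by positivity
  calc ∑ k ∈ Finset.univ.erase j, |lennardJones (dist (x j) (x k))|
      ≤ ∑ k ∈ Finset.univ.erase j, (δ⁻¹ ^ 6 / 12 + 1 / 6) * (dist (x j) (x k))⁻¹ ^ 6 :=
        Finset.sum_le_sum fun k hk =>
          abs_lennardJones_le_of_le hδ (hsep j k (Finset.ne_of_mem_erase hk).symm)
    _ = (δ⁻¹ ^ 6 / 12 + 1 / 6) * ∑ k ∈ Finset.univ.erase j, (dist (x j) (x k))⁻¹ ^ 6 := by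
        rw [Finset.mul_sum]
    _ ≤ (δ⁻¹ ^ 6 / 12 + 1 / 6) * (250 * δ⁻¹ ^ 6) := mul_le_mul_of_nonneg_left h6 hc

/-- **Far centre ⇒ exposed nearest particle.** If the particle `i` nearest to a point `c` is at
distance `> a ≥ r₀`, then `i` is `(r₀, a+2)`-exposed: some point within `a + 2` of `xᵢ` is at
distance `≥ r₀` from every particle (the point `c` itself if `dist ≤ a + 2`, else the point of the
segment `[xᵢ, c]` at distance `a + 2` from `xᵢ`). [folklore] -/
theorem exposed_of_far {N : ℕ} (x : Fin N → E3) (c : E3) (i : Fin N) {a r₀ : ℝ} (hr₀ : r₀ ≤ a)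
    (ha : 0 ≤ a) (hmin : ∀ j, dist (x i) c ≤ dist (x j) c) (hfar : a < dist (x i) c) :
    ∃ p : E3, dist p (x i) ≤ a + 2 ∧ ∀ j : Fin N, r₀ ≤ dist p (x j) := by
  by_cases hd : dist (x i) c ≤ a + 2
  · refine ⟨c, by rwa [dist_comm], fun j => ?_⟩
    rw [dist_comm]
    linarith [hmin j]
  · push Not at hd
    set d : ℝ := dist (x i) c with hd_def
    have hdpos : 0 < d := by linarith
    have hnorm : ‖c - x i‖ = d := by rw [← dist_eq_norm, dist_comm]
    refine ⟨x i + ((a + 2) / d) • (c - x i), ?_, fun j => ?_⟩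
    · rw [dist_eq_norm, add_sub_cancel_left, norm_smul, Real.norm_eq_abs,
        abs_of_pos (by positivity), hnorm, div_mul_cancel₀ _ hdpos.ne']
    · have hcp : dist c (x i + ((a + 2) / d) • (c - x i)) = d - (a + 2) := by
        have : c - (x i + ((a + 2) / d) • (c - x i)) = (1 - (a + 2) / d) • (c - x i) := by
          rw [sub_smul, one_smul]; abel
        rw [dist_eq_norm, this, norm_smul, Real.norm_eq_abs, hnorm,
          abs_of_nonneg (by rw [sub_nonneg, div_le_one hdpos]; linarith)]
        field_simp
      have htri := dist_triangle c (x i + ((a + 2) / d) • (c - x i)) (x j)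
      have hj := hmin j
      rw [dist_comm (x j)] at hj
      linarith

/-- Levels with consecutive gaps `≥ 3/4` are `3/4`-separated: `c k + 3/4·(m+1) ≤ c (k + (m+1))`.
[folklore] -/
theorem levels_gap (c : ℤ → ℝ) (hc : ∀ k : ℤ, c k + 3 / 4 ≤ c (k + 1)) (k : ℤ) (m : ℕ) :
    c k + 3 / 4 * (m + 1 : ℝ) ≤ c (k + (m + 1 : ℕ)) := by
  induction m with
  | zero => simpa using hc k
  | succ m ih =>
    have h := hc (k + (m + 1 : ℕ))
    have e : k + ((m + 1 + 1 : ℕ) : ℤ) = k + ((m + 1 : ℕ) : ℤ) + 1 := by push_cast; ring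
    rw [e]
    push_cast at ih h ⊢
    linarith

/-- The range of such levels is a `3/4`-separated set. [folklore] -/
theorem levels_separated (c : ℤ → ℝ) (hc : ∀ k : ℤ, c k + 3 / 4 ≤ c (k + 1)) :
    ∀ s ∈ Set.range c, ∀ s' ∈ Set.range c, s ≠ s' → (3 : ℝ) / 4 ≤ |s - s'| := by
  rintro _ ⟨k, rfl⟩ _ ⟨k', rfl⟩ hne
  have key : ∀ k k' : ℤ, k < k' → (3 : ℝ) / 4 ≤ c k' - c k := by
    intro k k' hlt
    obtain ⟨m, hm⟩ : ∃ m : ℕ, k' = k + (m + 1 : ℕ) := by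
      refine ⟨(k' - k - 1).toNat, ?_⟩
      have : 0 ≤ k' - k - 1 := by omega
      push_cast
      rw [Int.toNat_of_nonneg this]
      ring
    have h := levels_gap c hc k m
    rw [← hm] at h
    have : (0 : ℝ) ≤ m := Nat.cast_nonneg m
    nlinarith
  rcases lt_trichotomy k k' with h | h | h
  · have := key k k' h
    rw [abs_sub_comm, abs_of_nonneg (by linarith)]
    exact this
  · exact absurd (congrArg c h) hne
  · have := key k' k h
    rw [abs_of_nonneg (by linarith)]
    exact this

/-- **Levels ⇒ isometry.** A unit normal `n` and levels `c` (gaps `≥ 3/4`) controlling the window of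
`i` give a linear isometry `A` (coordinates in an orthonormal basis with third vector `n`, so that
`(A v)₂ = ⟪v, n⟫`) and the `3/4`-separated height set `T = range c` of the crux's laminarity
clause. [folklore] -/
theorem laminar_of_levels {N : ℕ} (y : Fin N → E3) (i : Fin N) (R t : ℝ) (n : E3) (hn : ‖n‖ = 1)
    (c : ℤ → ℝ) (hc : ∀ k : ℤ, c k + 3 / 4 ≤ c (k + 1))
    (h : ∀ j : Fin N, dist (y j) (y i) ≤ R → ∃ k : ℤ, |inner ℝ (y j - y i) n - c k| ≤ t) :
    ∃ (A : E3 →ₗᵢ[ℝ] E3) (T : Set ℝ), (∀ s ∈ T, ∀ s' ∈ T, s ≠ s' → (3 : ℝ) / 4 ≤ |s - s'|) ∧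
      ∀ j : Fin N, dist (y j) (y i) ≤ R → ∃ s ∈ T, |(A (y j - y i)) 2 - s| ≤ t := by
  have hon : Orthonormal ℝ (({(2 : Fin 3)} : Set (Fin 3)).restrict fun _ : Fin 3 => n) := by
    refine ⟨fun _ => by simpa using hn, ?_⟩
    intro a b hab
    exact absurd (Subsingleton.elim a b) hab
  obtain ⟨b, hb⟩ := Orthonormal.exists_orthonormalBasis_extension_of_card_eq
    (𝕜 := ℝ) (E := E3) (ι := Fin 3) (by simp) hon
  have hb2 : b 2 = n := hb 2 (by simp)
  refine ⟨b.repr.toLinearIsometry, Set.range c, levels_separated c hc, fun j hj => ?_⟩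
  obtain ⟨k, hk⟩ := h j hj
  refine ⟨c k, ⟨k, rfl⟩, ?_⟩
  have : (b.repr.toLinearIsometry (y j - y i)) 2 = inner ℝ (y j - y i) n := by
    show b.repr (y j - y i) 2 = inner ℝ (y j - y i) n
    rw [b.repr_apply_apply, hb2, real_inner_comm]
  rw [this]
  exact hk

/-! ## Local copy of the landed `stub_windowTransfer` (p106066, module `…WindowTransferThick`, not yet built on the farm at 15:40Z; this copy is removed and the import restored once it is) -/

/-- Row bound: summing `|v j k|` over ordered pairs `j ≠ k` with the ROW index restricted to a
predicate `p` gives at most `M · #{p}` when every row satisfies `∑_{k ≠ j} |v j k| ≤ M`. [folklore] -/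
theorem wtLocal_row_le {α : Type*} [Fintype α] [DecidableEq α]
    (p : α → Prop) [DecidablePred p] (v : α → α → ℝ) (M : ℝ)
    (hrow : ∀ j, ∑ k ∈ Finset.univ.erase j, |v j k| ≤ M) :
    (∑ j, ∑ k, if j ≠ k ∧ p j then |v j k| else 0) ≤
      M * ((Finset.univ.filter p).card : ℝ) := by
  have hpt : ∀ j, (∑ k, if j ≠ k ∧ p j then |v j k| else 0) ≤ if p j then M else 0 := by
    intro j
    by_cases hj : p j
    · rw [if_pos hj]
      calc (∑ k, if j ≠ k ∧ p j then |v j k| else 0)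
          = ∑ k ∈ Finset.univ.erase j, |v j k| := by
            rw [← Finset.filter_ne, Finset.sum_filter]
            exact Finset.sum_congr rfl fun k _ => if_congr (and_iff_left hj) rfl rfl
        _ ≤ M := hrow j
    · rw [if_neg hj]
      refine (Finset.sum_eq_zero fun k _ => ?_).le
      exact if_neg fun h => hj h.2
  calc (∑ j, ∑ k, if j ≠ k ∧ p j then |v j k| else 0)
      ≤ ∑ j, (if p j then M else 0) := Finset.sum_le_sum fun j _ => hpt j
    _ = M * ((Finset.univ.filter p).card : ℝ) := by
      rw [← Finset.sum_filter, Finset.sum_const, nsmul_eq_mul]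
      ring

/-- Column bound: the same as `wtLocal_row_le` with the COLUMN index restricted, for
a symmetric kernel `v j k = v k j`. [folklore] -/
theorem wtLocal_col_le {α : Type*} [Fintype α] [DecidableEq α]
    (p : α → Prop) [DecidablePred p] (v : α → α → ℝ) (hv : ∀ j k, v j k = v k j) (M : ℝ)
    (hrow : ∀ j, ∑ k ∈ Finset.univ.erase j, |v j k| ≤ M) :
    (∑ j, ∑ k, if j ≠ k ∧ p k then |v j k| else 0) ≤
      M * ((Finset.univ.filter p).card : ℝ) := by
  calc (∑ j, ∑ k, if j ≠ k ∧ p k then |v j k| else 0)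
      = ∑ k, ∑ j, if k ≠ j ∧ p k then |v k j| else 0 := by
        refine Finset.sum_comm.trans ?_
        refine Finset.sum_congr rfl fun k _ => Finset.sum_congr rfl fun j _ => ?_
        rw [hv j k]
        exact if_congr ⟨fun h => ⟨fun h' => h.1 h'.symm, h.2⟩, fun h => ⟨fun h' => h.1 h'.symm, h.2⟩⟩
          rfl rfl
    _ ≤ M * ((Finset.univ.filter p).card : ℝ) := wtLocal_row_le p v M hrow

/-- Abstract window transfer (the finite bookkeeping behind `stub_windowTransfer`): two windows
`B`, `W` whose symmetric difference lies in a shell `S`, a symmetric kernel with rows bounded by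
`M`, the shell-budgeted energy bound `E(B) + λ#S ≤ 2(e+ε)#B`, the floor `2e#B ≤ E(B)` and
`λ ≥ 2M, 4ε, 4|e+ε|`, `e + ε ≤ 0 < ε` give `E(W) ≤ 2(e+2ε)#W`.  Steps: (a) `#W ≤ #B + #S`,
`#B ≤ #W + #S`; (c) `E(W) ≤ E(B) + 2M#S` (pairs inside `W ∩ B` cancel, every other ordered pair
has an index in `W Δ B ⊆ S`, rows and — by symmetry — columns of `|v|` are bounded by `M`);
(b), (d)–(g) linear arithmetic on explicit product facts. [folklore] -/
theorem wtLocal_abstract {α : Type*} [Fintype α] [DecidableEq α]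
    (pB pW pS : α → Prop) [DecidablePred pB] [DecidablePred pW] [DecidablePred pS]
    (v : α → α → ℝ) (M e ε lam : ℝ)
    (hWB : ∀ j, pW j → ¬ pB j → pS j) (hBW : ∀ j, pB j → ¬ pW j → pS j)
    (hv : ∀ j k, v j k = v k j)
    (hε : 0 < ε) (he : e + ε ≤ 0)
    (hlamM : 2 * M ≤ lam) (hlamε : 4 * ε ≤ lam) (hlame : 4 * |e + ε| ≤ lam)
    (hrow : ∀ j, ∑ k ∈ Finset.univ.erase j, |v j k| ≤ M)
    (h1 : (∑ j, ∑ k, if j ≠ k ∧ pB j ∧ pB k then v j k else 0) +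
        lam * ((Finset.univ.filter pS).card : ℝ) ≤
          2 * (e + ε) * ((Finset.univ.filter pB).card : ℝ))
    (h2 : 2 * e * ((Finset.univ.filter pB).card : ℝ) ≤
        ∑ j, ∑ k, if j ≠ k ∧ pB j ∧ pB k then v j k else 0) :
    (∑ j, ∑ k, if j ≠ k ∧ pW j ∧ pW k then v j k else 0) ≤
      2 * (e + 2 * ε) * ((Finset.univ.filter pW).card : ℝ) := by
  -- (a) the symmetric difference of the two windows lies in the shell
  have hWsub : Finset.univ.filter pW ⊆ Finset.univ.filter pB ∪ Finset.univ.filter pS := by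
    intro j hj
    rw [Finset.mem_filter] at hj
    rw [Finset.mem_union, Finset.mem_filter, Finset.mem_filter]
    by_cases h : pB j
    · exact Or.inl ⟨hj.1, h⟩
    · exact Or.inr ⟨hj.1, hWB j hj.2 h⟩
  have hBsub : Finset.univ.filter pB ⊆ Finset.univ.filter pW ∪ Finset.univ.filter pS := by
    intro j hj
    rw [Finset.mem_filter] at hj
    rw [Finset.mem_union, Finset.mem_filter, Finset.mem_filter]
    by_cases h : pW j
    · exact Or.inl ⟨hj.1, h⟩
    · exact Or.inr ⟨hj.1, hBW j hj.2 h⟩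
  have ha1 : ((Finset.univ.filter pW).card : ℝ) ≤
      (Finset.univ.filter pB).card + (Finset.univ.filter pS).card := by
    exact_mod_cast (Finset.card_le_card hWsub).trans (Finset.card_union_le _ _)
  have ha2 : ((Finset.univ.filter pB).card : ℝ) ≤
      (Finset.univ.filter pW).card + (Finset.univ.filter pS).card := by
    exact_mod_cast (Finset.card_le_card hBsub).trans (Finset.card_union_le _ _)
  -- (c) energy comparison through the shell: pairs inside `W ∩ B` cancel, every other ordered
  -- pair has an index in the symmetric difference, hence in the shell
  have hpt : ∀ j k, (if j ≠ k ∧ pW j ∧ pW k then v j k else 0) -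
      (if j ≠ k ∧ pB j ∧ pB k then v j k else 0) ≤
      (if j ≠ k ∧ pS j then |v j k| else 0) + (if j ≠ k ∧ pS k then |v j k| else 0) := by
    intro j k
    have hWBj := hWB j
    have hBWj := hBW j
    have hWBk := hWB k
    have hBWk := hBW k
    have a1 := abs_nonneg (v j k)
    have a2 := le_abs_self (v j k)
    have a3 := neg_le_abs (v j k)
    split_ifs <;> first | linarith | (exfalso; tauto)
  have hsum : (∑ j, ∑ k, if j ≠ k ∧ pW j ∧ pW k then v j k else 0) -
      (∑ j, ∑ k, if j ≠ k ∧ pB j ∧ pB k then v j k else 0) ≤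
      (∑ j, ∑ k, if j ≠ k ∧ pS j then |v j k| else 0) +
        (∑ j, ∑ k, if j ≠ k ∧ pS k then |v j k| else 0) := by
    rw [← Finset.sum_sub_distrib, ← Finset.sum_add_distrib]
    refine Finset.sum_le_sum fun j _ => ?_
    rw [← Finset.sum_sub_distrib, ← Finset.sum_add_distrib]
    exact Finset.sum_le_sum fun k _ => hpt j k
  have hr := wtLocal_row_le pS v M hrow
  have hc := wtLocal_col_le pS v hv M hrow
  -- (b), (d)-(g): arithmetic on explicit product facts
  have hnS : (0 : ℝ) ≤ ((Finset.univ.filter pS).card : ℝ) := Nat.cast_nonneg _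
  have hnB : (0 : ℝ) ≤ ((Finset.univ.filter pB).card : ℝ) := Nat.cast_nonneg _
  have hnW : (0 : ℝ) ≤ ((Finset.univ.filter pW).card : ℝ) := Nat.cast_nonneg _
  set nS : ℝ := ((Finset.univ.filter pS).card : ℝ) with hnSdef
  set nB : ℝ := ((Finset.univ.filter pB).card : ℝ) with hnBdef
  set nW : ℝ := ((Finset.univ.filter pW).card : ℝ) with hnWdef
  have p1 : 2 * M * nS ≤ lam * nS := mul_le_mul_of_nonneg_right hlamM hnS
  have p2 : (e + ε) * nB ≤ (e + ε) * (nW - nS) :=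
    mul_le_mul_of_nonpos_left (by linarith) he
  have p3 : 4 * ε * nS ≤ lam * nS := mul_le_mul_of_nonneg_right hlamε hnS
  have p4 : 4 * |e + ε| * nS ≤ lam * nS := mul_le_mul_of_nonneg_right hlame hnS
  rw [abs_of_nonpos he] at p4
  have p5 : ε * nB ≤ ε * (nW + nS) := mul_le_mul_of_nonneg_left ha2 hε.le
  linarith

/-- **Window transfer with shell thickness `a` (centre ball → particle-centred window).**
Deterministic bookkeeping: if the centre ball `B_L(c)` is energy-good with the shell budget,
`E_int(B_L(c)) + λ·#shell(c; L−a, L+a) ≤ 2(e+ε)·#B_L(c)`, its energy is floored by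
`2e·#B_L(c)`, the rows of `|V|` are bounded by `M`, `λ ≥ 2M, 4ε, 4|e+ε|`, `e + ε ≤ 0 < ε`, and the
particle `i` is within `a` of `c`, then the particle-centred window `B_L(xᵢ)` (whose symmetric
difference with `B_L(c)` lies in the shell `L - a < dist · c ≤ L + a`, by the triangle
inequality) satisfies `E_int(B_L(xᵢ)) ≤ 2(e + 2ε)·#B_L(xᵢ)`.  Here `V` is an arbitrary pair
potential evaluated at distances (so the kernel is symmetric).  (Registered stub
`stub_windowTransfer` of skeleton rev. 3, shell thickness `a`.) [folklore] -/
theorem windowTransfer_local :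
    ∀ (N : ℕ) (x : Fin N → E3) (V : ℝ → ℝ) (c : E3) (i : Fin N) (a L M e ε lam : ℝ),
      dist (x i) c ≤ a → 0 ≤ M → 0 < ε → e + ε ≤ 0 →
      2 * M ≤ lam → 4 * ε ≤ lam → 4 * |e + ε| ≤ lam →
      (∀ j : Fin N, ∑ k ∈ Finset.univ.erase j, |V (dist (x j) (x k))| ≤ M) →
      (∑ j : Fin N, ∑ k : Fin N,
          if j ≠ k ∧ dist (x j) c ≤ L ∧ dist (x k) c ≤ L then V (dist (x j) (x k)) else 0) +
        lam * ((Finset.univ.filter fun j : Fin N => L - a < dist (x j) c ∧ dist (x j) c ≤ L + a).card : ℝ)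
        ≤ 2 * (e + ε) * ((Finset.univ.filter fun j : Fin N => dist (x j) c ≤ L).card : ℝ) →
      2 * e * ((Finset.univ.filter fun j : Fin N => dist (x j) c ≤ L).card : ℝ) ≤
        (∑ j : Fin N, ∑ k : Fin N,
          if j ≠ k ∧ dist (x j) c ≤ L ∧ dist (x k) c ≤ L then V (dist (x j) (x k)) else 0) →
      (∑ j : Fin N, ∑ k : Fin N,
          if j ≠ k ∧ dist (x j) (x i) ≤ L ∧ dist (x k) (x i) ≤ L then V (dist (x j) (x k)) else 0) ≤
        2 * (e + 2 * ε) * (Nat.card {j : Fin N // dist (x j) (x i) ≤ L} : ℝ) := by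
  intro N x V c i a L M e ε lam hic _hM hε he hlamM hlamε hlame hrow h1 h2
  have ha : 0 ≤ a := dist_nonneg.trans hic
  -- the symmetric difference of the two windows lies in the shell (triangle inequality)
  have hWB : ∀ j : Fin N, dist (x j) (x i) ≤ L → ¬ dist (x j) c ≤ L →
      L - a < dist (x j) c ∧ dist (x j) c ≤ L + a := by
    intro j hjW hjB
    have hjB' : L < dist (x j) c := not_le.mp hjB
    refine ⟨by linarith, ?_⟩
    calc dist (x j) c ≤ dist (x j) (x i) + dist (x i) c := dist_triangle _ _ _
      _ ≤ L + a := by linarith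
  have hBW : ∀ j : Fin N, dist (x j) c ≤ L → ¬ dist (x j) (x i) ≤ L →
      L - a < dist (x j) c ∧ dist (x j) c ≤ L + a := by
    intro j hjB hjW
    have hjW' : L < dist (x j) (x i) := not_le.mp hjW
    have ht : dist (x j) (x i) ≤ dist (x j) c + dist c (x i) := dist_triangle _ _ _
    rw [dist_comm c (x i)] at ht
    exact ⟨by linarith, by linarith⟩
  have hv : ∀ j k : Fin N, V (dist (x j) (x k)) = V (dist (x k) (x j)) := fun j k => by
    rw [dist_comm]
  have key := wtLocal_abstract (fun j => dist (x j) c ≤ L)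
    (fun j => dist (x j) (x i) ≤ L) (fun j => L - a < dist (x j) c ∧ dist (x j) c ≤ L + a)
    (fun j k => V (dist (x j) (x k))) M e ε lam hWB hBW hv hε he hlamM hlamε hlame hrow h1 h2
  have hcard : Nat.card {j : Fin N // dist (x j) (x i) ≤ L} =
      (Finset.univ.filter fun j : Fin N => dist (x j) (x i) ≤ L).card :=
    Nat.subtype_card _ fun j => by simp
  rw [hcard]
  exact key


/-! ## The registered stubs (rev. 16: the density residual `stub_laminarityAt` — from rev. 17 on only a HYPOTHESIS `hLamAt` — and its landed glue) -/

/- (former registered stub `stub_laminarityAt` of rev. 16, superseded in rev. 17 by the weaker `stub_oneWindow`;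
kept for the record, it is the hypothesis `hLamAt` of the `example`s below)
**S1' (rev. 16) — the laminarity residual of the line** (rev. 16; weaker than board item
stmt-AtomisticToContinuum-14293 `LaminarSixThreeThree.LjLaminarity`, which implies it by
`laminarityAt_of_laminarity` below): for every thickness `η > 0`, along every sequence of LJ ground
states there is `L₁` such that for every radius `L ≥ L₁` and every `δ > 0`, FREQUENTLY in `N`, fewer
than `δ N` particles `i` admit NO unit normal `n` and levels `c : ℤ → ℝ` with consecutive gaps `≥ 3/4`
putting every particle within `L` of `xᵢ` within `η` of a level plane ("lim inf of the density of
non-`(η, L)`-laminar particles is `0`"; by monotonicity in `L` it is the same to ask this at arbitrarily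
large `L`).  This is exactly what the glue consumes (`t = η`, `R = L`, frequently).  Open problem for
`η < 3/8` (3-D layering of a pair-potential ground state); a THEOREM for `η ≥ 3/8`
(`laminarityAt_of_three_eighths_le`, helper file …Residual.lean).

  stub_laminarityAt :
    ∀ η : ℝ, 0 < η → ∀ x : (N : ℕ) → (Fin N → EuclideanSpace ℝ (Fin 3)),
      (∀ N, IsGroundState lennardJones (x N)) → ∃ L₁ : ℝ, ∀ L : ℝ, L₁ ≤ L → ∀ δ : ℝ, 0 < δ →
      ∃ᶠ N : ℕ in Filter.atTop, (Nat.card {i : Fin N // ¬ (∃ n : EuclideanSpace ℝ (Fin 3),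
        ‖n‖ = 1 ∧ ∃ c : ℤ → ℝ, (∀ k : ℤ, c k + 3 / 4 ≤ c (k + 1)) ∧ ∀ j : Fin N,
          dist (x N j) (x N i) ≤ L → ∃ k : ℤ, |inner ℝ (x N j - x N i) n - c k| ≤ η)} : ℝ) <
        δ * N
-/

/-- **S8 (LANDED p134778; lead c10) — the glue at the residual**: `stub_laminarityAt` ⇒ the crux body
(unfolded).  Proof = `stub_glueNSF` localised to one thickness (`glueNSF_at`: `Frequently.and_eventually`
replaces the eventual laminarity bound) composed with the tree theorems `nsf_holds`, `stub_windowRemoval`,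
`stub_shellBound`, `stub_pathCount`; helper file `Theorems/ChessboardParticlePlanesLjLaminarWindowsResidual.lean`, which also
proves the UNCONDITIONAL `η ≥ 3/8` case of the crux body (`ljLaminarWindows_of_three_eighths_le`). -/
theorem stub_cruxOfLaminarityAt :
    (∀ η : ℝ, 0 < η → ∀ x : (N : ℕ) → (Fin N → EuclideanSpace ℝ (Fin 3)),
      (∀ N, IsGroundState lennardJones (x N)) → ∃ L₁ : ℝ, ∀ L : ℝ, L₁ ≤ L → ∀ δ : ℝ, 0 < δ →
      ∃ᶠ N : ℕ in Filter.atTop, (Nat.card {i : Fin N // ¬ (∃ n : EuclideanSpace ℝ (Fin 3),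
        ‖n‖ = 1 ∧ ∃ c : ℤ → ℝ, (∀ k : ℤ, c k + 3 / 4 ≤ c (k + 1)) ∧ ∀ j : Fin N,
          dist (x N j) (x N i) ≤ L → ∃ k : ℤ, |inner ℝ (x N j - x N i) n - c k| ≤ η)} : ℝ) <
        δ * N) →
    ∀ x : (N : ℕ) → (Fin N → EuclideanSpace ℝ (Fin 3)), (∀ N, IsGroundState lennardJones (x N)) →
      ∀ η ε : ℝ, 0 < η → 0 < ε → ∃ L₀ : ℝ, ∀ L : ℝ, L₀ ≤ L → ∃ᶠ N in Filter.atTop,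
        ∃ (i : Fin N) (A : EuclideanSpace ℝ (Fin 3) →ₗᵢ[ℝ] EuclideanSpace ℝ (Fin 3)) (T : Set ℝ),
          (∀ t ∈ T, ∀ t' ∈ T, t ≠ t' → (3 : ℝ) / 4 ≤ |t - t'|) ∧
          (∀ j k : Fin N, j ≠ k → dist (x N j) (x N i) ≤ L → dist (x N k) (x N i) ≤ L →
            (7 : ℝ) / 10 ≤ dist (x N j) (x N k)) ∧
          (∀ j : Fin N, dist (x N j) (x N i) ≤ L → ∃ t ∈ T, |(A (x N j - x N i)) 2 - t| ≤ η) ∧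
          (∑ j : Fin N, ∑ k : Fin N, if j ≠ k ∧ dist (x N j) (x N i) ≤ L ∧ dist (x N k) (x N i) ≤ L
              then lennardJones (dist (x N j) (x N k)) else 0) ≤
            2 * ((⨅ Q : PeriodicConfiguration 3, Q.energyPerParticle lennardJones) + ε) *
              (Nat.card {j : Fin N // dist (x N j) (x N i) ≤ L} : ℝ) :=
  -- LANDED (lead c10, rev 16, p134778: Theorems/ChessboardParticlePlanesLjLaminarWindowsResidual.lean)
  LjLaminarWindowsSketch.stub_cruxOfLaminarityAt

/-- **14293 ⇒ the residual** (PROVED; also `LjLaminarWindowsSketch.laminarityAt_of_laminarity` in the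
helper file): `Tendsto → 0` gives `#non-laminar < δ N` eventually, hence frequently (`L₁ = 1`).  So the
crux is still closed in one line by a proof of board item stmt-AtomisticToContinuum-14293. -/
theorem laminarityAt_of_laminarity
    (hLam : ∀ t R : ℝ, 0 < t → 0 < R → ∀ x : (N : ℕ) → (Fin N → EuclideanSpace ℝ (Fin 3)),
      (∀ N, IsGroundState lennardJones (x N)) →
      Filter.Tendsto (fun N : ℕ => (Nat.card {i : Fin N // ¬ (∃ n : EuclideanSpace ℝ (Fin 3),
        ‖n‖ = 1 ∧ ∃ c : ℤ → ℝ, (∀ k : ℤ, c k + 3 / 4 ≤ c (k + 1)) ∧ ∀ j : Fin N,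
          dist (x N j) (x N i) ≤ R → ∃ k : ℤ, |inner ℝ (x N j - x N i) n - c k| ≤ t)} : ℝ) / N)
        Filter.atTop (nhds 0)) :
    ∀ η : ℝ, 0 < η → ∀ x : (N : ℕ) → (Fin N → EuclideanSpace ℝ (Fin 3)),
      (∀ N, IsGroundState lennardJones (x N)) → ∃ L₁ : ℝ, ∀ L : ℝ, L₁ ≤ L → ∀ δ : ℝ, 0 < δ →
      ∃ᶠ N : ℕ in Filter.atTop, (Nat.card {i : Fin N // ¬ (∃ n : EuclideanSpace ℝ (Fin 3),
        ‖n‖ = 1 ∧ ∃ c : ℤ → ℝ, (∀ k : ℤ, c k + 3 / 4 ≤ c (k + 1)) ∧ ∀ j : Fin N,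
          dist (x N j) (x N i) ≤ L → ∃ k : ℤ, |inner ℝ (x N j - x N i) n - c k| ≤ η)} : ℝ) <
        δ * N := by
  intro η hη x hx
  refine ⟨1, fun L hL δ hδ => ?_⟩
  have hLpos : 0 < L := by linarith
  have hE1 := (hLam η L hη hLpos x hx).eventually (gt_mem_nhds hδ)
  have hE3 : ∀ᶠ N : ℕ in atTop, 1 ≤ N := eventually_ge_atTop 1
  refine (hE1.and hE3).frequently.mono ?_
  rintro N ⟨h1, h3⟩
  have hNpos : (0 : ℝ) < N := by exact_mod_cast h3
  rwa [div_lt_iff₀ hNpos] at h1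

/-! **S3 — no foam** (item stmt-AtomisticToContinuum-13453 `SurfaceTensionNoFoam.NoFoam`, OPEN board
item): from rev. 10 (lead c6) on it is no longer a registered stub of this line but the hypothesis
`hNoFoam` of the composition `LjLaminarWindows_of_noFoam` below (its glue `stub_glue`, p116502, is
landed); the line's registered cohesion input is the coin-structure theorem `stub_coinStructure`. -/

/-! ## Sub-goals of lead c5 (cohesion side) — LANDED (2026-08-16, p121130,
`Theorems/ChessboardParticlePlanesLjLaminarWindowsRemoval.lean`, namespace `…Theorems.LjLaminarWindowsSketch`):
`stub_chemicalPotential` (∀ δ > 0, ∃ᶠ N: `E(N) − E(M) ≤ (N − M)(e* + δ)` for all `M ≤ N` and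
`(M − N)(e* − δ) ≤ E(M) − E(N)` for all `M ≥ N` — two-sided contact times of `E(N) − N e*`), and
`stub_removalRecord` (at those `N`, every ground state `x`, every group `S`:
`∑_{S×S} V_LJ + 2 ∑_{S×Sᶜ} V_LJ ≤ 2 (e* + δ) #S`; every family `y` of `M` new distinct points:
`2 (e* − δ) M ≤ 2 𝓔(y) + 2 ∑ V_LJ(|x_i − y_j|)`), with `removal_group_le`, `removal_append_ge`,
`removal_contact_frequently`, `removal_siteEnergy_frequently` (every particle bound by `≥ |e*| − δ`, no empty
site bound by `> |e*| + δ`).  Imported above; e.g. -/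
example : ∀ δ : ℝ, 0 < δ → ∃ᶠ N : ℕ in atTop, ∀ x : Fin N → E3, IsGroundState lennardJones x →
    (∀ S : Finset (Fin N),
        ∑ i ∈ S, ∑ k ∈ S, lennardJones (dist (x i) (x k)) +
            2 * ∑ i ∈ S, ∑ k ∈ Sᶜ, lennardJones (dist (x i) (x k)) ≤
          2 * (eStar + δ) * S.card) ∧
      (∀ (M : ℕ) (y : Fin M → E3), Function.Injective y → (∀ i j, x i ≠ y j) →
        2 * (eStar - δ) * M ≤
          2 * interactionEnergy lennardJones y + 2 * ∑ i, ∑ j, lennardJones (dist (x i) (y j))) :=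
  Summit.AtomisticToContinuum.Crystallization.Theorems.LjLaminarWindowsSketch.stub_removalRecord

/-- **C5c — window removal for all `N`** (sub-goal of lead c5 toward replacing `stub_noFoam`, card
`Ideas/subadditive-shells.md`; LANDED p121733 in
`Theorems/…LjLaminarWindowsRemoval.lean` as `LjLaminarWindowsSketch.stub_windowRemoval`): for every `η > 0` there is `k₀` such that for
EVERY `N`, every ground state `x` and every group `S` with `#S ≥ k₀`,
`∑_{S×S} V_LJ + 2 ∑_{S×Sᶜ} V_LJ ≤ 2 (e* + η) #S` (subadditivity `E(N) < E(N − #S) + E(#S)` and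
`E(k) ≤ k(e* + η)`); for a particle-centred window this is the crux's energy clause up to twice the
attraction across the window boundary. -/
theorem stub_windowRemoval :
    ∀ η : ℝ, 0 < η → ∃ k₀ : ℕ, ∀ (N : ℕ) (x : Fin N → E3), IsGroundState lennardJones x →
      ∀ S : Finset (Fin N), k₀ ≤ S.card →
        ∑ i ∈ S, ∑ k ∈ S, lennardJones (dist (x i) (x k)) +
            2 * ∑ i ∈ S, ∑ k ∈ Sᶜ, lennardJones (dist (x i) (x k)) ≤
          2 * (eStar + η) * S.card :=
  -- LANDED p121733 (appended to Theorems/…LjLaminarWindowsRemoval.lean)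
  LjLaminarWindowsSketch.stub_windowRemoval

/-! ## Rev. 8 — alternative cohesion branch of lead c5 (card `Ideas/subadditive-shells.md`):
`stub_noFoam` (13453) is NOT needed if the pair-distance distribution of a separated connected net cannot
be "spiky" at unboundedly many scales.  Stubs C5d–C5g below; `LjLaminarWindows_of'` is the alternative
composition `stub_glueC5 stub_laminarity stub_boundedSpikes stub_windowRemoval stub_shellBound stub_pathCount`.
The NoFoam branch (`LjLaminarWindows_of`) is kept unchanged. -/

/-- **C5d — shell bound** (provable now): for a `7/10`-separated configuration, the attraction across the
boundary of a particle-centred closed `L`-ball is at most `ε` per particle of the ball plus `C` per particle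
of the boundary shell `L − R < |x_j − x_i| ≤ L` (`r⁻⁶` tail beyond `R = R(ε)`; `C` = one-centre bound on
`∑_k V_LJ⁻`, e.g. from `sum_inv_pow_six_le`). -/
theorem stub_shellBound :
    ∀ ε : ℝ, 0 < ε → ∃ R C : ℝ, 1 ≤ R ∧ 0 < C ∧ ∀ (N : ℕ) (x : Fin N → E3),
      (∀ j k : Fin N, j ≠ k → (7 : ℝ) / 10 ≤ dist (x j) (x k)) → ∀ (i : Fin N) (L : ℝ),
        ∑ j ∈ Finset.univ.filter (fun j : Fin N => dist (x j) (x i) ≤ L),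
            ∑ k ∈ Finset.univ.filter (fun k : Fin N => ¬ dist (x k) (x i) ≤ L),
              max (-lennardJones (dist (x j) (x k))) 0 ≤
          ε * ((Finset.univ.filter fun j : Fin N => dist (x j) (x i) ≤ L).card : ℝ) +
            C * ((Finset.univ.filter fun j : Fin N =>
              L - R < dist (x j) (x i) ∧ dist (x j) (x i) ≤ L).card : ℝ) :=
  -- LANDED p122286 (worker), Theorems/…LjLaminarWindowsShellBound.lean
  LjLaminarWindowsSketch.stub_shellBound

/-- **C5e — path count** (provable now): in a `ρ`-connected configuration (every non-empty proper group has a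
member within `ρ` of a non-member), a particle that sees another particle beyond distance `L ≥ 0` has at
least `L/ρ` particles in its closed `L`-ball (the ball grows by at least one particle per `ρ`-step). -/
theorem stub_pathCount :
    ∀ (N : ℕ) (x : Fin N → E3) (ρ : ℝ), 0 < ρ →
      (∀ S : Finset (Fin N), S.Nonempty → Sᶜ.Nonempty → ∃ p ∈ S, ∃ k ∈ Sᶜ, dist (x p) (x k) ≤ ρ) →
      ∀ (i : Fin N) (L : ℝ), 0 ≤ L → (∃ j : Fin N, L < dist (x j) (x i)) →
        L / ρ ≤ ((Finset.univ.filter fun j : Fin N => dist (x j) (x i) ≤ L).card : ℝ) :=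
  -- LANDED p122231 (worker), Theorems/…LjLaminarWindowsPathCount.lean
  LjLaminarWindowsSketch.stub_pathCount

/-! ## Rev. 10 — lead c6: `stub_boundedSpikes` ⇐ the single-scale COIN-STRUCTURE theorem (C6a, the bet)
by a cross-scale accounting that is provable now (C6b growth, C6c slab packing, C6d cell covering,
C6e comparability of spiky scales, C6f octave bound).  Heuristic behind C6a and the accounting
(lead c6 NOTES § BSS): in the blow-down of a spiky configuration at scale `L` only flat "coins"
(diameter `O(√(LR))`, sagitta) carry pairs at distance `≈ L`; coins pair coaxially, so every coin has
`O(R)` partner coins and `Sh(L) ≤ c Σ n_i² +` junk; heavy coins of a large spiky scale `L'` force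
`F(L) ≳ N·min(L', L²/R)` while the coins of scale `L` force `F(L) ≲ N·L·R²`, so all spiky scales lie
within a bounded ratio, where the coins fit inside `L_min`-balls and `F` can only grow by the bounded
factor `2c/κ` — against the forced growth `(1−κ)^{-1}` per spiky scale. -/

/-! ## Rev. 11 — lead c6, wave 2: C6a ⇐ core extraction (C6a1, provable now) + coin structure of a
uniformly `θ₁`-spiky core (C6a2, the bet refined): the `k`-core peeling of the shell graph charges every
discarded shell pair to a particle with shell count `≤ θ₁ ·` ball count, so only UNIFORMLY spiky
sub-configurations need coins. -/

/-- **C6a1 — core extraction (provable now; the `k`-core peeling of the shell graph).** For every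
`θ₁ > 0`, radius `L`, width `R` and finite configuration there is an index set `Y` (the core) such that
every `p ∈ Y` has MORE than `θ₁ ·` (particles within `L` of `x p`) shell-partners inside `Y`, while the
ordered shell pairs not inside `Y × Y` number at most `2 θ₁ ·` (ordered pairs at distance `≤ L`):
repeatedly delete a particle violating the core condition; each deletion discards at most `θ₁ w_p`
shell pairs in each order. -/
theorem stub_coreExtraction :
    ∀ (θ₁ L R : ℝ), 0 < θ₁ → ∀ (N : ℕ) (x : Fin N → E3), ∃ Y : Finset (Fin N),
      (∀ p ∈ Y, θ₁ * ((Finset.univ.filter fun q : Fin N => dist (x q) (x p) ≤ L).card : ℝ) <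
          ((Y.filter fun q : Fin N => L - R < dist (x q) (x p) ∧ dist (x q) (x p) ≤ L).card : ℝ)) ∧
      ((Finset.univ.filter fun p : Fin N × Fin N =>
          L - R < dist (x p.1) (x p.2) ∧ dist (x p.1) (x p.2) ≤ L).card : ℝ) ≤
        (((Y ×ˢ Y).filter fun p : Fin N × Fin N =>
            L - R < dist (x p.1) (x p.2) ∧ dist (x p.1) (x p.2) ≤ L).card : ℝ) +
          2 * θ₁ * ((Finset.univ.filter fun p : Fin N × Fin N => dist (x p.1) (x p.2) ≤ L).card : ℝ) :=
  -- LANDED p125289 (worker, lead c6 wave 2), Theorems/…LjLaminarWindowsCoreExtraction.lean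
  LjLaminarWindowsSketch.stub_coreExtraction

/-! ## Rev. 12 — lead c6, wave 3: C6a2 ⇐ pair charging (C6a3, provable now) + few small-class partners
(C6a4, the bet in POINTWISE form): charge each core shell pair to its endpoint with the larger label class;
then it suffices that every core particle has `≤ c ·`(own class size) core partners in classes not larger
than its own — e.g. because its partners meet `O(1)` classes (coherent coaxial families). -/

/-- **C6a3 — pair charging (provable now; AM–GM made combinatorial).** For any labelling and any index
set `Y`: if every `q ∈ Y` has at most `c ·` (size of its own label class) shell-partners `p ∈ Y` whose
class is not larger than the class of `q`, then the ordered shell pairs inside `Y × Y` number at most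
`2c ·` (ordered pairs with equal labels) — charge each pair to its endpoint with the larger class (the
shell relation is symmetric), and `Σ_q n_{lab q} = #{(p,q) : lab p = lab q}` (`c ≥ 0`). -/
theorem stub_pairCharging :
    ∀ (N : ℕ) (x : Fin N → E3) (L R c : ℝ) (Y : Finset (Fin N)) (lab : Fin N → ℕ), 0 ≤ c →
      (∀ q ∈ Y, ((Y.filter fun p : Fin N =>
          (L - R < dist (x p) (x q) ∧ dist (x p) (x q) ≤ L) ∧
            (Finset.univ.filter fun r : Fin N => lab r = lab p).card ≤
              (Finset.univ.filter fun r : Fin N => lab r = lab q).card).card : ℝ) ≤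
        c * ((Finset.univ.filter fun r : Fin N => lab r = lab q).card : ℝ)) →
      (((Y ×ˢ Y).filter fun p : Fin N × Fin N =>
          L - R < dist (x p.1) (x p.2) ∧ dist (x p.1) (x p.2) ≤ L).card : ℝ) ≤
        2 * c * ((Finset.univ.filter fun p : Fin N × Fin N => lab p.1 = lab p.2).card : ℝ) :=
  -- LANDED p125819 (worker, lead c6 wave 3), Theorems/…LjLaminarWindowsPairCharging.lean
  LjLaminarWindowsSketch.stub_pairCharging

/-! **C6a4 — few small-class partners (THE BET of lead c6, v3; pointwise form of the coin structure).**
From rev. 14a (lead c8) on C6a4 is NOT a registered stub but the explicit hypothesis `hFew` of the theorems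
`stub_coreCoins`, `stub_coinStructure`, `stub_boundedSpikes`, `LjLaminarWindows_of'`, `LjLaminarWindows_of''` below
(c6's chain stays a theorem-with-hypothesis; the registered cohesion input is the NSF branch)

For `θ₁ > 0`, `R ≥ 1` there are `c, C, L₀` such that at every scale `L ≥ L₀`, in every finite
`7/10`-separated `23/20`-connected configuration, for every index set `Y` all of whose members have
more than `θ₁ ·` (particles within `L`) shell-partners inside `Y`, some labelling of all particles by
flat coins (slab-discs of half-thickness `R`, radius `C √(L R)` in the frame of a linear isometry) gives
EVERY `q ∈ Y` at most `c ·` (size of its class) shell-partners `p ∈ Y` lying in classes not larger than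
the class of `q`.  Heuristic (lead NOTES § C6a): the partners of a core particle form `O(θ₁^{-2})`
coherent families (coaxial coins / their focal regions); label = (axis bin, aligned grid cell).
(Statement: the hypothesis `hFew` of `stub_coreCoins`.) -/


/-- C6a2 from C6a3 and C6a4 (constant `2c`). -/
theorem coreCoins_of_charging
    (hCh : ∀ (N : ℕ) (x : Fin N → E3) (L R c : ℝ) (Y : Finset (Fin N)) (lab : Fin N → ℕ), 0 ≤ c →
      (∀ q ∈ Y, ((Y.filter fun p : Fin N =>
          (L - R < dist (x p) (x q) ∧ dist (x p) (x q) ≤ L) ∧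
            (Finset.univ.filter fun r : Fin N => lab r = lab p).card ≤
              (Finset.univ.filter fun r : Fin N => lab r = lab q).card).card : ℝ) ≤
        c * ((Finset.univ.filter fun r : Fin N => lab r = lab q).card : ℝ)) →
      (((Y ×ˢ Y).filter fun p : Fin N × Fin N =>
          L - R < dist (x p.1) (x p.2) ∧ dist (x p.1) (x p.2) ≤ L).card : ℝ) ≤
        2 * c * ((Finset.univ.filter fun p : Fin N × Fin N => lab p.1 = lab p.2).card : ℝ))
    (hFew : ∀ θ₁ R : ℝ, 0 < θ₁ → 1 ≤ R → ∃ c C L₀ : ℝ, 0 < c ∧ 1 ≤ C ∧ ∀ L : ℝ, L₀ ≤ L →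
      ∀ (N : ℕ) (x : Fin N → E3),
      (∀ j k : Fin N, j ≠ k → (7 : ℝ) / 10 ≤ dist (x j) (x k)) →
      (∀ S : Finset (Fin N), S.Nonempty → Sᶜ.Nonempty →
          ∃ p ∈ S, ∃ k ∈ Sᶜ, dist (x p) (x k) ≤ 23 / 20) →
      ∀ Y : Finset (Fin N),
        (∀ p ∈ Y, θ₁ * ((Finset.univ.filter fun q : Fin N => dist (x q) (x p) ≤ L).card : ℝ) <
            ((Y.filter fun q : Fin N => L - R < dist (x q) (x p) ∧ dist (x q) (x p) ≤ L).card : ℝ)) →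
        ∃ lab : Fin N → ℕ,
          (∀ l : ℕ, ∃ (z : E3) (A : E3 →ₗᵢ[ℝ] E3), ∀ p : Fin N, lab p = l →
              |(A (x p - z)) 2| ≤ R ∧ dist (x p) z ≤ C * Real.sqrt (L * R)) ∧
          (∀ q ∈ Y, ((Y.filter fun p : Fin N =>
              (L - R < dist (x p) (x q) ∧ dist (x p) (x q) ≤ L) ∧
                (Finset.univ.filter fun r : Fin N => lab r = lab p).card ≤
                  (Finset.univ.filter fun r : Fin N => lab r = lab q).card).card : ℝ) ≤
            c * ((Finset.univ.filter fun r : Fin N => lab r = lab q).card : ℝ))) :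
    ∀ θ₁ R : ℝ, 0 < θ₁ → 1 ≤ R → ∃ c C L₀ : ℝ, 0 < c ∧ 1 ≤ C ∧ ∀ L : ℝ, L₀ ≤ L →
      ∀ (N : ℕ) (x : Fin N → E3),
      (∀ j k : Fin N, j ≠ k → (7 : ℝ) / 10 ≤ dist (x j) (x k)) →
      (∀ S : Finset (Fin N), S.Nonempty → Sᶜ.Nonempty →
          ∃ p ∈ S, ∃ k ∈ Sᶜ, dist (x p) (x k) ≤ 23 / 20) →
      ∀ Y : Finset (Fin N),
        (∀ p ∈ Y, θ₁ * ((Finset.univ.filter fun q : Fin N => dist (x q) (x p) ≤ L).card : ℝ) <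
            ((Y.filter fun q : Fin N => L - R < dist (x q) (x p) ∧ dist (x q) (x p) ≤ L).card : ℝ)) →
        ∃ lab : Fin N → ℕ,
          (∀ l : ℕ, ∃ (z : E3) (A : E3 →ₗᵢ[ℝ] E3), ∀ p : Fin N, lab p = l →
              |(A (x p - z)) 2| ≤ R ∧ dist (x p) z ≤ C * Real.sqrt (L * R)) ∧
          (((Y ×ˢ Y).filter fun p : Fin N × Fin N =>
              L - R < dist (x p.1) (x p.2) ∧ dist (x p.1) (x p.2) ≤ L).card : ℝ) ≤
            c * ((Finset.univ.filter fun p : Fin N × Fin N => lab p.1 = lab p.2).card : ℝ) := by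
  intro θ₁ R hθ hR
  obtain ⟨c, C, L₀, hc, hC, h⟩ := hFew θ₁ R hθ hR
  refine ⟨2 * c, C, L₀, by positivity, hC, fun L hL N x hsep hconn Y hY => ?_⟩
  obtain ⟨lab, hflat, hfew⟩ := h L hL N x hsep hconn Y hY
  exact ⟨lab, hflat, hCh N x L R c Y lab hc.le hfew⟩

/-- **C6a2 — coin structure of a uniformly spiky core (THE BET of lead c6, refined).** For `θ₁ > 0`,
`R ≥ 1` there are `c, C, L₀` such that at every scale `L ≥ L₀`, in every finite `7/10`-separated
`23/20`-connected configuration, every index set `Y` all of whose members have more than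
`θ₁ ·` (particles within `L`) shell-partners inside `Y` admits a labelling of all particles by flat
coins (slab-discs of half-thickness `R` and radius `C √(L R)` in the frame of a linear isometry) with:
ordered shell pairs inside `Y × Y` ≤ `c ·` (ordered pairs with equal labels).  Heuristic: near-exact-`L`
pairs of a uniformly spiky set come from coaxial pairs of flat coins (sagitta `√(LR)`), every coin has
`O(R)` partner coins, AM–GM. -/
theorem stub_coreCoins
    (hFew :
    ∀ θ₁ R : ℝ, 0 < θ₁ → 1 ≤ R → ∃ c C L₀ : ℝ, 0 < c ∧ 1 ≤ C ∧ ∀ L : ℝ, L₀ ≤ L →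
      ∀ (N : ℕ) (x : Fin N → E3),
      (∀ j k : Fin N, j ≠ k → (7 : ℝ) / 10 ≤ dist (x j) (x k)) →
      (∀ S : Finset (Fin N), S.Nonempty → Sᶜ.Nonempty →
          ∃ p ∈ S, ∃ k ∈ Sᶜ, dist (x p) (x k) ≤ 23 / 20) →
      ∀ Y : Finset (Fin N),
        (∀ p ∈ Y, θ₁ * ((Finset.univ.filter fun q : Fin N => dist (x q) (x p) ≤ L).card : ℝ) <
            ((Y.filter fun q : Fin N => L - R < dist (x q) (x p) ∧ dist (x q) (x p) ≤ L).card : ℝ)) →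
        ∃ lab : Fin N → ℕ,
          (∀ l : ℕ, ∃ (z : E3) (A : E3 →ₗᵢ[ℝ] E3), ∀ p : Fin N, lab p = l →
              |(A (x p - z)) 2| ≤ R ∧ dist (x p) z ≤ C * Real.sqrt (L * R)) ∧
          (∀ q ∈ Y, ((Y.filter fun p : Fin N =>
              (L - R < dist (x p) (x q) ∧ dist (x p) (x q) ≤ L) ∧
                (Finset.univ.filter fun r : Fin N => lab r = lab p).card ≤
                  (Finset.univ.filter fun r : Fin N => lab r = lab q).card).card : ℝ) ≤
            c * ((Finset.univ.filter fun r : Fin N => lab r = lab q).card : ℝ))) :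
    ∀ θ₁ R : ℝ, 0 < θ₁ → 1 ≤ R → ∃ c C L₀ : ℝ, 0 < c ∧ 1 ≤ C ∧ ∀ L : ℝ, L₀ ≤ L →
      ∀ (N : ℕ) (x : Fin N → E3),
      (∀ j k : Fin N, j ≠ k → (7 : ℝ) / 10 ≤ dist (x j) (x k)) →
      (∀ S : Finset (Fin N), S.Nonempty → Sᶜ.Nonempty →
          ∃ p ∈ S, ∃ k ∈ Sᶜ, dist (x p) (x k) ≤ 23 / 20) →
      ∀ Y : Finset (Fin N),
        (∀ p ∈ Y, θ₁ * ((Finset.univ.filter fun q : Fin N => dist (x q) (x p) ≤ L).card : ℝ) <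
            ((Y.filter fun q : Fin N => L - R < dist (x q) (x p) ∧ dist (x q) (x p) ≤ L).card : ℝ)) →
        ∃ lab : Fin N → ℕ,
          (∀ l : ℕ, ∃ (z : E3) (A : E3 →ₗᵢ[ℝ] E3), ∀ p : Fin N, lab p = l →
              |(A (x p - z)) 2| ≤ R ∧ dist (x p) z ≤ C * Real.sqrt (L * R)) ∧
          (((Y ×ˢ Y).filter fun p : Fin N × Fin N =>
              L - R < dist (x p.1) (x p.2) ∧ dist (x p.1) (x p.2) ≤ L).card : ℝ) ≤
            c * ((Finset.univ.filter fun p : Fin N × Fin N => lab p.1 = lab p.2).card : ℝ) :=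
  coreCoins_of_charging stub_pairCharging hFew

/-- C6a from C6a1 and C6a2 (`θ₁ := θ/2`). -/
theorem coinStructure_of_core
    (hCore : ∀ (θ₁ L R : ℝ), 0 < θ₁ → ∀ (N : ℕ) (x : Fin N → E3), ∃ Y : Finset (Fin N),
      (∀ p ∈ Y, θ₁ * ((Finset.univ.filter fun q : Fin N => dist (x q) (x p) ≤ L).card : ℝ) <
          ((Y.filter fun q : Fin N => L - R < dist (x q) (x p) ∧ dist (x q) (x p) ≤ L).card : ℝ)) ∧
      ((Finset.univ.filter fun p : Fin N × Fin N =>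
          L - R < dist (x p.1) (x p.2) ∧ dist (x p.1) (x p.2) ≤ L).card : ℝ) ≤
        (((Y ×ˢ Y).filter fun p : Fin N × Fin N =>
            L - R < dist (x p.1) (x p.2) ∧ dist (x p.1) (x p.2) ≤ L).card : ℝ) +
          2 * θ₁ * ((Finset.univ.filter fun p : Fin N × Fin N => dist (x p.1) (x p.2) ≤ L).card : ℝ))
    (hCoins : ∀ θ₁ R : ℝ, 0 < θ₁ → 1 ≤ R → ∃ c C L₀ : ℝ, 0 < c ∧ 1 ≤ C ∧ ∀ L : ℝ, L₀ ≤ L →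
      ∀ (N : ℕ) (x : Fin N → E3),
      (∀ j k : Fin N, j ≠ k → (7 : ℝ) / 10 ≤ dist (x j) (x k)) →
      (∀ S : Finset (Fin N), S.Nonempty → Sᶜ.Nonempty →
          ∃ p ∈ S, ∃ k ∈ Sᶜ, dist (x p) (x k) ≤ 23 / 20) →
      ∀ Y : Finset (Fin N),
        (∀ p ∈ Y, θ₁ * ((Finset.univ.filter fun q : Fin N => dist (x q) (x p) ≤ L).card : ℝ) <
            ((Y.filter fun q : Fin N => L - R < dist (x q) (x p) ∧ dist (x q) (x p) ≤ L).card : ℝ)) →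
        ∃ lab : Fin N → ℕ,
          (∀ l : ℕ, ∃ (z : E3) (A : E3 →ₗᵢ[ℝ] E3), ∀ p : Fin N, lab p = l →
              |(A (x p - z)) 2| ≤ R ∧ dist (x p) z ≤ C * Real.sqrt (L * R)) ∧
          (((Y ×ˢ Y).filter fun p : Fin N × Fin N =>
              L - R < dist (x p.1) (x p.2) ∧ dist (x p.1) (x p.2) ≤ L).card : ℝ) ≤
            c * ((Finset.univ.filter fun p : Fin N × Fin N => lab p.1 = lab p.2).card : ℝ)) :
    ∀ θ R : ℝ, 0 < θ → 1 ≤ R → ∃ c C L₀ : ℝ, 0 < c ∧ 1 ≤ C ∧ ∀ L : ℝ, L₀ ≤ L →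
      ∀ (N : ℕ) (x : Fin N → E3),
      (∀ j k : Fin N, j ≠ k → (7 : ℝ) / 10 ≤ dist (x j) (x k)) →
      (∀ S : Finset (Fin N), S.Nonempty → Sᶜ.Nonempty →
          ∃ p ∈ S, ∃ k ∈ Sᶜ, dist (x p) (x k) ≤ 23 / 20) →
      ∃ lab : Fin N → ℕ,
        (∀ l : ℕ, ∃ (z : E3) (A : E3 →ₗᵢ[ℝ] E3), ∀ p : Fin N, lab p = l →
            |(A (x p - z)) 2| ≤ R ∧ dist (x p) z ≤ C * Real.sqrt (L * R)) ∧
        ((Finset.univ.filter fun p : Fin N × Fin N =>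
            L - R < dist (x p.1) (x p.2) ∧ dist (x p.1) (x p.2) ≤ L).card : ℝ) ≤
          c * ((Finset.univ.filter fun p : Fin N × Fin N => lab p.1 = lab p.2).card : ℝ) +
            θ * ((Finset.univ.filter fun p : Fin N × Fin N => dist (x p.1) (x p.2) ≤ L).card : ℝ) := by
  intro θ R hθ hR
  obtain ⟨c, C, L₀, hc, hC, h⟩ := hCoins (θ / 2) R (by positivity) hR
  refine ⟨c, C, L₀, hc, hC, fun L hL N x hsep hconn => ?_⟩
  obtain ⟨Y, hY, hjunk⟩ := hCore (θ / 2) L R (by positivity) N x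
  obtain ⟨lab, hflat, hcount⟩ := h L hL N x hsep hconn Y hY
  refine ⟨lab, hflat, ?_⟩
  have e : 2 * (θ / 2) = θ := by ring
  rw [e] at hjunk
  linarith

/-- **C6a — coin structure at one scale (THE BET of lead c6; single-scale inverse theorem).**
For `θ > 0`, `R ≥ 1` there are `c, C, L₀` such that at every scale `L ≥ L₀` every finite
`7/10`-separated `23/20`-connected configuration of `ℝ³` admits a labelling of its points by "coins"
— each label class lies in a slab-disc of half-thickness `R` and radius `C √(L R)` (in the frame of some
linear isometry) — with: ordered pairs at distance in `(L − R, L]` ≤ `c ·` (ordered pairs with equal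
labels) `+ θ ·` (ordered pairs at distance `≤ L`).  Coin dumbbells / coaxial coin stacks: the coins
themselves; sheets, bulk, sparse nets, hedgehogs: the `θ`-junk term (every `L ≥ 6R/θ`). -/
theorem stub_coinStructure
    (hFew :
    ∀ θ₁ R : ℝ, 0 < θ₁ → 1 ≤ R → ∃ c C L₀ : ℝ, 0 < c ∧ 1 ≤ C ∧ ∀ L : ℝ, L₀ ≤ L →
      ∀ (N : ℕ) (x : Fin N → E3),
      (∀ j k : Fin N, j ≠ k → (7 : ℝ) / 10 ≤ dist (x j) (x k)) →
      (∀ S : Finset (Fin N), S.Nonempty → Sᶜ.Nonempty →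
          ∃ p ∈ S, ∃ k ∈ Sᶜ, dist (x p) (x k) ≤ 23 / 20) →
      ∀ Y : Finset (Fin N),
        (∀ p ∈ Y, θ₁ * ((Finset.univ.filter fun q : Fin N => dist (x q) (x p) ≤ L).card : ℝ) <
            ((Y.filter fun q : Fin N => L - R < dist (x q) (x p) ∧ dist (x q) (x p) ≤ L).card : ℝ)) →
        ∃ lab : Fin N → ℕ,
          (∀ l : ℕ, ∃ (z : E3) (A : E3 →ₗᵢ[ℝ] E3), ∀ p : Fin N, lab p = l →
              |(A (x p - z)) 2| ≤ R ∧ dist (x p) z ≤ C * Real.sqrt (L * R)) ∧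
          (∀ q ∈ Y, ((Y.filter fun p : Fin N =>
              (L - R < dist (x p) (x q) ∧ dist (x p) (x q) ≤ L) ∧
                (Finset.univ.filter fun r : Fin N => lab r = lab p).card ≤
                  (Finset.univ.filter fun r : Fin N => lab r = lab q).card).card : ℝ) ≤
            c * ((Finset.univ.filter fun r : Fin N => lab r = lab q).card : ℝ))) :
    ∀ θ R : ℝ, 0 < θ → 1 ≤ R → ∃ c C L₀ : ℝ, 0 < c ∧ 1 ≤ C ∧ ∀ L : ℝ, L₀ ≤ L →
      ∀ (N : ℕ) (x : Fin N → E3),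
      (∀ j k : Fin N, j ≠ k → (7 : ℝ) / 10 ≤ dist (x j) (x k)) →
      (∀ S : Finset (Fin N), S.Nonempty → Sᶜ.Nonempty →
          ∃ p ∈ S, ∃ k ∈ Sᶜ, dist (x p) (x k) ≤ 23 / 20) →
      ∃ lab : Fin N → ℕ,
        (∀ l : ℕ, ∃ (z : E3) (A : E3 →ₗᵢ[ℝ] E3), ∀ p : Fin N, lab p = l →
            |(A (x p - z)) 2| ≤ R ∧ dist (x p) z ≤ C * Real.sqrt (L * R)) ∧
        ((Finset.univ.filter fun p : Fin N × Fin N =>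
            L - R < dist (x p.1) (x p.2) ∧ dist (x p.1) (x p.2) ≤ L).card : ℝ) ≤
          c * ((Finset.univ.filter fun p : Fin N × Fin N => lab p.1 = lab p.2).card : ℝ) +
            θ * ((Finset.univ.filter fun p : Fin N × Fin N => dist (x p.1) (x p.2) ≤ L).card : ℝ) :=
  coinStructure_of_core stub_coreExtraction (stub_coreCoins hFew)

/-- **C6b — geometric growth along spiky scales** (provable now, pure real analysis): if a monotone
`F : ℝ → ℝ` gains more than a `κ`-fraction within the last `R` at every point of a finite
`R`-separated set `Λ`, then `F (min Λ) ≤ (1 − κ)^(#Λ − 1) · F (max Λ)`. -/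
theorem stub_spikyGrowth :
    ∀ (F : ℝ → ℝ), Monotone F → ∀ κ R : ℝ, 0 < κ → κ < 1 → 0 < R →
      ∀ (Λ : Finset ℝ) (hΛ : Λ.Nonempty),
        (∀ L ∈ Λ, ∀ L' ∈ Λ, L ≠ L' → R ≤ |L - L'|) →
        (∀ L ∈ Λ, κ * F L < F L - F (L - R)) →
        F (Λ.min' hΛ) ≤ (1 - κ) ^ (Λ.card - 1) * F (Λ.max' hΛ) :=
  -- LANDED p124433 (worker, lead c6 wave 1), Theorems/…LjLaminarWindowsSpikyGrowth.lean
  LjLaminarWindowsSketch.stub_spikyGrowth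

/-- **C6c — slab-disc packing** (provable now): a `7/10`-separated family of points lying, in the frame
of a linear isometry `A`, in the slab-disc `|(A (x − z))₂| ≤ R`, `|x − z| ≤ ρ` (`R, ρ ≥ 1`) has at
most `216 ρ² R` members (cells of side `2/5` hold at most one point each). -/
theorem stub_slabCount :
    ∀ (N : ℕ) (x : Fin N → E3), (∀ j k : Fin N, j ≠ k → (7 : ℝ) / 10 ≤ dist (x j) (x k)) →
      ∀ (R ρ : ℝ), 1 ≤ R → 1 ≤ ρ → ∀ (z : E3) (A : E3 →ₗᵢ[ℝ] E3) (S : Finset (Fin N)),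
        (∀ p ∈ S, |(A (x p - z)) 2| ≤ R ∧ dist (x p) z ≤ ρ) →
        (S.card : ℝ) ≤ 216 * ρ ^ 2 * R :=
  -- LANDED p124519 (worker, lead c6 wave 1), Theorems/…LjLaminarWindowsSlabCount.lean
  LjLaminarWindowsSketch.stub_slabCount

/-- **C6d — cell covering of a slab-disc** (provable now): for points in a slab-disc of
half-thickness `R` and radius `ρ` and a radius `L ≥ 4R`, Cauchy–Schwarz over the cells of side
`L/2` of the disc gives `(#S)² ≤ max 1 (64 ρ²/L²) · #{(p,q) ∈ S × S : |x_p − x_q| ≤ L}`. -/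
theorem stub_cellCover :
    ∀ (N : ℕ) (x : Fin N → E3) (R ρ L : ℝ), 1 ≤ R → 0 < ρ → 4 * R ≤ L →
      ∀ (z : E3) (A : E3 →ₗᵢ[ℝ] E3) (S : Finset (Fin N)),
        (∀ p ∈ S, |(A (x p - z)) 2| ≤ R ∧ dist (x p) z ≤ ρ) →
        (S.card : ℝ) ^ 2 ≤ max 1 (64 * ρ ^ 2 / L ^ 2) *
          (((S ×ˢ S).filter fun p : Fin N × Fin N => dist (x p.1) (x p.2) ≤ L).card : ℝ) :=
  -- LANDED p124649 (worker, lead c6 wave 1), Theorems/…LjLaminarWindowsCellCover.lean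
  LjLaminarWindowsSketch.stub_cellCover

/-- **C6e — spiky scales are comparable** (provable now from C6a's conclusion, C6c, C6d and the
landed path count): if the coin structure holds with junk fraction `κ/2`, then two `κ`-spiky scales
`L ≤ L'` beyond a threshold satisfy `L' ≤ C₆ L` — at scale `L` the flat coins give
`F(L) < (2c/κ)·216 C² L R² · N`, while the heavy coins of scale `L'` (classes with `≥ a L'` points,
carrying a fixed fraction of all points) give `F(L) ≥ c₅ N · min(L', L²/R)` by the cell covering. -/
theorem stub_coinScaleRatio
    (hSlab : ∀ (N : ℕ) (x : Fin N → E3), (∀ j k : Fin N, j ≠ k → (7 : ℝ) / 10 ≤ dist (x j) (x k)) →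
      ∀ (R ρ : ℝ), 1 ≤ R → 1 ≤ ρ → ∀ (z : E3) (A : E3 →ₗᵢ[ℝ] E3) (S : Finset (Fin N)),
        (∀ p ∈ S, |(A (x p - z)) 2| ≤ R ∧ dist (x p) z ≤ ρ) →
        (S.card : ℝ) ≤ 216 * ρ ^ 2 * R)
    (hCover : ∀ (N : ℕ) (x : Fin N → E3) (R ρ L : ℝ), 1 ≤ R → 0 < ρ → 4 * R ≤ L →
      ∀ (z : E3) (A : E3 →ₗᵢ[ℝ] E3) (S : Finset (Fin N)),
        (∀ p ∈ S, |(A (x p - z)) 2| ≤ R ∧ dist (x p) z ≤ ρ) →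
        (S.card : ℝ) ^ 2 ≤ max 1 (64 * ρ ^ 2 / L ^ 2) *
          (((S ×ˢ S).filter fun p : Fin N × Fin N => dist (x p.1) (x p.2) ≤ L).card : ℝ))
    (hPC : ∀ (N : ℕ) (x : Fin N → E3) (ρ : ℝ), 0 < ρ →
      (∀ S : Finset (Fin N), S.Nonempty → Sᶜ.Nonempty → ∃ p ∈ S, ∃ k ∈ Sᶜ, dist (x p) (x k) ≤ ρ) →
      ∀ (i : Fin N) (L : ℝ), 0 ≤ L → (∃ j : Fin N, L < dist (x j) (x i)) →
        L / ρ ≤ ((Finset.univ.filter fun j : Fin N => dist (x j) (x i) ≤ L).card : ℝ)) :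
    ∀ κ R c C L_I : ℝ, 0 < κ → 1 ≤ R → 0 < c → 1 ≤ C →
      (∀ L : ℝ, L_I ≤ L → ∀ (N : ℕ) (x : Fin N → E3),
        (∀ j k : Fin N, j ≠ k → (7 : ℝ) / 10 ≤ dist (x j) (x k)) →
        (∀ S : Finset (Fin N), S.Nonempty → Sᶜ.Nonempty →
            ∃ p ∈ S, ∃ k ∈ Sᶜ, dist (x p) (x k) ≤ 23 / 20) →
        ∃ lab : Fin N → ℕ,
          (∀ l : ℕ, ∃ (z : E3) (A : E3 →ₗᵢ[ℝ] E3), ∀ p : Fin N, lab p = l →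
              |(A (x p - z)) 2| ≤ R ∧ dist (x p) z ≤ C * Real.sqrt (L * R)) ∧
          ((Finset.univ.filter fun p : Fin N × Fin N =>
              L - R < dist (x p.1) (x p.2) ∧ dist (x p.1) (x p.2) ≤ L).card : ℝ) ≤
            c * ((Finset.univ.filter fun p : Fin N × Fin N => lab p.1 = lab p.2).card : ℝ) +
              κ / 2 * ((Finset.univ.filter fun p : Fin N × Fin N =>
                dist (x p.1) (x p.2) ≤ L).card : ℝ)) →
      ∃ C₆ L₁ : ℝ, 1 ≤ C₆ ∧ ∀ (N : ℕ) (x : Fin N → E3),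
        (∀ j k : Fin N, j ≠ k → (7 : ℝ) / 10 ≤ dist (x j) (x k)) →
        (∀ S : Finset (Fin N), S.Nonempty → Sᶜ.Nonempty →
            ∃ p ∈ S, ∃ k ∈ Sᶜ, dist (x p) (x k) ≤ 23 / 20) →
        ∀ L L' : ℝ, L₁ ≤ L → L ≤ L' →
          κ * ((Finset.univ.filter fun p : Fin N × Fin N => dist (x p.1) (x p.2) ≤ L).card : ℝ) <
            ((Finset.univ.filter fun p : Fin N × Fin N =>
                L - R < dist (x p.1) (x p.2) ∧ dist (x p.1) (x p.2) ≤ L).card : ℝ) →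
          κ * ((Finset.univ.filter fun p : Fin N × Fin N => dist (x p.1) (x p.2) ≤ L').card : ℝ) <
            ((Finset.univ.filter fun p : Fin N × Fin N =>
                L' - R < dist (x p.1) (x p.2) ∧ dist (x p.1) (x p.2) ≤ L').card : ℝ) →
          L' ≤ C₆ * L :=
  -- LANDED p124781 (worker, lead c6 wave 1), Theorems/…LjLaminarWindowsCoinScaleRatio.lean
  LjLaminarWindowsSketch.stub_coinScaleRatio hSlab hCover hPC

/-- **C6f — bounded spiky scales from the coin structure** (provable now; the cross-scale
accounting): coin structure (C6a) + geometric growth (C6b) + comparability of spiky scales (C6e's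
conclusion) ⇒ `stub_boundedSpikes`.  With `L₁ = min Λ` and `max Λ ≤ C₆ L₁`, every coin of every
scale in `Λ` has diameter `≤ 2C√(C₆ L₁ R) ≤ L₁`, so `F(L) < (2c/κ) F(L₁)` on `Λ`, against
`F(max Λ) ≥ (1−κ)^{−(#Λ−1)} F(L₁)`: `#Λ ≤ K₀` with `(1−κ)^{K₀} ≤ κ/(2c)` (`K₀ = 0` if `κ ≥ 1`). -/
theorem stub_bssOfCoins
    (hI : ∀ θ R : ℝ, 0 < θ → 1 ≤ R → ∃ c C L₀ : ℝ, 0 < c ∧ 1 ≤ C ∧ ∀ L : ℝ, L₀ ≤ L →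
      ∀ (N : ℕ) (x : Fin N → E3),
      (∀ j k : Fin N, j ≠ k → (7 : ℝ) / 10 ≤ dist (x j) (x k)) →
      (∀ S : Finset (Fin N), S.Nonempty → Sᶜ.Nonempty →
          ∃ p ∈ S, ∃ k ∈ Sᶜ, dist (x p) (x k) ≤ 23 / 20) →
      ∃ lab : Fin N → ℕ,
        (∀ l : ℕ, ∃ (z : E3) (A : E3 →ₗᵢ[ℝ] E3), ∀ p : Fin N, lab p = l →
            |(A (x p - z)) 2| ≤ R ∧ dist (x p) z ≤ C * Real.sqrt (L * R)) ∧
        ((Finset.univ.filter fun p : Fin N × Fin N =>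
            L - R < dist (x p.1) (x p.2) ∧ dist (x p.1) (x p.2) ≤ L).card : ℝ) ≤
          c * ((Finset.univ.filter fun p : Fin N × Fin N => lab p.1 = lab p.2).card : ℝ) +
            θ * ((Finset.univ.filter fun p : Fin N × Fin N => dist (x p.1) (x p.2) ≤ L).card : ℝ))
    (hG : ∀ (F : ℝ → ℝ), Monotone F → ∀ κ R : ℝ, 0 < κ → κ < 1 → 0 < R →
      ∀ (Λ : Finset ℝ) (hΛ : Λ.Nonempty),
        (∀ L ∈ Λ, ∀ L' ∈ Λ, L ≠ L' → R ≤ |L - L'|) →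
        (∀ L ∈ Λ, κ * F L < F L - F (L - R)) →
        F (Λ.min' hΛ) ≤ (1 - κ) ^ (Λ.card - 1) * F (Λ.max' hΛ))
    (hA : ∀ κ R c C L_I : ℝ, 0 < κ → 1 ≤ R → 0 < c → 1 ≤ C →
      (∀ L : ℝ, L_I ≤ L → ∀ (N : ℕ) (x : Fin N → E3),
        (∀ j k : Fin N, j ≠ k → (7 : ℝ) / 10 ≤ dist (x j) (x k)) →
        (∀ S : Finset (Fin N), S.Nonempty → Sᶜ.Nonempty →
            ∃ p ∈ S, ∃ k ∈ Sᶜ, dist (x p) (x k) ≤ 23 / 20) →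
        ∃ lab : Fin N → ℕ,
          (∀ l : ℕ, ∃ (z : E3) (A : E3 →ₗᵢ[ℝ] E3), ∀ p : Fin N, lab p = l →
              |(A (x p - z)) 2| ≤ R ∧ dist (x p) z ≤ C * Real.sqrt (L * R)) ∧
          ((Finset.univ.filter fun p : Fin N × Fin N =>
              L - R < dist (x p.1) (x p.2) ∧ dist (x p.1) (x p.2) ≤ L).card : ℝ) ≤
            c * ((Finset.univ.filter fun p : Fin N × Fin N => lab p.1 = lab p.2).card : ℝ) +
              κ / 2 * ((Finset.univ.filter fun p : Fin N × Fin N =>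
                dist (x p.1) (x p.2) ≤ L).card : ℝ)) →
      ∃ C₆ L₁ : ℝ, 1 ≤ C₆ ∧ ∀ (N : ℕ) (x : Fin N → E3),
        (∀ j k : Fin N, j ≠ k → (7 : ℝ) / 10 ≤ dist (x j) (x k)) →
        (∀ S : Finset (Fin N), S.Nonempty → Sᶜ.Nonempty →
            ∃ p ∈ S, ∃ k ∈ Sᶜ, dist (x p) (x k) ≤ 23 / 20) →
        ∀ L L' : ℝ, L₁ ≤ L → L ≤ L' →
          κ * ((Finset.univ.filter fun p : Fin N × Fin N => dist (x p.1) (x p.2) ≤ L).card : ℝ) <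
            ((Finset.univ.filter fun p : Fin N × Fin N =>
                L - R < dist (x p.1) (x p.2) ∧ dist (x p.1) (x p.2) ≤ L).card : ℝ) →
          κ * ((Finset.univ.filter fun p : Fin N × Fin N => dist (x p.1) (x p.2) ≤ L').card : ℝ) <
            ((Finset.univ.filter fun p : Fin N × Fin N =>
                L' - R < dist (x p.1) (x p.2) ∧ dist (x p.1) (x p.2) ≤ L').card : ℝ) →
          L' ≤ C₆ * L) :
    ∀ κ R : ℝ, 0 < κ → 1 ≤ R → ∃ (K₀ : ℕ) (L₀ : ℝ), ∀ (N : ℕ) (x : Fin N → E3),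
      (∀ j k : Fin N, j ≠ k → (7 : ℝ) / 10 ≤ dist (x j) (x k)) →
      (∀ S : Finset (Fin N), S.Nonempty → Sᶜ.Nonempty →
          ∃ p ∈ S, ∃ k ∈ Sᶜ, dist (x p) (x k) ≤ 23 / 20) →
      ∀ Λ : Finset ℝ, (∀ L ∈ Λ, L₀ ≤ L) → (∀ L ∈ Λ, ∀ L' ∈ Λ, L ≠ L' → R ≤ |L - L'|) →
        (∀ L ∈ Λ, κ * ((Finset.univ.filter fun p : Fin N × Fin N => dist (x p.1) (x p.2) ≤ L).card : ℝ) <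
            ((Finset.univ.filter fun p : Fin N × Fin N =>
                L - R < dist (x p.1) (x p.2) ∧ dist (x p.1) (x p.2) ≤ L).card : ℝ)) →
        Λ.card ≤ K₀ :=
  -- LANDED p124689 (worker, lead c6 wave 1), Theorems/…LjLaminarWindowsBssOfCoins.lean
  LjLaminarWindowsSketch.stub_bssOfCoins hI hG hA

/-- **C5f — bounded spiky scales** (the bet of lead c5, card `Ideas/subadditive-shells.md`; from
rev. 10 on PROVED modulo the single-scale coin-structure theorem C6a, by C6b–C6f and the landed path
count): for `κ > 0`, `R ≥ 1` there are `K₀`, `L₀` such that every finite `7/10`-separated,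
`23/20`-connected configuration in `ℝ³` is `κ`-spiky — the ordered pairs at distance in `(L − R, L]`
outnumber `κ` times the ordered pairs at distance `≤ L` — at no more than `K₀` pairwise `R`-separated
scales `L ≥ L₀`. -/
theorem stub_boundedSpikes
    (hFew :
    ∀ θ₁ R : ℝ, 0 < θ₁ → 1 ≤ R → ∃ c C L₀ : ℝ, 0 < c ∧ 1 ≤ C ∧ ∀ L : ℝ, L₀ ≤ L →
      ∀ (N : ℕ) (x : Fin N → E3),
      (∀ j k : Fin N, j ≠ k → (7 : ℝ) / 10 ≤ dist (x j) (x k)) →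
      (∀ S : Finset (Fin N), S.Nonempty → Sᶜ.Nonempty →
          ∃ p ∈ S, ∃ k ∈ Sᶜ, dist (x p) (x k) ≤ 23 / 20) →
      ∀ Y : Finset (Fin N),
        (∀ p ∈ Y, θ₁ * ((Finset.univ.filter fun q : Fin N => dist (x q) (x p) ≤ L).card : ℝ) <
            ((Y.filter fun q : Fin N => L - R < dist (x q) (x p) ∧ dist (x q) (x p) ≤ L).card : ℝ)) →
        ∃ lab : Fin N → ℕ,
          (∀ l : ℕ, ∃ (z : E3) (A : E3 →ₗᵢ[ℝ] E3), ∀ p : Fin N, lab p = l →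
              |(A (x p - z)) 2| ≤ R ∧ dist (x p) z ≤ C * Real.sqrt (L * R)) ∧
          (∀ q ∈ Y, ((Y.filter fun p : Fin N =>
              (L - R < dist (x p) (x q) ∧ dist (x p) (x q) ≤ L) ∧
                (Finset.univ.filter fun r : Fin N => lab r = lab p).card ≤
                  (Finset.univ.filter fun r : Fin N => lab r = lab q).card).card : ℝ) ≤
            c * ((Finset.univ.filter fun r : Fin N => lab r = lab q).card : ℝ))) :
    ∀ κ R : ℝ, 0 < κ → 1 ≤ R → ∃ (K₀ : ℕ) (L₀ : ℝ), ∀ (N : ℕ) (x : Fin N → E3),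
      (∀ j k : Fin N, j ≠ k → (7 : ℝ) / 10 ≤ dist (x j) (x k)) →
      (∀ S : Finset (Fin N), S.Nonempty → Sᶜ.Nonempty →
          ∃ p ∈ S, ∃ k ∈ Sᶜ, dist (x p) (x k) ≤ 23 / 20) →
      ∀ Λ : Finset ℝ, (∀ L ∈ Λ, L₀ ≤ L) → (∀ L ∈ Λ, ∀ L' ∈ Λ, L ≠ L' → R ≤ |L - L'|) →
        (∀ L ∈ Λ, κ * ((Finset.univ.filter fun p : Fin N × Fin N => dist (x p.1) (x p.2) ≤ L).card : ℝ) <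
            ((Finset.univ.filter fun p : Fin N × Fin N =>
                L - R < dist (x p.1) (x p.2) ∧ dist (x p.1) (x p.2) ≤ L).card : ℝ)) →
        Λ.card ≤ K₀ :=
  stub_bssOfCoins (stub_coinStructure hFew) stub_spikyGrowth
    (stub_coinScaleRatio stub_slabCount stub_cellCover LjLaminarWindowsSketch.stub_pathCount)

/-- **C5g — the glue of the alternative branch** (provable now, lead c5): a.e. laminarity (C5-independent
board item 14293) + bounded spiky scales + window removal + shell bound + path count ⇒ the crux (with the
landed `7/10`-separation and `(11/5)^{1/6}`-connectivity of ground states used inside the proof): unless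
`x^N` is spiky at scale `L`, Markov over centres gives a positive fraction of particles with thin boundary
shells, whose windows satisfy the energy clause by window removal; one of them is laminar; failing at
unboundedly many `L` would make all large `x^N` spiky at more than `K₀` separated scales. -/
theorem stub_glueC5
    (hLam : ∀ t R : ℝ, 0 < t → 0 < R → ∀ x : (N : ℕ) → (Fin N → EuclideanSpace ℝ (Fin 3)),
      (∀ N, IsGroundState lennardJones (x N)) →
      Filter.Tendsto (fun N : ℕ => (Nat.card {i : Fin N // ¬ (∃ n : EuclideanSpace ℝ (Fin 3),
        ‖n‖ = 1 ∧ ∃ c : ℤ → ℝ, (∀ k : ℤ, c k + 3 / 4 ≤ c (k + 1)) ∧ ∀ j : Fin N,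
          dist (x N j) (x N i) ≤ R → ∃ k : ℤ, |inner ℝ (x N j - x N i) n - c k| ≤ t)} : ℝ) / N)
        Filter.atTop (nhds 0))
    (hBSS : ∀ κ R : ℝ, 0 < κ → 1 ≤ R → ∃ (K₀ : ℕ) (L₀ : ℝ), ∀ (N : ℕ) (x : Fin N → E3),
      (∀ j k : Fin N, j ≠ k → (7 : ℝ) / 10 ≤ dist (x j) (x k)) →
      (∀ S : Finset (Fin N), S.Nonempty → Sᶜ.Nonempty →
          ∃ p ∈ S, ∃ k ∈ Sᶜ, dist (x p) (x k) ≤ 23 / 20) →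
      ∀ Λ : Finset ℝ, (∀ L ∈ Λ, L₀ ≤ L) → (∀ L ∈ Λ, ∀ L' ∈ Λ, L ≠ L' → R ≤ |L - L'|) →
        (∀ L ∈ Λ, κ * ((Finset.univ.filter fun p : Fin N × Fin N => dist (x p.1) (x p.2) ≤ L).card : ℝ) <
            ((Finset.univ.filter fun p : Fin N × Fin N =>
                L - R < dist (x p.1) (x p.2) ∧ dist (x p.1) (x p.2) ≤ L).card : ℝ)) →
        Λ.card ≤ K₀)
    (hWR : ∀ η : ℝ, 0 < η → ∃ k₀ : ℕ, ∀ (N : ℕ) (x : Fin N → E3), IsGroundState lennardJones x →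
      ∀ S : Finset (Fin N), k₀ ≤ S.card →
        ∑ i ∈ S, ∑ k ∈ S, lennardJones (dist (x i) (x k)) +
            2 * ∑ i ∈ S, ∑ k ∈ Sᶜ, lennardJones (dist (x i) (x k)) ≤
          2 * (eStar + η) * S.card)
    (hSB : ∀ ε : ℝ, 0 < ε → ∃ R C : ℝ, 1 ≤ R ∧ 0 < C ∧ ∀ (N : ℕ) (x : Fin N → E3),
      (∀ j k : Fin N, j ≠ k → (7 : ℝ) / 10 ≤ dist (x j) (x k)) → ∀ (i : Fin N) (L : ℝ),
        ∑ j ∈ Finset.univ.filter (fun j : Fin N => dist (x j) (x i) ≤ L),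
            ∑ k ∈ Finset.univ.filter (fun k : Fin N => ¬ dist (x k) (x i) ≤ L),
              max (-lennardJones (dist (x j) (x k))) 0 ≤
          ε * ((Finset.univ.filter fun j : Fin N => dist (x j) (x i) ≤ L).card : ℝ) +
            C * ((Finset.univ.filter fun j : Fin N =>
              L - R < dist (x j) (x i) ∧ dist (x j) (x i) ≤ L).card : ℝ))
    (hPC : ∀ (N : ℕ) (x : Fin N → E3) (ρ : ℝ), 0 < ρ →
      (∀ S : Finset (Fin N), S.Nonempty → Sᶜ.Nonempty → ∃ p ∈ S, ∃ k ∈ Sᶜ, dist (x p) (x k) ≤ ρ) →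
      ∀ (i : Fin N) (L : ℝ), 0 ≤ L → (∃ j : Fin N, L < dist (x j) (x i)) →
        L / ρ ≤ ((Finset.univ.filter fun j : Fin N => dist (x j) (x i) ≤ L).card : ℝ)) :
    ∀ x : (N : ℕ) → (Fin N → EuclideanSpace ℝ (Fin 3)), (∀ N, IsGroundState lennardJones (x N)) →
      ∀ η ε : ℝ, 0 < η → 0 < ε → ∃ L₀ : ℝ, ∀ L : ℝ, L₀ ≤ L → ∃ᶠ N in Filter.atTop,
        ∃ (i : Fin N) (A : EuclideanSpace ℝ (Fin 3) →ₗᵢ[ℝ] EuclideanSpace ℝ (Fin 3)) (T : Set ℝ),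
          (∀ t ∈ T, ∀ t' ∈ T, t ≠ t' → (3 : ℝ) / 4 ≤ |t - t'|) ∧
          (∀ j k : Fin N, j ≠ k → dist (x N j) (x N i) ≤ L → dist (x N k) (x N i) ≤ L →
            (7 : ℝ) / 10 ≤ dist (x N j) (x N k)) ∧
          (∀ j : Fin N, dist (x N j) (x N i) ≤ L → ∃ t ∈ T, |(A (x N j - x N i)) 2 - t| ≤ η) ∧
          (∑ j : Fin N, ∑ k : Fin N, if j ≠ k ∧ dist (x N j) (x N i) ≤ L ∧ dist (x N k) (x N i) ≤ L
              then lennardJones (dist (x N j) (x N k)) else 0) ≤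
            2 * ((⨅ Q : PeriodicConfiguration 3, Q.energyPerParticle lennardJones) + ε) *
              (Nat.card {j : Fin N // dist (x N j) (x N i) ≤ L} : ℝ) :=
  -- LANDED p122311 (lead c5), Theorems/…LjLaminarWindowsGlueC5.lean
  LjLaminarWindowsSketch.stub_glueC5 hLam hBSS hWR hSB hPC

/-! **C5f′ — bounded spiky scales OF GROUND STATES** (rev. 9's weaker fallback bet): from rev. 10 on
derived from `stub_boundedSpikes` by `boundedSpikesGS_of_boundedSpikes` (no longer a registered stub). -/

/-- The abstract bet implies the ground-state bet. -/
theorem boundedSpikesGS_of_boundedSpikes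
    (h : ∀ κ R : ℝ, 0 < κ → 1 ≤ R → ∃ (K₀ : ℕ) (L₀ : ℝ), ∀ (N : ℕ) (x : Fin N → E3),
      (∀ j k : Fin N, j ≠ k → (7 : ℝ) / 10 ≤ dist (x j) (x k)) →
      (∀ S : Finset (Fin N), S.Nonempty → Sᶜ.Nonempty →
          ∃ p ∈ S, ∃ k ∈ Sᶜ, dist (x p) (x k) ≤ 23 / 20) →
      ∀ Λ : Finset ℝ, (∀ L ∈ Λ, L₀ ≤ L) → (∀ L ∈ Λ, ∀ L' ∈ Λ, L ≠ L' → R ≤ |L - L'|) →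
        (∀ L ∈ Λ, κ * ((Finset.univ.filter fun p : Fin N × Fin N => dist (x p.1) (x p.2) ≤ L).card : ℝ) <
            ((Finset.univ.filter fun p : Fin N × Fin N =>
                L - R < dist (x p.1) (x p.2) ∧ dist (x p.1) (x p.2) ≤ L).card : ℝ)) →
        Λ.card ≤ K₀) :
    ∀ κ R : ℝ, 0 < κ → 1 ≤ R → ∃ (K₀ : ℕ) (L₀ : ℝ), ∀ (N : ℕ) (x : Fin N → E3),
      IsGroundState lennardJones x →
      (∀ j k : Fin N, j ≠ k → (7 : ℝ) / 10 ≤ dist (x j) (x k)) →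
      (∀ S : Finset (Fin N), S.Nonempty → Sᶜ.Nonempty →
          ∃ p ∈ S, ∃ k ∈ Sᶜ, dist (x p) (x k) ≤ 23 / 20) →
      ∀ Λ : Finset ℝ, (∀ L ∈ Λ, L₀ ≤ L) → (∀ L ∈ Λ, ∀ L' ∈ Λ, L ≠ L' → R ≤ |L - L'|) →
        (∀ L ∈ Λ, κ * ((Finset.univ.filter fun p : Fin N × Fin N => dist (x p.1) (x p.2) ≤ L).card : ℝ) <
            ((Finset.univ.filter fun p : Fin N × Fin N =>
                L - R < dist (x p.1) (x p.2) ∧ dist (x p.1) (x p.2) ≤ L).card : ℝ)) →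
        Λ.card ≤ K₀ := by
  intro κ R hκ hR
  obtain ⟨K₀, L₀, hK⟩ := h κ R hκ hR
  exact ⟨K₀, L₀, fun N x _ => hK N x⟩

/-- **C5g′ — the glue with the ground-state form of the bet** (lead c5; proved in `work/GlueC5GS.lean`,
landing as `LjLaminarWindowsSketch.stub_glueC5GS`). -/
theorem stub_glueC5GS
    (hLam : ∀ t R : ℝ, 0 < t → 0 < R → ∀ x : (N : ℕ) → (Fin N → EuclideanSpace ℝ (Fin 3)),
      (∀ N, IsGroundState lennardJones (x N)) →
      Filter.Tendsto (fun N : ℕ => (Nat.card {i : Fin N // ¬ (∃ n : EuclideanSpace ℝ (Fin 3),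
        ‖n‖ = 1 ∧ ∃ c : ℤ → ℝ, (∀ k : ℤ, c k + 3 / 4 ≤ c (k + 1)) ∧ ∀ j : Fin N,
          dist (x N j) (x N i) ≤ R → ∃ k : ℤ, |inner ℝ (x N j - x N i) n - c k| ≤ t)} : ℝ) / N)
        Filter.atTop (nhds 0))
    (hBSS : ∀ κ R : ℝ, 0 < κ → 1 ≤ R → ∃ (K₀ : ℕ) (L₀ : ℝ), ∀ (N : ℕ) (x : Fin N → E3),
      IsGroundState lennardJones x →
      (∀ j k : Fin N, j ≠ k → (7 : ℝ) / 10 ≤ dist (x j) (x k)) →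
      (∀ S : Finset (Fin N), S.Nonempty → Sᶜ.Nonempty →
          ∃ p ∈ S, ∃ k ∈ Sᶜ, dist (x p) (x k) ≤ 23 / 20) →
      ∀ Λ : Finset ℝ, (∀ L ∈ Λ, L₀ ≤ L) → (∀ L ∈ Λ, ∀ L' ∈ Λ, L ≠ L' → R ≤ |L - L'|) →
        (∀ L ∈ Λ, κ * ((Finset.univ.filter fun p : Fin N × Fin N => dist (x p.1) (x p.2) ≤ L).card : ℝ) <
            ((Finset.univ.filter fun p : Fin N × Fin N =>
                L - R < dist (x p.1) (x p.2) ∧ dist (x p.1) (x p.2) ≤ L).card : ℝ)) →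
        Λ.card ≤ K₀)
    (hWR : ∀ η : ℝ, 0 < η → ∃ k₀ : ℕ, ∀ (N : ℕ) (x : Fin N → E3), IsGroundState lennardJones x →
      ∀ S : Finset (Fin N), k₀ ≤ S.card →
        ∑ i ∈ S, ∑ k ∈ S, lennardJones (dist (x i) (x k)) +
            2 * ∑ i ∈ S, ∑ k ∈ Sᶜ, lennardJones (dist (x i) (x k)) ≤
          2 * (eStar + η) * S.card)
    (hSB : ∀ ε : ℝ, 0 < ε → ∃ R C : ℝ, 1 ≤ R ∧ 0 < C ∧ ∀ (N : ℕ) (x : Fin N → E3),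
      (∀ j k : Fin N, j ≠ k → (7 : ℝ) / 10 ≤ dist (x j) (x k)) → ∀ (i : Fin N) (L : ℝ),
        ∑ j ∈ Finset.univ.filter (fun j : Fin N => dist (x j) (x i) ≤ L),
            ∑ k ∈ Finset.univ.filter (fun k : Fin N => ¬ dist (x k) (x i) ≤ L),
              max (-lennardJones (dist (x j) (x k))) 0 ≤
          ε * ((Finset.univ.filter fun j : Fin N => dist (x j) (x i) ≤ L).card : ℝ) +
            C * ((Finset.univ.filter fun j : Fin N =>
              L - R < dist (x j) (x i) ∧ dist (x j) (x i) ≤ L).card : ℝ))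
    (hPC : ∀ (N : ℕ) (x : Fin N → E3) (ρ : ℝ), 0 < ρ →
      (∀ S : Finset (Fin N), S.Nonempty → Sᶜ.Nonempty → ∃ p ∈ S, ∃ k ∈ Sᶜ, dist (x p) (x k) ≤ ρ) →
      ∀ (i : Fin N) (L : ℝ), 0 ≤ L → (∃ j : Fin N, L < dist (x j) (x i)) →
        L / ρ ≤ ((Finset.univ.filter fun j : Fin N => dist (x j) (x i) ≤ L).card : ℝ)) :
    ∀ x : (N : ℕ) → (Fin N → EuclideanSpace ℝ (Fin 3)), (∀ N, IsGroundState lennardJones (x N)) →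
      ∀ η ε : ℝ, 0 < η → 0 < ε → ∃ L₀ : ℝ, ∀ L : ℝ, L₀ ≤ L → ∃ᶠ N in Filter.atTop,
        ∃ (i : Fin N) (A : EuclideanSpace ℝ (Fin 3) →ₗᵢ[ℝ] EuclideanSpace ℝ (Fin 3)) (T : Set ℝ),
          (∀ t ∈ T, ∀ t' ∈ T, t ≠ t' → (3 : ℝ) / 4 ≤ |t - t'|) ∧
          (∀ j k : Fin N, j ≠ k → dist (x N j) (x N i) ≤ L → dist (x N k) (x N i) ≤ L →
            (7 : ℝ) / 10 ≤ dist (x N j) (x N k)) ∧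
          (∀ j : Fin N, dist (x N j) (x N i) ≤ L → ∃ t ∈ T, |(A (x N j - x N i)) 2 - t| ≤ η) ∧
          (∑ j : Fin N, ∑ k : Fin N, if j ≠ k ∧ dist (x N j) (x N i) ≤ L ∧ dist (x N k) (x N i) ≤ L
              then lennardJones (dist (x N j) (x N k)) else 0) ≤
            2 * ((⨅ Q : PeriodicConfiguration 3, Q.energyPerParticle lennardJones) + ε) *
              (Nat.card {j : Fin N // dist (x N j) (x N i) ≤ L} : ℝ) :=
  -- LANDED p122563 (lead c5), Theorems/…LjLaminarWindowsGlueC5GS.lean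
  LjLaminarWindowsSketch.stub_glueC5GS hLam hBSS hWR hSB hPC

/-! ## Rev. 14 — lead c8: the NSF branch (single-scale, pointwise cohesion input)

Observation (lead c7, verified by c8): if the crux fails at scale `L` for all large `N`, then every LAMINAR particle `i`
of `x^N` is pointwise `θ`-spiky at scale `L` — its boundary shell `L − R < |x_j − x_i| ≤ L` holds more than `θ ·`
(its closed `L`-ball) particles — because window removal (`stub_windowRemoval`, p121733) and the shell bound
(`stub_shellBound`, p122286) give the energy clause at every NON-spiky particle (`θ = ε/(4C)`, `R = R(ε/4)`).  Hence the
crux follows from a.e. laminarity (14293) and the pure-geometry statement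

  NSF: for `θ ∈ (0,1)`, `R ≥ 1` there is `L₀` such that for every `L ≥ L₀` there are `δ > 0`, `N₀` with: every finite
  `7/10`-separated `23/20`-connected configuration of `N ≥ N₀` points in `ℝ³` has at least `δ N` particles that are NOT
  `θ`-spiky at scale `L`.

Proof plan for NSF (lead c8, this skeleton; all four stubs provable now):
* `stub_thickCircle` (TC) — the points of a `7/10`-separated set lying in the intersection of two spherical shells
  (radius `L`, thickness `R`, centres `d ∈ [4R, L/2]` apart) and in a ball of radius `r` number
  `≤ 10⁴ (r + √(LR)) R² (L/d + 1)` (cover the thick circle by spherical rectangles, box count `slabCount_card_le_prod`);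
* `bonferroni` (proved here) — `Σ #A_i ≤ #(⋃ A_i) + Σ_{j<i} #(A_i ∩ A_j)`;
* `stub_massBound` (Stage A) — if all particles within `2L²` of `p₀` are spiky then every `2L`-ball centred within `L²`
  of `p₀` holds `≤ M₁ L` particles (`M₁ = C R²/θ³`): Bonferroni over `m = O(1/θ)` ring points `q_i ∈ X ∩ B_{L/10}(a)`
  (pairwise `≥ L/(10(2m+1))` apart, by connectivity) whose shells each hold `> θ #B_{0.9L}(a)` particles forces either a
  thick circle with many points (excluded by TC) or a light inner ball; a walk to a weighted maximiser of the `1.1L`-ball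
  count turns this into the uniform bound;
* `stub_sparseAllSpiky` (Stage B) — in that sparse regime an all-spiky `L`-neighbourhood is impossible: every heavy
  `c_r L`-blob serves the `m` ring points with total weight `≤` its mass `+ O(m² c_r L)` (Bonferroni inside the blob + TC),
  so most ring points are served by the diffuse remainder, whose second- and third-level Bonferroni charge `≥ θL/m³`
  diffuse points to the intersection of two DISTINCT thick circles — empty when the three centres involved are nearly
  collinear, inside two `c_r L`-balls (hence `< 2c₂L` diffuse points) otherwise;
* `stub_nsfReduction` — NSF from Stage A + Stage B (if fewer than `δN` particles are non-spiky, some `p₀` has an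
  all-spiky `(2L²+2L)`-neighbourhood; `N ≥ N₀ > M₁L` supplies a far particle);
* `stub_glueNSF` — 14293 ∧ NSF ∧ window removal ∧ shell bound ∧ path count ⇒ crux (pigeonhole replaces the Markov
  step and the scales game of `stub_glueC5`).
Composition: `LjLaminarWindows_of''' := stub_glueNSF stub_laminarity nsf_holds stub_windowRemoval stub_shellBound stub_pathCount`.
-/

/-- **Bonferroni's second inequality for finite sets** (proved; used by Stages A and B as a hypothesis):
`Σ_{i<m} #A_i ≤ #(⋃_{i<m} A_i) + Σ_{i<m} Σ_{j<i} #(A_i ∩ A_j)`. [folklore] -/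
theorem bonferroni :
    ∀ (N m : ℕ) (A : ℕ → Finset (Fin N)),
      ∑ i ∈ Finset.range m, ((A i).card : ℝ) ≤
        (((Finset.range m).biUnion A).card : ℝ) +
          ∑ i ∈ Finset.range m, ∑ j ∈ Finset.range i, ((A i ∩ A j).card : ℝ) := by
  intro N m A
  have key : ∀ m : ℕ, ∑ i ∈ Finset.range m, (A i).card ≤
      ((Finset.range m).biUnion A).card + ∑ i ∈ Finset.range m, ∑ j ∈ Finset.range i, (A i ∩ A j).card := by
    intro m
    induction m with
    | zero => simp
    | succ m ih =>
      rw [Finset.sum_range_succ, Finset.sum_range_succ, Finset.range_add_one, Finset.biUnion_insert]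
      set U : Finset (Fin N) := (Finset.range m).biUnion A with hU
      have h1 : (A m ∪ U).card + (A m ∩ U).card = (A m).card + U.card := Finset.card_union_add_card_inter _ _
      have h2 : (A m ∩ U).card ≤ ∑ j ∈ Finset.range m, (A m ∩ A j).card := by
        have e : A m ∩ U = (Finset.range m).biUnion fun j => A m ∩ A j := by
          rw [hU, Finset.inter_biUnion]
        rw [e]
        exact Finset.card_biUnion_le
      omega
  exact_mod_cast key m

/-- **TC — thick-circle count (provable now; stub of lead c8).** In a `7/10`-separated configuration, for radii
`1 ≤ R`, `100 R ≤ L` and two centres `q, q'` at distance `d ∈ [4R, L/2]`, the particles lying in BOTH spherical shells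
`L − R < |· − q| ≤ L`, `L − R < |· − q'| ≤ L` and in the ball `|· − z| ≤ r` number at most
`10⁴ (r + √(L R)) R² (L/d + 1)`.  (The intersection of the two shells is a tube of cross-section `≈ R × 2LR/d` around a
circle of radius `≈ L`; cover it by spherical rectangles of angular size `√(R/L)` — adapted orthonormal frames, polar
angle from the axis `q' − q`, azimuth — and count each piece with `slabCount_card_le_prod`.) -/
theorem stub_thickCircle :
    ∀ (N : ℕ) (x : Fin N → E3), (∀ j k : Fin N, j ≠ k → (7 : ℝ) / 10 ≤ dist (x j) (x k)) →
      ∀ (L R : ℝ), 1 ≤ R → 100 * R ≤ L →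
      ∀ (q q' z : E3) (r : ℝ), 4 * R ≤ dist q q' → dist q q' ≤ L / 2 → 0 ≤ r →
        ((Finset.univ.filter fun j : Fin N =>
            (L - R < dist (x j) q ∧ dist (x j) q ≤ L) ∧ (L - R < dist (x j) q' ∧ dist (x j) q' ≤ L) ∧
              dist (x j) z ≤ r).card : ℝ) ≤
          10000 * (r + Real.sqrt (L * R)) * R ^ 2 * (L / dist q q' + 1) :=
  -- LANDED (lead c8, rev 15)
  LjLaminarWindowsSketch.stub_thickCircle

/-- **Stage A — mass bound in an all-spiky region (provable now from TC + Bonferroni; stub of lead c8).**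
For `θ ∈ (0,1)`, `R ≥ 1` there are `M₁ > 0` and `L₁` such that for `L ≥ L₁`, in every finite `7/10`-separated
`23/20`-connected configuration: if every particle within `2L²` of `x_{p₀}` is `θ`-spiky at scale `L` (shell
`(L − R, L]`), then every closed `2L`-ball centred at a particle within `L²` of `x_{p₀}` holds at most `M₁ L` particles.
(Ring points + Bonferroni + TC give, at any particle `a` of the region, `#B_{1.1L}(a) ≥ m θ #B_{0.9L}(a) − O(m³ L R²)`;
at a weighted maximiser `q*` of `y ↦ #B_{1.1L}(y) 2^{−|y − q|/L}` some `a` within `1.1L` has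
`#B_{0.9L}(a) ≥ #B_{1.1L}(q*)/41`, whence `#B_{1.1L}(q*) = O(L R²/θ³)` for `m = ⌈180/θ⌉`.) -/
theorem stub_massBound
    (hTC : ∀ (N : ℕ) (x : Fin N → E3), (∀ j k : Fin N, j ≠ k → (7 : ℝ) / 10 ≤ dist (x j) (x k)) →
      ∀ (L R : ℝ), 1 ≤ R → 100 * R ≤ L →
      ∀ (q q' z : E3) (r : ℝ), 4 * R ≤ dist q q' → dist q q' ≤ L / 2 → 0 ≤ r →
        ((Finset.univ.filter fun j : Fin N =>
            (L - R < dist (x j) q ∧ dist (x j) q ≤ L) ∧ (L - R < dist (x j) q' ∧ dist (x j) q' ≤ L) ∧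
              dist (x j) z ≤ r).card : ℝ) ≤
          10000 * (r + Real.sqrt (L * R)) * R ^ 2 * (L / dist q q' + 1))
    (hBonf : ∀ (N m : ℕ) (A : ℕ → Finset (Fin N)),
      ∑ i ∈ Finset.range m, ((A i).card : ℝ) ≤
        (((Finset.range m).biUnion A).card : ℝ) +
          ∑ i ∈ Finset.range m, ∑ j ∈ Finset.range i, ((A i ∩ A j).card : ℝ)) :
    ∀ θ R : ℝ, 0 < θ → θ < 1 → 1 ≤ R → ∃ M₁ L₁ : ℝ, 0 < M₁ ∧ ∀ L : ℝ, L₁ ≤ L →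
      ∀ (N : ℕ) (x : Fin N → E3),
      (∀ j k : Fin N, j ≠ k → (7 : ℝ) / 10 ≤ dist (x j) (x k)) →
      (∀ S : Finset (Fin N), S.Nonempty → Sᶜ.Nonempty →
          ∃ p ∈ S, ∃ k ∈ Sᶜ, dist (x p) (x k) ≤ 23 / 20) →
      ∀ p₀ : Fin N,
        (∀ p : Fin N, dist (x p) (x p₀) ≤ 2 * L ^ 2 →
          θ * ((Finset.univ.filter fun q : Fin N => dist (x q) (x p) ≤ L).card : ℝ) <
            ((Finset.univ.filter fun q : Fin N =>
              L - R < dist (x q) (x p) ∧ dist (x q) (x p) ≤ L).card : ℝ)) →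
        ∀ q : Fin N, dist (x q) (x p₀) ≤ L ^ 2 →
          ((Finset.univ.filter fun j : Fin N => dist (x j) (x q) ≤ 2 * L).card : ℝ) ≤ M₁ * L :=
  -- LANDED (lead c8, rev 15)
  LjLaminarWindowsSketch.stub_massBound hTC hBonf

/-- **TT — triple thick-sphere intersection (provable now; stub of lead c8, pure Euclidean geometry of `ℝ³`).**
For `cr > 0`, `K ≥ 1` there is `L₃` such that for `R ≥ 1`, `L ≥ L₃ R` and three centres `a, b, c` with pairwise
distances in `[D, L/5]`, `L ≤ K D`: the common part of the three thick spheres `L − R < |· − a|, |· − b|, |· − c| ≤ L` lies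
in the union of two balls of radius `cr L`.  (Write `y = m + t e + ϱ(α₁ f + α₂ g)` with `m` the midpoint of `a b`,
`e = (b − a)/|b − a|`, `(e,f,g)` orthonormal, `f` along the `⊥e`-part of `c − m`: the first two constraints give
`|t| ≤ L R/D ≤ K R` and pin `ϱ` within `2R`; with `w := dist (c, line a b)`: if `w ≥ w₀ := C(K) R/cr²` the third pins
`α₁` within `Δ ≤ cr²/54` hence `α₂ = ±√(1 − α₁²)` within `√(2Δ)` — two balls; if `w < w₀` the third constraint is
incompatible with the first (`|s² − d²/4| ≥ D²/4 ≫ L R (2 + K + w₀/R)`), the intersection is empty.) -/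
theorem stub_tripleShell :
    ∀ (cr K : ℝ), 0 < cr → 1 ≤ K → ∃ L₃ : ℝ, ∀ (L R D : ℝ), 1 ≤ R → L₃ * R ≤ L → L ≤ K * D →
      ∀ (a b c : E3), D ≤ dist a b → D ≤ dist a c → D ≤ dist b c →
        dist a b ≤ L / 5 → dist a c ≤ L / 5 → dist b c ≤ L / 5 →
        ∃ y₁ y₂ : E3, ∀ y : E3,
          L - R < dist y a → dist y a ≤ L → L - R < dist y b → dist y b ≤ L →
          L - R < dist y c → dist y c ≤ L →
          dist y y₁ ≤ cr * L ∨ dist y y₂ ≤ cr * L :=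
  -- LANDED (lead c8, rev 15)
  LjLaminarWindowsSketch.stub_tripleShell

/-- **Stage B — an all-spiky neighbourhood is impossible in the sparse regime (provable now from TC + Bonferroni;
stub of lead c8, the lead's own stub; from TC + Bonferroni + TT).**  For `θ ∈ (0,1)`, `R ≥ 1`, `M₁ > 0` there is `L₂` such that for `L ≥ L₂`,
in a finite `7/10`-separated `23/20`-connected configuration there is NO particle `a` such that every particle within
`L` of `x_a` is `θ`-spiky at scale `L`, the closed `2L`-ball about `x_a` holds `≤ M₁ L` particles, and some particle
lies beyond `2L` from `x_a`.  (Ring points `q_1..q_m` within `L/10` of `a`; heavy `c_r L`-blobs serve them with total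
weight `≤` mass `+ O(m² c_r L)`; the diffuse remainder charges `≥ θL/m³` points to the intersection of two distinct thick
circles, which is empty or inside two `c_r L`-balls holding `< 2c₂ L` diffuse points; constants `m, c₂, c_r` in this
order.) -/
theorem stub_sparseAllSpiky
    (hTC : ∀ (N : ℕ) (x : Fin N → E3), (∀ j k : Fin N, j ≠ k → (7 : ℝ) / 10 ≤ dist (x j) (x k)) →
      ∀ (L R : ℝ), 1 ≤ R → 100 * R ≤ L →
      ∀ (q q' z : E3) (r : ℝ), 4 * R ≤ dist q q' → dist q q' ≤ L / 2 → 0 ≤ r →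
        ((Finset.univ.filter fun j : Fin N =>
            (L - R < dist (x j) q ∧ dist (x j) q ≤ L) ∧ (L - R < dist (x j) q' ∧ dist (x j) q' ≤ L) ∧
              dist (x j) z ≤ r).card : ℝ) ≤
          10000 * (r + Real.sqrt (L * R)) * R ^ 2 * (L / dist q q' + 1))
    (hBonf : ∀ (N m : ℕ) (A : ℕ → Finset (Fin N)),
      ∑ i ∈ Finset.range m, ((A i).card : ℝ) ≤
        (((Finset.range m).biUnion A).card : ℝ) +
          ∑ i ∈ Finset.range m, ∑ j ∈ Finset.range i, ((A i ∩ A j).card : ℝ))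
    (hTT :
  ∀ (cr K : ℝ), 0 < cr → 1 ≤ K → ∃ L₃ : ℝ, ∀ (L R D : ℝ), 1 ≤ R → L₃ * R ≤ L → L ≤ K * D →
      ∀ (a b c : E3), D ≤ dist a b → D ≤ dist a c → D ≤ dist b c →
        dist a b ≤ L / 5 → dist a c ≤ L / 5 → dist b c ≤ L / 5 →
        ∃ y₁ y₂ : E3, ∀ y : E3,
          L - R < dist y a → dist y a ≤ L → L - R < dist y b → dist y b ≤ L →
          L - R < dist y c → dist y c ≤ L →
          dist y y₁ ≤ cr * L ∨ dist y y₂ ≤ cr * L) :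
    ∀ θ R M₁ : ℝ, 0 < θ → θ < 1 → 1 ≤ R → 0 < M₁ → ∃ L₂ : ℝ, ∀ L : ℝ, L₂ ≤ L →
      ∀ (N : ℕ) (x : Fin N → E3),
      (∀ j k : Fin N, j ≠ k → (7 : ℝ) / 10 ≤ dist (x j) (x k)) →
      (∀ S : Finset (Fin N), S.Nonempty → Sᶜ.Nonempty →
          ∃ p ∈ S, ∃ k ∈ Sᶜ, dist (x p) (x k) ≤ 23 / 20) →
      ∀ a : Fin N,
        (∀ p : Fin N, dist (x p) (x a) ≤ L →
          θ * ((Finset.univ.filter fun q : Fin N => dist (x q) (x p) ≤ L).card : ℝ) <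
            ((Finset.univ.filter fun q : Fin N =>
              L - R < dist (x q) (x p) ∧ dist (x q) (x p) ≤ L).card : ℝ)) →
        ((Finset.univ.filter fun j : Fin N => dist (x j) (x a) ≤ 2 * L).card : ℝ) ≤ M₁ * L →
        (∃ j : Fin N, 2 * L < dist (x j) (x a)) → False :=
  -- LANDED (lead c8, rev 15)
  LjLaminarWindowsSketch.stub_sparseAllSpiky hTC hBonf hTT

/-- **NSF reduction (provable now; stub of lead c8).** The non-spiky-fraction statement NSF from Stage A and
Stage B: with `δ = 1/(2 (2(2L²+2L)/(7/10) + 1)³)` and `N₀ > M₁ L`, if fewer than `δ N` particles were non-spiky then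
some particle `p₀` would have no non-spiky particle within `2L² + 2L` (packing), Stage A would bound the `2L`-ball at
`p₀` by `M₁ L < N` (so a far particle exists), and Stage B would give a contradiction. -/
theorem stub_nsfReduction
    (hMB : ∀ θ R : ℝ, 0 < θ → θ < 1 → 1 ≤ R → ∃ M₁ L₁ : ℝ, 0 < M₁ ∧ ∀ L : ℝ, L₁ ≤ L →
      ∀ (N : ℕ) (x : Fin N → E3),
      (∀ j k : Fin N, j ≠ k → (7 : ℝ) / 10 ≤ dist (x j) (x k)) →
      (∀ S : Finset (Fin N), S.Nonempty → Sᶜ.Nonempty →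
          ∃ p ∈ S, ∃ k ∈ Sᶜ, dist (x p) (x k) ≤ 23 / 20) →
      ∀ p₀ : Fin N,
        (∀ p : Fin N, dist (x p) (x p₀) ≤ 2 * L ^ 2 →
          θ * ((Finset.univ.filter fun q : Fin N => dist (x q) (x p) ≤ L).card : ℝ) <
            ((Finset.univ.filter fun q : Fin N =>
              L - R < dist (x q) (x p) ∧ dist (x q) (x p) ≤ L).card : ℝ)) →
        ∀ q : Fin N, dist (x q) (x p₀) ≤ L ^ 2 →
          ((Finset.univ.filter fun j : Fin N => dist (x j) (x q) ≤ 2 * L).card : ℝ) ≤ M₁ * L)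
    (hSP : ∀ θ R M₁ : ℝ, 0 < θ → θ < 1 → 1 ≤ R → 0 < M₁ → ∃ L₂ : ℝ, ∀ L : ℝ, L₂ ≤ L →
      ∀ (N : ℕ) (x : Fin N → E3),
      (∀ j k : Fin N, j ≠ k → (7 : ℝ) / 10 ≤ dist (x j) (x k)) →
      (∀ S : Finset (Fin N), S.Nonempty → Sᶜ.Nonempty →
          ∃ p ∈ S, ∃ k ∈ Sᶜ, dist (x p) (x k) ≤ 23 / 20) →
      ∀ a : Fin N,
        (∀ p : Fin N, dist (x p) (x a) ≤ L →
          θ * ((Finset.univ.filter fun q : Fin N => dist (x q) (x p) ≤ L).card : ℝ) <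
            ((Finset.univ.filter fun q : Fin N =>
              L - R < dist (x q) (x p) ∧ dist (x q) (x p) ≤ L).card : ℝ)) →
        ((Finset.univ.filter fun j : Fin N => dist (x j) (x a) ≤ 2 * L).card : ℝ) ≤ M₁ * L →
        (∃ j : Fin N, 2 * L < dist (x j) (x a)) → False) :
    ∀ θ R : ℝ, 0 < θ → θ < 1 → 1 ≤ R → ∃ L₀ : ℝ, ∀ L : ℝ, L₀ ≤ L → ∃ δ : ℝ, 0 < δ ∧ ∃ N₀ : ℕ,
      ∀ N : ℕ, N₀ ≤ N → ∀ x : Fin N → E3,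
      (∀ j k : Fin N, j ≠ k → (7 : ℝ) / 10 ≤ dist (x j) (x k)) →
      (∀ S : Finset (Fin N), S.Nonempty → Sᶜ.Nonempty →
          ∃ p ∈ S, ∃ k ∈ Sᶜ, dist (x p) (x k) ≤ 23 / 20) →
      δ * (N : ℝ) ≤ ((Finset.univ.filter fun i : Fin N =>
        ((Finset.univ.filter fun q : Fin N =>
            L - R < dist (x q) (x i) ∧ dist (x q) (x i) ≤ L).card : ℝ) ≤
          θ * ((Finset.univ.filter fun q : Fin N => dist (x q) (x i) ≤ L).card : ℝ)).card : ℝ) :=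
  -- LANDED (lead c8, rev 15)
  LjLaminarWindowsSketch.stub_nsfReduction hMB hSP

/-- **NSF (the non-spiky fraction), composed from the four stubs above.** -/
theorem nsf_holds :
    ∀ θ R : ℝ, 0 < θ → θ < 1 → 1 ≤ R → ∃ L₀ : ℝ, ∀ L : ℝ, L₀ ≤ L → ∃ δ : ℝ, 0 < δ ∧ ∃ N₀ : ℕ,
      ∀ N : ℕ, N₀ ≤ N → ∀ x : Fin N → E3,
      (∀ j k : Fin N, j ≠ k → (7 : ℝ) / 10 ≤ dist (x j) (x k)) →
      (∀ S : Finset (Fin N), S.Nonempty → Sᶜ.Nonempty →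
          ∃ p ∈ S, ∃ k ∈ Sᶜ, dist (x p) (x k) ≤ 23 / 20) →
      δ * (N : ℝ) ≤ ((Finset.univ.filter fun i : Fin N =>
        ((Finset.univ.filter fun q : Fin N =>
            L - R < dist (x q) (x i) ∧ dist (x q) (x i) ≤ L).card : ℝ) ≤
          θ * ((Finset.univ.filter fun q : Fin N => dist (x q) (x i) ≤ L).card : ℝ)).card : ℝ) :=
  stub_nsfReduction (stub_massBound stub_thickCircle bonferroni) (stub_sparseAllSpiky stub_thickCircle bonferroni stub_tripleShell)

/-- **Glue of the NSF branch (provable now; stub of lead c8).** A.e. laminarity (14293) + NSF + window removal +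
shell bound + path count ⇒ the crux `LjLaminarWindows` (statement unfolded).  With `k₀ = k₀(ε/4)`,
`(R, C) = hSB(ε/4)`, `θ = min (ε/(4C)) (1/2)`, `L₀ = max (L₀^{NSF}(θ,R)) (max 1 (23 k₀/20))`: for `L ≥ L₀`, eventually
in `N` the non-laminar particles (radius `L`, thickness `η`) are fewer than `δ N ≤ #`non-spiky, so some particle is
laminar AND non-spiky; its window has `≥ k₀` particles (path count), window removal and the shell bound
(`C · #shell ≤ C θ #ball ≤ (ε/4) #ball`) give the energy clause, `laminar_of_levels` the isometry and the height set,
`7/10`-separation (`lennardJones_groundState_dist_ge_seven_tenths`) and `23/20`-connectivity (`glueC5_connected`)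
are landed. -/
theorem stub_glueNSF
    (hLam : ∀ t R : ℝ, 0 < t → 0 < R → ∀ x : (N : ℕ) → (Fin N → EuclideanSpace ℝ (Fin 3)),
      (∀ N, IsGroundState lennardJones (x N)) →
      Filter.Tendsto (fun N : ℕ => (Nat.card {i : Fin N // ¬ (∃ n : EuclideanSpace ℝ (Fin 3),
        ‖n‖ = 1 ∧ ∃ c : ℤ → ℝ, (∀ k : ℤ, c k + 3 / 4 ≤ c (k + 1)) ∧ ∀ j : Fin N,
          dist (x N j) (x N i) ≤ R → ∃ k : ℤ, |inner ℝ (x N j - x N i) n - c k| ≤ t)} : ℝ) / N)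
        Filter.atTop (nhds 0))
    (hNSF : ∀ θ R : ℝ, 0 < θ → θ < 1 → 1 ≤ R → ∃ L₀ : ℝ, ∀ L : ℝ, L₀ ≤ L → ∃ δ : ℝ, 0 < δ ∧ ∃ N₀ : ℕ,
      ∀ N : ℕ, N₀ ≤ N → ∀ x : Fin N → E3,
      (∀ j k : Fin N, j ≠ k → (7 : ℝ) / 10 ≤ dist (x j) (x k)) →
      (∀ S : Finset (Fin N), S.Nonempty → Sᶜ.Nonempty →
          ∃ p ∈ S, ∃ k ∈ Sᶜ, dist (x p) (x k) ≤ 23 / 20) →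
      δ * (N : ℝ) ≤ ((Finset.univ.filter fun i : Fin N =>
        ((Finset.univ.filter fun q : Fin N =>
            L - R < dist (x q) (x i) ∧ dist (x q) (x i) ≤ L).card : ℝ) ≤
          θ * ((Finset.univ.filter fun q : Fin N => dist (x q) (x i) ≤ L).card : ℝ)).card : ℝ))
    (hWR : ∀ η : ℝ, 0 < η → ∃ k₀ : ℕ, ∀ (N : ℕ) (x : Fin N → E3), IsGroundState lennardJones x →
      ∀ S : Finset (Fin N), k₀ ≤ S.card →
        ∑ i ∈ S, ∑ k ∈ S, lennardJones (dist (x i) (x k)) +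
            2 * ∑ i ∈ S, ∑ k ∈ Sᶜ, lennardJones (dist (x i) (x k)) ≤
          2 * (eStar + η) * S.card)
    (hSB : ∀ ε : ℝ, 0 < ε → ∃ R C : ℝ, 1 ≤ R ∧ 0 < C ∧ ∀ (N : ℕ) (x : Fin N → E3),
      (∀ j k : Fin N, j ≠ k → (7 : ℝ) / 10 ≤ dist (x j) (x k)) → ∀ (i : Fin N) (L : ℝ),
        ∑ j ∈ Finset.univ.filter (fun j : Fin N => dist (x j) (x i) ≤ L),
            ∑ k ∈ Finset.univ.filter (fun k : Fin N => ¬ dist (x k) (x i) ≤ L),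
              max (-lennardJones (dist (x j) (x k))) 0 ≤
          ε * ((Finset.univ.filter fun j : Fin N => dist (x j) (x i) ≤ L).card : ℝ) +
            C * ((Finset.univ.filter fun j : Fin N =>
              L - R < dist (x j) (x i) ∧ dist (x j) (x i) ≤ L).card : ℝ))
    (hPC : ∀ (N : ℕ) (x : Fin N → E3) (ρ : ℝ), 0 < ρ →
      (∀ S : Finset (Fin N), S.Nonempty → Sᶜ.Nonempty → ∃ p ∈ S, ∃ k ∈ Sᶜ, dist (x p) (x k) ≤ ρ) →
      ∀ (i : Fin N) (L : ℝ), 0 ≤ L → (∃ j : Fin N, L < dist (x j) (x i)) →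
        L / ρ ≤ ((Finset.univ.filter fun j : Fin N => dist (x j) (x i) ≤ L).card : ℝ)) :
    ∀ x : (N : ℕ) → (Fin N → EuclideanSpace ℝ (Fin 3)), (∀ N, IsGroundState lennardJones (x N)) →
      ∀ η ε : ℝ, 0 < η → 0 < ε → ∃ L₀ : ℝ, ∀ L : ℝ, L₀ ≤ L → ∃ᶠ N in Filter.atTop,
        ∃ (i : Fin N) (A : EuclideanSpace ℝ (Fin 3) →ₗᵢ[ℝ] EuclideanSpace ℝ (Fin 3)) (T : Set ℝ),
          (∀ t ∈ T, ∀ t' ∈ T, t ≠ t' → (3 : ℝ) / 4 ≤ |t - t'|) ∧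
          (∀ j k : Fin N, j ≠ k → dist (x N j) (x N i) ≤ L → dist (x N k) (x N i) ≤ L →
            (7 : ℝ) / 10 ≤ dist (x N j) (x N k)) ∧
          (∀ j : Fin N, dist (x N j) (x N i) ≤ L → ∃ t ∈ T, |(A (x N j - x N i)) 2 - t| ≤ η) ∧
          (∑ j : Fin N, ∑ k : Fin N, if j ≠ k ∧ dist (x N j) (x N i) ≤ L ∧ dist (x N k) (x N i) ≤ L
              then lennardJones (dist (x N j) (x N k)) else 0) ≤
            2 * ((⨅ Q : PeriodicConfiguration 3, Q.energyPerParticle lennardJones) + ε) *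
              (Nat.card {j : Fin N // dist (x N j) (x N i) ≤ L} : ℝ) :=
  -- LANDED (lead c8, rev 15)
  LjLaminarWindowsSketch.stub_glueNSF hLam hNSF hWR hSB hPC

/-! ## The minimal-distance stubs M1–M5 of rev. 5 are ALL LANDED (2026-08-16):
`LjLaminarWindowsSketch.stub_forceBalance` (p112273, …ForceBalance.lean), `stub_forceTheta` (p114329, …ForceTheta.lean),
`stub_forceClubsuit` (p114893, …ForceClubsuit.lean), `stub_forceCapacity` (p115454, …ForceCapacity.lean),
`stub_forceFinalIneq` (p111755, …MinDistDefs.lean); their assembly `stub_minDistance07` is landed too (p115815,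
…MinDistance.lean — identical to `minDistance07_of` below applied to the five names; the skeleton keeps the local assembly
so that it elaborates against the farm snapshot of 17:00Z). -/

/-! ## The minimal distance `7/10` from M1–M5 (PROVED by the lead) -/

/-- **Every Lennard-Jones ground state is `7/10`-separated** (from the five stubs M1–M5): at a closest
pair `(p, q)`, `a = dist ≤ 7/10` (and `a > 0.684` by `Yuhjtman2015_minDistance_holds`), force balance
with `t = 1/25` gives `1 - h(a) + h'(a)/25 ≤ ∑_{k ≠ p,q} kF(‖x_k - x_p‖)`, the capacity bound with
`c = a/2` gives `≤ (84/25)/c³ = 24·(28/25)/a³`, contradicting the final inequality. -/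
theorem minDistance07_of
    (hFB : ∀ (N : ℕ) (x : Fin N → EuclideanSpace ℝ (Fin 3)), IsGroundState lennardJones x →
      ∀ p q : Fin N, p ≠ q → ∀ t : ℝ, 0 ≤ t →
        1 - hLJ (dist (x p) (x q)) +
            t * (12 * (dist (x p) (x q))⁻¹ ^ 13 - 12 * (dist (x p) (x q))⁻¹ ^ 7) ≤
          ∑ k ∈ (Finset.univ.erase p).erase q,
            (hLJ (dist (x p) (x k)) +
              t * |12 * (dist (x p) (x k))⁻¹ ^ 13 - 12 * (dist (x p) (x k))⁻¹ ^ 7|))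
    (hCap : ForceCapacity) (hFin : ForceFinalIneq) :
    ∀ (N : ℕ) (x : Fin N → EuclideanSpace ℝ (Fin 3)), IsGroundState lennardJones x →
      ∀ j k : Fin N, j ≠ k → (7 : ℝ) / 10 ≤ dist (x j) (x k) := by
  intro N x hx j k hjk
  by_contra hlt
  rw [not_le] at hlt
  -- a closest pair `(p, q)`
  obtain ⟨pr, hpr, hmin⟩ := Finset.exists_min_image Finset.univ.offDiag
    (fun pr : Fin N × Fin N ↦ dist (x pr.1) (x pr.2)) ⟨(j, k), by simp [hjk]⟩
  obtain ⟨p, q⟩ := pr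
  have hpq : p ≠ q := by simpa using hpr
  set a := dist (x p) (x q) with ha_def
  have hsep : ∀ k l, k ≠ l → a ≤ dist (x k) (x l) := fun k l hkl ↦ hmin (k, l) (by simp [hkl])
  have ha7 : a ≤ 7 / 10 := (hsep j k hjk).trans hlt.le
  have ha684 : 171 / 250 ≤ a := by
    have h := Yuhjtman2015_minDistance_holds N x hx p q hpq
    norm_num at h
    exact h.le
  have ha0 : 0 < a := by linarith
  -- force balance with `t = 1/25`
  have h1 := hFB N x hx p q hpq (1 / 25) (by norm_num)
  -- capacity with `c = a/2` for the points `x k - x p`, `k ≠ p, q`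
  have h2 := hCap N ((Finset.univ.erase p).erase q) (fun k => x k - x p) (a / 2) (by linarith)
    (by linarith)
    (fun i hi => by
      have hip : i ≠ p := Finset.ne_of_mem_erase (Finset.mem_of_mem_erase hi)
      have h := hsep i p hip
      rw [dist_eq_norm] at h
      linarith)
    (fun i _ j _ hij => by
      rw [dist_eq_norm, show x i - x p - (x j - x p) = x i - x j by abel, ← dist_eq_norm]
      linarith [hsep i j hij])
  have h2' : ∑ k ∈ (Finset.univ.erase p).erase q, (hLJ (dist (x p) (x k)) +
      1 / 25 * |12 * (dist (x p) (x k))⁻¹ ^ 13 - 12 * (dist (x p) (x k))⁻¹ ^ 7|) ≤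
        84 / 25 / (a / 2) ^ 3 := by
    refine le_of_eq_of_le (Finset.sum_congr rfl fun k _ ↦ ?_) h2
    rw [dist_comm, dist_eq_norm]
    rfl
  -- the final inequality
  have h3 := hFin a ha684 ha7
  have h3' : 24 * (28 / 25) / a ^ 3 <
      1 - hLJ a + 1 / 25 * (12 * a⁻¹ ^ 13 - 12 * a⁻¹ ^ 7) := h3
  have e : 84 / 25 / (a / 2) ^ 3 = 24 * (28 / 25) / a ^ 3 := by
    field_simp
    ring
  rw [e] at h2'
  linarith

/-- **Separation density from the pointwise bound** (PROVED): if every ground state is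
`7/10`-separated then the separation-bad set of `composition` is empty, so its density tends to `0`. -/
theorem sepDensity_of_minDistance07
    (hmin : ∀ (N : ℕ) (x : Fin N → EuclideanSpace ℝ (Fin 3)), IsGroundState lennardJones x →
      ∀ j k : Fin N, j ≠ k → (7 : ℝ) / 10 ≤ dist (x j) (x k)) :
    ∀ R : ℝ, 0 < R → ∀ x : (N : ℕ) → (Fin N → EuclideanSpace ℝ (Fin 3)),
      (∀ N, IsGroundState lennardJones (x N)) →
      Filter.Tendsto (fun N : ℕ => (Nat.card {i : Fin N // ∃ j k : Fin N, j ≠ k ∧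
        dist (x N j) (x N i) ≤ R ∧ dist (x N k) (x N i) ≤ R ∧ dist (x N j) (x N k) < 7 / 10} : ℝ) / N)
        Filter.atTop (nhds 0) := by
  intro R _ x hx
  have hzero : ∀ N : ℕ, (Nat.card {i : Fin N // ∃ j k : Fin N, j ≠ k ∧
      dist (x N j) (x N i) ≤ R ∧ dist (x N k) (x N i) ≤ R ∧ dist (x N j) (x N k) < 7 / 10} : ℝ) / N
        = 0 := by
    intro N
    have hempty : IsEmpty {i : Fin N // ∃ j k : Fin N, j ≠ k ∧
        dist (x N j) (x N i) ≤ R ∧ dist (x N k) (x N i) ≤ R ∧ dist (x N j) (x N k) < 7 / 10} := by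
      refine ⟨fun ⟨i, j, k, hjk, _, _, hlt⟩ => ?_⟩
      exact absurd (hmin N (x N) (hx N) j k hjk) (not_le.2 hlt)
    rw [Nat.card_of_isEmpty]
    simp
  simp_rw [hzero]
  exact tendsto_const_nhds

/-! ## Composition -/

/-- **Composition (PROVED by the lead).** The seven stub statements imply the crux (stated here in
unfolded form, so that `LjLaminarWindows_of` is the only theorem concluding the crux by name). -/
theorem composition :
    (∀ t R : ℝ, 0 < t → 0 < R → ∀ x : (N : ℕ) → (Fin N → EuclideanSpace ℝ (Fin 3)),
      (∀ N, IsGroundState lennardJones (x N)) →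
      Filter.Tendsto (fun N : ℕ => (Nat.card {i : Fin N // ¬ (∃ n : EuclideanSpace ℝ (Fin 3),
        ‖n‖ = 1 ∧ ∃ c : ℤ → ℝ, (∀ k : ℤ, c k + 3 / 4 ≤ c (k + 1)) ∧ ∀ j : Fin N,
          dist (x N j) (x N i) ≤ R → ∃ k : ℤ, |inner ℝ (x N j - x N i) n - c k| ≤ t)} : ℝ) / N)
        Filter.atTop (nhds 0)) →
    (∀ R : ℝ, 0 < R → ∀ x : (N : ℕ) → (Fin N → EuclideanSpace ℝ (Fin 3)),
      (∀ N, IsGroundState lennardJones (x N)) →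
      Filter.Tendsto (fun N : ℕ => (Nat.card {i : Fin N // ∃ j k : Fin N, j ≠ k ∧
        dist (x N j) (x N i) ≤ R ∧ dist (x N k) (x N i) ≤ R ∧ dist (x N j) (x N k) < 7 / 10} : ℝ) / N)
        Filter.atTop (nhds 0)) →
    (∃ r₀ : ℝ, 0 < r₀ ∧ ∀ R : ℝ, 0 < R → ∀ x : (N : ℕ) → (Fin N → EuclideanSpace ℝ (Fin 3)),
      (∀ N, IsGroundState lennardJones (x N)) →
      Filter.Tendsto (fun N : ℕ => (Nat.card {i : Fin N // ∃ c : EuclideanSpace ℝ (Fin 3),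
        dist c (x N i) ≤ R ∧ ∀ j : Fin N, r₀ ≤ dist c (x N j)} : ℝ) / N) Filter.atTop (nhds 0)) →
    (∀ (N : ℕ) (x : Fin N → E3), Function.Injective x → ∀ (c : E3) (L : ℝ),
      2 * eStar * ((Finset.univ.filter fun j : Fin N => dist (x j) c ≤ L).card : ℝ) ≤
        ∑ j : Fin N, ∑ k : Fin N,
          if j ≠ k ∧ dist (x j) c ≤ L ∧ dist (x k) c ≤ L then lennardJones (dist (x j) (x k)) else 0) →
    (∀ (N : ℕ) (x : Fin N → E3) (δ L : ℝ), 0 < δ → 1 ≤ L → Function.Injective x →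
      (∀ j k : Fin N, j ≠ k → δ ≤ dist (x j) (x k)) →
      Integrable (fun c : E3 => ((Finset.univ.filter fun j : Fin N => dist (x j) c ≤ L).card : ℝ)) ∧
      Integrable (fun c : E3 =>
        ((Finset.univ.filter fun j : Fin N => L - 1 < dist (x j) c ∧ dist (x j) c ≤ L + 1).card : ℝ)) ∧
      Integrable (fun c : E3 => ∑ j : Fin N, ∑ k : Fin N,
        if j ≠ k ∧ dist (x j) c ≤ L ∧ dist (x k) c ≤ L then lennardJones (dist (x j) (x k)) else 0) ∧
      (∫ c : E3, ((Finset.univ.filter fun j : Fin N => dist (x j) c ≤ L).card : ℝ)) =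
        N * (4 / 3 * Real.pi * L ^ 3) ∧
      (∫ c : E3,
        ((Finset.univ.filter fun j : Fin N => L - 1 < dist (x j) c ∧ dist (x j) c ≤ L + 1).card : ℝ)) ≤
        11 * Real.pi * L ^ 2 * N ∧
      (∫ c : E3, ∑ j : Fin N, ∑ k : Fin N,
        if j ≠ k ∧ dist (x j) c ≤ L ∧ dist (x k) c ≤ L then lennardJones (dist (x j) (x k)) else 0) ≤
        (4 / 3 * Real.pi * L ^ 3) * (2 * interactionEnergy lennardJones x) + 530 * δ⁻¹ ^ 5 * L ^ 2 * N) →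
    (∀ (G w : E3 → ℝ) (D : Set E3) (N : ℕ) (s : Finset (Fin N)) (z : Fin N → E3) (r : Fin N → ℝ)
      (A ε P : ℝ), 0 < ε → 0 < A → 0 ≤ P → Integrable G → Integrable w →
      (∀ c, -(2 * ε * w c) ≤ G c) → (∀ c, 0 ≤ w c) → (∀ c, w c ≤ P) →
      (∫ c, G c) ≤ -A → MeasurableSet D →
      (∀ c ∈ D, w c ≠ 0 → ∃ m ∈ s, dist c (z m) ≤ r m) → (∀ m ∈ s, 0 ≤ r m) →
      P * ∑ m ∈ s, (4 / 3 * Real.pi * (r m) ^ 3) ≤ A / (4 * ε) →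
      ∃ c, c ∉ D ∧ G c < 0) →
    (∀ (N : ℕ) (x : Fin N → E3) (V : ℝ → ℝ) (c : E3) (i : Fin N) (a L M e ε lam : ℝ),
      dist (x i) c ≤ a → 0 ≤ M → 0 < ε → e + ε ≤ 0 →
      2 * M ≤ lam → 4 * ε ≤ lam → 4 * |e + ε| ≤ lam →
      (∀ j : Fin N, ∑ k ∈ Finset.univ.erase j, |V (dist (x j) (x k))| ≤ M) →
      (∑ j : Fin N, ∑ k : Fin N,
          if j ≠ k ∧ dist (x j) c ≤ L ∧ dist (x k) c ≤ L then V (dist (x j) (x k)) else 0) +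
        lam * ((Finset.univ.filter fun j : Fin N => L - a < dist (x j) c ∧ dist (x j) c ≤ L + a).card : ℝ)
        ≤ 2 * (e + ε) * ((Finset.univ.filter fun j : Fin N => dist (x j) c ≤ L).card : ℝ) →
      2 * e * ((Finset.univ.filter fun j : Fin N => dist (x j) c ≤ L).card : ℝ) ≤
        (∑ j : Fin N, ∑ k : Fin N,
          if j ≠ k ∧ dist (x j) c ≤ L ∧ dist (x k) c ≤ L then V (dist (x j) (x k)) else 0) →
      (∑ j : Fin N, ∑ k : Fin N,
          if j ≠ k ∧ dist (x j) (x i) ≤ L ∧ dist (x k) (x i) ≤ L then V (dist (x j) (x k)) else 0) ≤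
        2 * (e + 2 * ε) * (Nat.card {j : Fin N // dist (x j) (x i) ≤ L} : ℝ)) →
    ∀ x : (N : ℕ) → (Fin N → EuclideanSpace ℝ (Fin 3)), (∀ N, IsGroundState lennardJones (x N)) →
      ∀ η ε : ℝ, 0 < η → 0 < ε → ∃ L₀ : ℝ, ∀ L : ℝ, L₀ ≤ L → ∃ᶠ N in Filter.atTop,
        ∃ (i : Fin N) (A : EuclideanSpace ℝ (Fin 3) →ₗᵢ[ℝ] EuclideanSpace ℝ (Fin 3)) (T : Set ℝ),
          (∀ t ∈ T, ∀ t' ∈ T, t ≠ t' → (3 : ℝ) / 4 ≤ |t - t'|) ∧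
          (∀ j k : Fin N, j ≠ k → dist (x N j) (x N i) ≤ L → dist (x N k) (x N i) ≤ L →
            (7 : ℝ) / 10 ≤ dist (x N j) (x N k)) ∧
          (∀ j : Fin N, dist (x N j) (x N i) ≤ L → ∃ t ∈ T, |(A (x N j - x N i)) 2 - t| ≤ η) ∧
          (∑ j : Fin N, ∑ k : Fin N, if j ≠ k ∧ dist (x N j) (x N i) ≤ L ∧ dist (x N k) (x N i) ≤ L
              then lennardJones (dist (x N j) (x N k)) else 0) ≤
            2 * ((⨅ Q : PeriodicConfiguration 3, Q.energyPerParticle lennardJones) + ε) *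
              (Nat.card {j : Fin N // dist (x N j) (x N i) ≤ L} : ℝ) := by
  intro hLam hSepD hNoFoam hFloor hAvg hGood hTrans x hx η ε hη hε
  obtain ⟨δ, hδ, hsep⟩ := LennardJonesMinimalDistance_holds
  obtain ⟨r₀, hr₀, hNF⟩ := hNoFoam
  -- `e* < 0`
  have he : eStar < 0 := by
    obtain ⟨e, he, htend, -⟩ := BlancLewin2015_8_holds 3 (by norm_num) (by norm_num)
    have heq : e = eStar := tendsto_nhds_unique htend crysEnergyLimit
    rw [← heq]
    exact he
  -- constants
  set a : ℝ := max r₀ 1 with ha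
  have ha1 : 1 ≤ a := le_max_right _ _
  have har : r₀ ≤ a := le_max_left _ _
  have ha0 : 0 < a := by linarith
  set ε₁ : ℝ := min ε (-eStar) with hε₁
  have hε₁pos : 0 < ε₁ := lt_min hε (neg_pos.2 he)
  have hε₁le : ε₁ ≤ ε := min_le_left _ _
  have hε₁le' : ε₁ ≤ -eStar := min_le_right _ _
  set ε' : ℝ := ε₁ / 2 with hε'
  have hε'pos : 0 < ε' := by positivity
  set M : ℝ := (δ⁻¹ ^ 6 / 12 + 1 / 6) * (250 * δ⁻¹ ^ 6) with hM
  have hM0 : 0 ≤ M := by positivity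
  set lam : ℝ := 2 * M + 4 * ε' + 4 * |eStar| with hlam
  have hlam0 : 0 ≤ lam := by positivity
  set C : ℝ := 530 * δ⁻¹ ^ 5 + 32 / 3 * Real.pi * a ^ 3 * lam with hC
  have hC0 : 0 ≤ C := by positivity
  set L₀ : ℝ := max (a + 1) (C / (4 / 3 * Real.pi * ε')) with hL₀
  refine ⟨L₀, fun L hL => ?_⟩
  have hLa1 : a + 1 ≤ L := le_trans (le_max_left _ _) hL
  have hL1 : 1 ≤ L := by linarith
  have hLpos : 0 < L := by linarith
  have hLa : a ≤ L := by linarith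
  have hLm1 : 1 ≤ L - a := by linarith
  have hLp1 : 1 ≤ L + a := by linarith
  set v : ℝ := 4 / 3 * Real.pi * L ^ 3 with hv
  have hvpos : 0 < v := by positivity
  have hCL : C * L ^ 2 ≤ ε' * v := by
    have h1 : C / (4 / 3 * Real.pi * ε') ≤ L := le_trans (le_max_right _ _) hL
    have hpos : 0 < 4 / 3 * Real.pi * ε' := by positivity
    rw [div_le_iff₀ hpos] at h1
    have h2 := mul_le_mul_of_nonneg_right h1 (sq_nonneg L)
    have h3 : L * (4 / 3 * Real.pi * ε') * L ^ 2 = ε' * v := by rw [hv]; ring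
    linarith
  -- packing constant and the density threshold
  set P : ℝ := (2 * L / δ + 1) ^ 3 with hP
  have hPpos : 0 < P := by positivity
  set θ : ℝ := 1 / (24 * P) with hθ
  have hθpos : 0 < θ := by positivity
  -- eventually in `N`
  have hcl : Tendsto (fun N : ℕ => groundStateEnergy lennardJones 3 N / N) atTop (𝓝 eStar) :=
    crysEnergyLimit
  have hlt : eStar < eStar + ε' / 4 := by linarith only [hε'pos]
  have hE1 : ∀ᶠ N : ℕ in atTop, groundStateEnergy lennardJones 3 N / N < eStar + ε' / 4 :=
    hcl.eventually (gt_mem_nhds hlt)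
  have hE2 := (hLam η L hη hLpos x hx).eventually (gt_mem_nhds hθpos)
  have hE2' := (hSepD L hLpos x hx).eventually (gt_mem_nhds hθpos)
  have hE3 := (hNF (a + 2) (by linarith) x hx).eventually (gt_mem_nhds hθpos)
  have hE4 : ∀ᶠ N : ℕ in atTop, 1 ≤ N := eventually_ge_atTop 1
  refine ((hE1.and (hE2.and (hE2'.and (hE3.and hE4)))).mono ?_).frequently
  rintro N ⟨h1, h2, h2', h3, h4⟩
  classical
  have hxN := hx N
  have hinj : Function.Injective (x N) := hxN.1
  have hsepN : ∀ j k : Fin N, j ≠ k → δ ≤ dist (x N j) (x N k) :=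
    fun j k hjk => hsep N (x N) hxN j k hjk
  have hNpos : (0 : ℝ) < N := by exact_mod_cast h4
  have hEN : interactionEnergy lennardJones (x N) ≤ N * (eStar + ε' / 4) := by
    rw [hxN.2]
    have h1' := h1
    rw [div_lt_iff₀ hNpos] at h1'
    linarith only [h1']
  -- from `#/N < θ` to `# ≤ θ N`
  have hdens : ∀ m : ℕ, (m : ℝ) / N < θ → (m : ℝ) ≤ θ * N := by
    intro m hm
    rw [div_lt_iff₀ hNpos] at hm
    exact hm.le
  -- the predicates
  let sepbad : Fin N → Prop := fun i => ∃ j k : Fin N, j ≠ k ∧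
    dist (x N j) (x N i) ≤ L ∧ dist (x N k) (x N i) ≤ L ∧ dist (x N j) (x N k) < 7 / 10
  let lamgood : Fin N → Prop := fun i => ∃ n : EuclideanSpace ℝ (Fin 3), ‖n‖ = 1 ∧
    ∃ c : ℤ → ℝ, (∀ k : ℤ, c k + 3 / 4 ≤ c (k + 1)) ∧ ∀ j : Fin N,
      dist (x N j) (x N i) ≤ L → ∃ k : ℤ, |inner ℝ (x N j - x N i) n - c k| ≤ η
  let exposedP : Fin N → Prop := fun i =>
    ∃ c : EuclideanSpace ℝ (Fin 3), dist c (x N i) ≤ a + 2 ∧ ∀ j : Fin N, r₀ ≤ dist c (x N j)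
  set U : Finset (Fin N) := Finset.univ.filter fun i => sepbad i ∨ ¬ lamgood i with hU
  set X : Finset (Fin N) := Finset.univ.filter fun i => exposedP i with hX
  have hUcard : (U.card : ℝ) ≤ 2 * θ * N := by
    have hA : (Nat.card {i : Fin N // ¬ lamgood i} : ℝ) ≤ θ * N := hdens _ h2
    have hB : (Nat.card {i : Fin N // sepbad i} : ℝ) ≤ θ * N := hdens _ h2'
    have eA : {i : Fin N // ¬ lamgood i} ≃ {i // i ∈ Finset.univ.filter fun i => ¬ lamgood i} :=
      Equiv.subtypeEquivRight (fun i => by simp)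
    have eB : {i : Fin N // sepbad i} ≃ {i // i ∈ Finset.univ.filter fun i => sepbad i} :=
      Equiv.subtypeEquivRight (fun i => by simp)
    rw [Nat.card_congr eA, Nat.card_eq_finsetCard] at hA
    rw [Nat.card_congr eB, Nat.card_eq_finsetCard] at hB
    have hsub : U ⊆ (Finset.univ.filter fun i => sepbad i) ∪ (Finset.univ.filter fun i => ¬ lamgood i) := by
      intro i hi
      simp only [hU, Finset.mem_filter, Finset.mem_univ, true_and] at hi
      simp only [Finset.mem_union, Finset.mem_filter, Finset.mem_univ, true_and]
      exact hi
    have h1 := Finset.card_le_card hsub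
    have h2 := Finset.card_union_le (Finset.univ.filter fun i => sepbad i)
      (Finset.univ.filter fun i => ¬ lamgood i)
    have h3 : (U.card : ℝ) ≤ ((Finset.univ.filter fun i => sepbad i).card : ℝ) +
        ((Finset.univ.filter fun i => ¬ lamgood i).card : ℝ) := by exact_mod_cast h1.trans h2
    linarith only [hA, hB, h3]
  have hXcard : (X.card : ℝ) ≤ θ * N := by
    have h3' : (Nat.card {i : Fin N // exposedP i} : ℝ) ≤ θ * N := hdens _ h3
    have e : {i : Fin N // exposedP i} ≃ {i // i ∈ X} :=
      Equiv.subtypeEquivRight (fun i => by simp [hX])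
    rwa [Nat.card_congr e, Nat.card_eq_finsetCard] at h3'
  -- the window functionals at radii `L`, `L + a`, `L - a`
  obtain ⟨hbc_int, -, hbe_int, hbc_eq, -, hbe_le⟩ := hAvg N (x N) δ L hδ hL1 hinj hsepN
  obtain ⟨hbcP_int, -, -, hbcP_eq, -, -⟩ := hAvg N (x N) δ (L + a) hδ hLp1 hinj hsepN
  obtain ⟨hbcM_int, -, -, hbcM_eq, -, -⟩ := hAvg N (x N) δ (L - a) hδ hLm1 hinj hsepN
  set bc : E3 → ℝ := fun c => ((Finset.univ.filter fun j : Fin N => dist (x N j) c ≤ L).card : ℝ)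
    with hbc
  set bcP : E3 → ℝ := fun c =>
    ((Finset.univ.filter fun j : Fin N => dist (x N j) c ≤ L + a).card : ℝ) with hbcP
  set bcM : E3 → ℝ := fun c =>
    ((Finset.univ.filter fun j : Fin N => dist (x N j) c ≤ L - a).card : ℝ) with hbcM
  set sc : E3 → ℝ := fun c => bcP c - bcM c with hsc
  set be : E3 → ℝ := fun c => ∑ j : Fin N, ∑ k : Fin N,
    if j ≠ k ∧ dist (x N j) c ≤ L ∧ dist (x N k) c ≤ L then lennardJones (dist (x N j) (x N k)) else 0
    with hbe
  set G : E3 → ℝ := fun c => be c - 2 * (eStar + ε') * bc c + lam * sc c with hG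
  -- the shell count `#{L - a < d ≤ L + a} = #B_{L+a} - #B_{L-a}`
  have hsc_eq : ∀ c : E3, ((Finset.univ.filter fun j : Fin N =>
      L - a < dist (x N j) c ∧ dist (x N j) c ≤ L + a).card : ℝ) = sc c := by
    intro c
    have hdisj : Disjoint
        (Finset.univ.filter fun j : Fin N => L - a < dist (x N j) c ∧ dist (x N j) c ≤ L + a)
        (Finset.univ.filter fun j : Fin N => dist (x N j) c ≤ L - a) := by
      rw [Finset.disjoint_filter]
      intro j _ hj1 hj2
      linarith [hj1.1]
    have hunion :
        (Finset.univ.filter fun j : Fin N => L - a < dist (x N j) c ∧ dist (x N j) c ≤ L + a) ∪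
          (Finset.univ.filter fun j : Fin N => dist (x N j) c ≤ L - a) =
        Finset.univ.filter fun j : Fin N => dist (x N j) c ≤ L + a := by
      ext j
      simp only [Finset.mem_union, Finset.mem_filter, Finset.mem_univ, true_and]
      constructor
      · rintro (hj | hj)
        · exact hj.2
        · linarith
      · intro hj
        by_cases hj' : dist (x N j) c ≤ L - a
        · exact Or.inr hj'
        · exact Or.inl ⟨lt_of_not_ge hj', hj⟩
    have hcard := Finset.card_union_of_disjoint hdisj
    rw [hunion] at hcard
    simp only [hsc, hbcP, hbcM, hcard]
    push_cast
    ring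
  -- pointwise facts
  have hbc_nonneg : ∀ c, 0 ≤ bc c := fun c => by simp only [hbc]; positivity
  have hsc_nonneg : ∀ c, 0 ≤ sc c := by
    intro c
    rw [← hsc_eq c]
    positivity
  have hfloor : ∀ c, 2 * eStar * bc c ≤ be c := fun c => hFloor N (x N) hinj c L
  have hGfloor : ∀ c, -(2 * ε' * bc c) ≤ G c := by
    intro c
    have h1 := hfloor c
    have h3 : 0 ≤ lam * sc c := mul_nonneg hlam0 (hsc_nonneg c)
    simp only [hG]
    linarith only [h1, h3]
  have hbc_leP : ∀ c, bc c ≤ P := by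
    intro c
    set F : Finset (Fin N) := Finset.univ.filter fun j : Fin N => dist (x N j) c ≤ L with hF
    have hcard : ((F.image (x N)).card : ℝ) = bc c := by
      simp only [hbc]
      rw [Finset.card_image_of_injective _ hinj]
    have h := card_le_of_separated_of_dist_le (F.image (x N)) c hδ hLpos.le ?_ ?_
    · rw [finrank_euclideanSpace_fin] at h
      rw [← hcard]
      simpa [hP] using h
    · intro p hp
      obtain ⟨j, hj, rfl⟩ := Finset.mem_image.1 hp
      exact (Finset.mem_filter.1 hj).2
    · intro p hp q hq hpq
      obtain ⟨j, -, rfl⟩ := Finset.mem_image.1 hp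
      obtain ⟨k, -, rfl⟩ := Finset.mem_image.1 hq
      exact hsepN j k fun h => hpq (h ▸ rfl)
  -- integrability and the integral of `G`
  have hsc_int : Integrable sc := hbcP_int.sub hbcM_int
  have hG_int : Integrable G :=
    (hbe_int.sub (hbc_int.const_mul (2 * (eStar + ε')))).add (hsc_int.const_mul lam)
  set A : ℝ := ε' * N * v / 2 with hA
  have hApos : 0 < A := by positivity
  have hG_integral : (∫ c, G c) ≤ -A := by
    have i1 : Integrable (fun c => be c - 2 * (eStar + ε') * bc c) :=
      hbe_int.sub (hbc_int.const_mul _)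
    have i2 : Integrable (fun c => lam * sc c) := hsc_int.const_mul lam
    have hsplit : (∫ c, G c) =
        (∫ c, be c) - 2 * (eStar + ε') * (∫ c, bc c) + lam * (∫ c, sc c) := by
      simp only [hG]
      rw [integral_add i1 i2, integral_sub hbe_int (hbc_int.const_mul _), integral_const_mul,
        integral_const_mul]
    have hsc_integral : (∫ c, sc c) = N * (4 / 3 * Real.pi * (L + a) ^ 3) -
        N * (4 / 3 * Real.pi * (L - a) ^ 3) := by
      simp only [hsc]
      rw [integral_sub hbcP_int hbcM_int]
      exact congrArg₂ (· - ·) hbcP_eq hbcM_eq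
    rw [hsplit, hbc_eq, hsc_integral]
    have hbe_le' : (∫ c, be c) ≤
        v * (2 * interactionEnergy lennardJones (x N)) + 530 * δ⁻¹ ^ 5 * L ^ 2 * N := hbe_le
    have ha' : v * (2 * interactionEnergy lennardJones (x N)) ≤
        2 * (v * N * eStar) + 1 / 2 * (v * N * ε') := by
      have h1 := mul_le_mul_of_nonneg_left hEN (by positivity : (0 : ℝ) ≤ 2 * v)
      have h2 : 2 * v * (N * (eStar + ε' / 4)) = 2 * (v * N * eStar) + 1 / 2 * (v * N * ε') := by ring
      have h3 : v * (2 * interactionEnergy lennardJones (x N)) =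
          2 * v * interactionEnergy lennardJones (x N) := by ring
      linarith only [h1, h2, h3]
    -- the shell volume `(4/3)π((L+a)³ − (L−a)³) ≤ (32/3)π a³ L²`
    have hshell : N * (4 / 3 * Real.pi * (L + a) ^ 3) - N * (4 / 3 * Real.pi * (L - a) ^ 3) ≤
        32 / 3 * Real.pi * a ^ 3 * L ^ 2 * N := by
      have ha2 : (1 : ℝ) ≤ a ^ 2 := one_le_pow₀ ha1
      have h1 : a ≤ a ^ 3 := by
        calc a = a * 1 := (mul_one a).symm
          _ ≤ a * a ^ 2 := mul_le_mul_of_nonneg_left ha2 ha0.le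
          _ = a ^ 3 := by ring
      have h2 : 6 * L ^ 2 * a ≤ 6 * L ^ 2 * a ^ 3 :=
        mul_le_mul_of_nonneg_left h1 (by positivity)
      have hL2 : (1 : ℝ) ≤ L ^ 2 := one_le_pow₀ hL1
      have h3 : 2 * a ^ 3 ≤ 2 * a ^ 3 * L ^ 2 :=
        le_mul_of_one_le_right (by positivity) hL2
      have e0 : (L + a) ^ 3 - (L - a) ^ 3 = 6 * L ^ 2 * a + 2 * a ^ 3 := by ring
      have h4 : (L + a) ^ 3 - (L - a) ^ 3 ≤ 8 * a ^ 3 * L ^ 2 := by linarith only [e0, h2, h3]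
      have h5 := mul_le_mul_of_nonneg_left h4 (by positivity : (0 : ℝ) ≤ 4 / 3 * Real.pi * N)
      have e1 : N * (4 / 3 * Real.pi * (L + a) ^ 3) - N * (4 / 3 * Real.pi * (L - a) ^ 3) =
          4 / 3 * Real.pi * N * ((L + a) ^ 3 - (L - a) ^ 3) := by ring
      have e2 : 4 / 3 * Real.pi * N * (8 * a ^ 3 * L ^ 2) = 32 / 3 * Real.pi * a ^ 3 * L ^ 2 * N := by
        ring
      linarith only [h5, e1, e2]
    have hb : lam * (N * (4 / 3 * Real.pi * (L + a) ^ 3) - N * (4 / 3 * Real.pi * (L - a) ^ 3)) ≤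
        lam * (32 / 3 * Real.pi * a ^ 3 * L ^ 2 * N) :=
      mul_le_mul_of_nonneg_left hshell hlam0
    have hc : 530 * δ⁻¹ ^ 5 * L ^ 2 * N + lam * (32 / 3 * Real.pi * a ^ 3 * L ^ 2 * N) =
        C * L ^ 2 * N := by
      simp only [hC]; ring
    have hd : C * L ^ 2 * N ≤ v * N * ε' := by
      have := mul_le_mul_of_nonneg_right hCL hNpos.le
      have h' : ε' * v * N = v * N * ε' := by ring
      linarith only [this, h']
    have he2 : 2 * (eStar + ε') * (↑N * (4 / 3 * Real.pi * L ^ 3)) =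
        2 * (v * N * eStar) + 2 * (v * N * ε') := by
      simp only [hv]; ring
    have hA' : -A = -(1 / 2) * (v * N * ε') := by simp only [hA]; ring
    rw [he2, hA']
    linarith only [hbe_le', ha', hb, hc, hd]
  -- the bad set
  set Far : Set E3 := {c | ∀ j : Fin N, a < dist (x N j) c} with hFar
  set Zone : Set E3 := ⋃ u ∈ U, closedBall (x N u) a with hZone
  set D : Set E3 := Far ∪ Zone with hD
  have hFar_open : IsOpen Far := by
    have : Far = ⋂ j : Fin N, {c : E3 | a < dist (x N j) c} := by
      ext c; simp [hFar]
    rw [this]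
    exact isOpen_iInter_of_finite fun j => isOpen_lt continuous_const (continuous_const.dist continuous_id)
  have hZone_closed : IsClosed Zone := isClosed_biUnion_finset fun u _ => isClosed_closedBall
  have hD_meas : MeasurableSet D := hFar_open.measurableSet.union hZone_closed.measurableSet
  set s : Finset (Fin N) := U ∪ X with hs
  have hcover : ∀ c ∈ D, bc c ≠ 0 → ∃ m ∈ s, dist c (x N m) ≤ (fun _ : Fin N => L) m := by
    intro c hc hbc0
    rcases hc with hc | hc
    · -- far centre: its nearest particle is exposed
      have hne : (Finset.univ.filter fun j : Fin N => dist (x N j) c ≤ L).Nonempty := by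
        rw [Finset.nonempty_iff_ne_empty]
        intro h
        apply hbc0
        simp only [hbc, h, Finset.card_empty, Nat.cast_zero]
      obtain ⟨j₀, hj₀⟩ := hne
      obtain ⟨i, -, hi⟩ := Finset.exists_min_image Finset.univ (fun j => dist (x N j) c)
        ⟨j₀, Finset.mem_univ _⟩
      have hmin : ∀ j, dist (x N i) c ≤ dist (x N j) c := fun j => hi j (Finset.mem_univ _)
      have hiL : dist (x N i) c ≤ L := le_trans (hmin j₀) (Finset.mem_filter.1 hj₀).2
      have hexp : exposedP i := exposed_of_far (x N) c i har ha0.le hmin (hc i)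
      refine ⟨i, ?_, ?_⟩
      · simp only [hs, Finset.mem_union]
        right
        simpa [hX] using hexp
      · simpa [dist_comm] using hiL
    · simp only [hZone, Set.mem_iUnion, mem_closedBall] at hc
      obtain ⟨u, hu, hcu⟩ := hc
      refine ⟨u, ?_, le_trans hcu hLa⟩
      simp only [hs, Finset.mem_union]
      left
      exact hu
  have hsum : P * ∑ m ∈ s, (4 / 3 * Real.pi * ((fun _ : Fin N => L) m) ^ 3) ≤ A / (4 * ε') := by
    simp only [Finset.sum_const, nsmul_eq_mul]
    have hscard : (s.card : ℝ) ≤ 3 * θ * N := by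
      have h01 := Finset.card_union_le U X
      have h02 : (s.card : ℝ) ≤ U.card + X.card := by simp only [hs]; exact_mod_cast h01
      linarith only [h02, hUcard, hXcard]
    have hθN : 3 * θ * N = N / (8 * P) := by simp only [hθ]; field_simp; ring
    have hA4 : A / (4 * ε') = N * v / 8 := by simp only [hA]; field_simp; ring
    rw [hA4]
    rw [hθN] at hscard
    have : P * (s.card : ℝ) ≤ N / 8 := by
      have h7 := mul_le_mul_of_nonneg_left hscard hPpos.le
      have h8 : P * (N / (8 * P)) = N / 8 := by field_simp
      linarith only [h7, h8]
    have hv' : (4 / 3 * Real.pi * L ^ 3) = v := rfl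
    rw [hv']
    have h9 := mul_le_mul_of_nonneg_right this hvpos.le
    have e1 : P * ((s.card : ℝ) * v) = P * (s.card : ℝ) * v := by ring
    have e2 : (N : ℝ) / 8 * v = N * v / 8 := by ring
    linarith only [h9, e1, e2]
  -- a good centre off the bad set
  obtain ⟨c, hcD, hGc⟩ := hGood G bc D N s (x N) (fun _ => L) A ε' P hε'pos hApos hPpos.le hG_int
    hbc_int hGfloor hbc_nonneg hbc_leP hG_integral hD_meas hcover (fun _ _ => hLpos.le) hsum
  -- a particle within `a` of the centre, which is clean
  have hnear : ∃ i : Fin N, dist (x N i) c ≤ a := by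
    by_contra h
    push Not at h
    exact hcD (Or.inl h)
  obtain ⟨i, hic⟩ := hnear
  have hclean : ¬ (sepbad i ∨ ¬ lamgood i) := by
    intro h
    apply hcD
    refine Or.inr ?_
    simp only [hZone, Set.mem_iUnion, mem_closedBall]
    refine ⟨i, ?_, by rwa [dist_comm]⟩
    simpa [hU] using h
  have hsepgood : ¬ sepbad i := fun h => hclean (Or.inl h)
  have hlamgood : lamgood i := by
    by_contra h
    exact hclean (Or.inr h)
  have hsep7 : ∀ j k : Fin N, j ≠ k → dist (x N j) (x N i) ≤ L → dist (x N k) (x N i) ≤ L →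
      (7 : ℝ) / 10 ≤ dist (x N j) (x N k) := by
    intro j k hjk hj hk
    by_contra hlt
    exact hsepgood ⟨j, k, hjk, hj, hk, lt_of_not_ge hlt⟩
  obtain ⟨n, hn, lev, hlev, hwin⟩ := hlamgood
  obtain ⟨A', T, hT, hlamin⟩ := laminar_of_levels (x N) i L η n hn lev hlev hwin
  -- the energy clause by transfer
  have heε : eStar + ε' ≤ 0 := by
    simp only [hε']; linarith only [hε₁le', hε₁pos]
  have habs0 := abs_nonneg eStar
  have h2M : 2 * M ≤ lam := by
    simp only [hlam]; linarith only [habs0, hε'pos]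
  have h4ε : 4 * ε' ≤ lam := by
    simp only [hlam]; linarith only [habs0, hM0]
  have h4abs : 4 * |eStar + ε'| ≤ lam := by
    have : |eStar + ε'| ≤ |eStar| + ε' := by
      calc |eStar + ε'| ≤ |eStar| + |ε'| := abs_add_le _ _
        _ = |eStar| + ε' := by rw [abs_of_pos hε'pos]
    simp only [hlam]; linarith only [this, hM0]
  have hrow : ∀ j : Fin N, ∑ k ∈ Finset.univ.erase j, |lennardJones (dist (x N j) (x N k))| ≤ M :=
    fun j => row_abs_lennardJones_le (x N) hδ hsepN j
  have hgood : be c + lam * ((Finset.univ.filter fun j : Fin N =>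
      L - a < dist (x N j) c ∧ dist (x N j) c ≤ L + a).card : ℝ) ≤ 2 * (eStar + ε') * bc c := by
    rw [hsc_eq c]
    have := hGc; simp only [hG] at this; linarith only [this]
  have henergy := hTrans N (x N) lennardJones c i a L M eStar ε' lam hic hM0 hε'pos heε h2M h4ε
    h4abs hrow hgood (hfloor c)
  refine ⟨i, A', T, hT, hsep7, hlamin, le_trans henergy ?_⟩
  have hcard0 : (0 : ℝ) ≤ (Nat.card {j : Fin N // dist (x N j) (x N i) ≤ L} : ℝ) := Nat.cast_nonneg _
  have hle : 2 * (eStar + 2 * ε') ≤ 2 * (eStar + ε) := by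
    simp only [hε']; linarith only [hε₁le]
  exact mul_le_mul_of_nonneg_right hle hcard0

/-! ## The composition closes the crux by name -/

/-! **NoFoam branch (rev. 3–9).** `composition stub_laminarity (sepDensity_of_minDistance07 (minDistance07_of
…)) hNoFoam LjLaminarWindowsSketch.windowFloor LjLaminarWindowsSketch.averagingIntegrals LjLaminarWindowsSketch.goodCentre
windowTransfer_local` proves the crux from `stub_laminarity` and the board item NoFoam (stmt-13453) taken as a
hypothesis `hNoFoam` (glue landed as `LjLaminarWindowsSketch.stub_glue`, p116502); from rev. 10 on NoFoam is not a
registered stub of this line, so that composition is not restated here (a skeleton theorem may only assume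
registered stubs). -/

/- (former `LjLaminarWindows_of'`, an `example` from rev. 16 on so that exactly ONE theorem concludes the crux by name)
**The alternative composition (rev. 8, lead c5)**: the crux from a.e. laminarity, bounded spiky
scales, window removal, the shell bound and the path count (card `Ideas/subadditive-shells.md`). -/
example
    (hLam : ∀ t R : ℝ, 0 < t → 0 < R → ∀ x : (N : ℕ) → (Fin N → EuclideanSpace ℝ (Fin 3)),
      (∀ N, IsGroundState lennardJones (x N)) →
      Filter.Tendsto (fun N : ℕ => (Nat.card {i : Fin N // ¬ (∃ n : EuclideanSpace ℝ (Fin 3),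
        ‖n‖ = 1 ∧ ∃ c : ℤ → ℝ, (∀ k : ℤ, c k + 3 / 4 ≤ c (k + 1)) ∧ ∀ j : Fin N,
          dist (x N j) (x N i) ≤ R → ∃ k : ℤ, |inner ℝ (x N j - x N i) n - c k| ≤ t)} : ℝ) / N)
        Filter.atTop (nhds 0))
    (hFew :
    ∀ θ₁ R : ℝ, 0 < θ₁ → 1 ≤ R → ∃ c C L₀ : ℝ, 0 < c ∧ 1 ≤ C ∧ ∀ L : ℝ, L₀ ≤ L →
      ∀ (N : ℕ) (x : Fin N → E3),
      (∀ j k : Fin N, j ≠ k → (7 : ℝ) / 10 ≤ dist (x j) (x k)) →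
      (∀ S : Finset (Fin N), S.Nonempty → Sᶜ.Nonempty →
          ∃ p ∈ S, ∃ k ∈ Sᶜ, dist (x p) (x k) ≤ 23 / 20) →
      ∀ Y : Finset (Fin N),
        (∀ p ∈ Y, θ₁ * ((Finset.univ.filter fun q : Fin N => dist (x q) (x p) ≤ L).card : ℝ) <
            ((Y.filter fun q : Fin N => L - R < dist (x q) (x p) ∧ dist (x q) (x p) ≤ L).card : ℝ)) →
        ∃ lab : Fin N → ℕ,
          (∀ l : ℕ, ∃ (z : E3) (A : E3 →ₗᵢ[ℝ] E3), ∀ p : Fin N, lab p = l →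
              |(A (x p - z)) 2| ≤ R ∧ dist (x p) z ≤ C * Real.sqrt (L * R)) ∧
          (∀ q ∈ Y, ((Y.filter fun p : Fin N =>
              (L - R < dist (x p) (x q) ∧ dist (x p) (x q) ≤ L) ∧
                (Finset.univ.filter fun r : Fin N => lab r = lab p).card ≤
                  (Finset.univ.filter fun r : Fin N => lab r = lab q).card).card : ℝ) ≤
            c * ((Finset.univ.filter fun r : Fin N => lab r = lab q).card : ℝ))) :
    Summit.AtomisticToContinuum.Crystallization.Theses.ChessboardParticlePlanes.LjLaminarWindows :=
  stub_glueC5 hLam (stub_boundedSpikes hFew) stub_windowRemoval stub_shellBound stub_pathCount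

/- (former `LjLaminarWindows_of''`, an `example` from rev. 16 on so that exactly ONE theorem concludes the crux by name)
**The alternative composition, ground-state form (rev. 9, lead c5)**: the crux from a.e.
laminarity and bounded spiky scales OF GROUND STATES. -/
example
    (hLam : ∀ t R : ℝ, 0 < t → 0 < R → ∀ x : (N : ℕ) → (Fin N → EuclideanSpace ℝ (Fin 3)),
      (∀ N, IsGroundState lennardJones (x N)) →
      Filter.Tendsto (fun N : ℕ => (Nat.card {i : Fin N // ¬ (∃ n : EuclideanSpace ℝ (Fin 3),
        ‖n‖ = 1 ∧ ∃ c : ℤ → ℝ, (∀ k : ℤ, c k + 3 / 4 ≤ c (k + 1)) ∧ ∀ j : Fin N,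
          dist (x N j) (x N i) ≤ R → ∃ k : ℤ, |inner ℝ (x N j - x N i) n - c k| ≤ t)} : ℝ) / N)
        Filter.atTop (nhds 0))
    (hFew :
    ∀ θ₁ R : ℝ, 0 < θ₁ → 1 ≤ R → ∃ c C L₀ : ℝ, 0 < c ∧ 1 ≤ C ∧ ∀ L : ℝ, L₀ ≤ L →
      ∀ (N : ℕ) (x : Fin N → E3),
      (∀ j k : Fin N, j ≠ k → (7 : ℝ) / 10 ≤ dist (x j) (x k)) →
      (∀ S : Finset (Fin N), S.Nonempty → Sᶜ.Nonempty →
          ∃ p ∈ S, ∃ k ∈ Sᶜ, dist (x p) (x k) ≤ 23 / 20) →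
      ∀ Y : Finset (Fin N),
        (∀ p ∈ Y, θ₁ * ((Finset.univ.filter fun q : Fin N => dist (x q) (x p) ≤ L).card : ℝ) <
            ((Y.filter fun q : Fin N => L - R < dist (x q) (x p) ∧ dist (x q) (x p) ≤ L).card : ℝ)) →
        ∃ lab : Fin N → ℕ,
          (∀ l : ℕ, ∃ (z : E3) (A : E3 →ₗᵢ[ℝ] E3), ∀ p : Fin N, lab p = l →
              |(A (x p - z)) 2| ≤ R ∧ dist (x p) z ≤ C * Real.sqrt (L * R)) ∧
          (∀ q ∈ Y, ((Y.filter fun p : Fin N =>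
              (L - R < dist (x p) (x q) ∧ dist (x p) (x q) ≤ L) ∧
                (Finset.univ.filter fun r : Fin N => lab r = lab p).card ≤
                  (Finset.univ.filter fun r : Fin N => lab r = lab q).card).card : ℝ) ≤
            c * ((Finset.univ.filter fun r : Fin N => lab r = lab q).card : ℝ))) :
    Summit.AtomisticToContinuum.Crystallization.Theses.ChessboardParticlePlanes.LjLaminarWindows :=
  stub_glueC5GS hLam (boundedSpikesGS_of_boundedSpikes (stub_boundedSpikes hFew)) stub_windowRemoval
    stub_shellBound stub_pathCount

/- (former `LjLaminarWindows_of'''`, an `example` from rev. 16 on so that exactly ONE theorem concludes the crux by name)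
**The NSF composition (rev. 14, lead c8)**: the crux from a.e. laminarity (14293, hypothesis `hLam` from rev. 16 on)
and the non-spiky fraction NSF (PROVED: `nsf_holds`), via `stub_glueNSF` and the landed window removal, shell bound and
path count.  Tree theorem: `LjLaminarWindowsSketch.LjLaminarWindows_of_laminarity` (…LjLaminarWindowsNSF.lean). -/
example
    (hLam : ∀ t R : ℝ, 0 < t → 0 < R → ∀ x : (N : ℕ) → (Fin N → EuclideanSpace ℝ (Fin 3)),
      (∀ N, IsGroundState lennardJones (x N)) →
      Filter.Tendsto (fun N : ℕ => (Nat.card {i : Fin N // ¬ (∃ n : EuclideanSpace ℝ (Fin 3),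
        ‖n‖ = 1 ∧ ∃ c : ℤ → ℝ, (∀ k : ℤ, c k + 3 / 4 ≤ c (k + 1)) ∧ ∀ j : Fin N,
          dist (x N j) (x N i) ≤ R → ∃ k : ℤ, |inner ℝ (x N j - x N i) n - c k| ≤ t)} : ℝ) / N)
        Filter.atTop (nhds 0))
    : Summit.AtomisticToContinuum.Crystallization.Theses.ChessboardParticlePlanes.LjLaminarWindows :=
  stub_glueNSF hLam nsf_holds stub_windowRemoval stub_shellBound stub_pathCount

/- (former `LjLaminarWindows_of''''`, an `example` from rev. 17 on so that exactly ONE theorem concludes the crux by name)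
**The residual composition (rev. 16, lead c10)**: the crux from rev. 16's density residual (hypothesis `hLamAt`,
the statement of the former registered stub `stub_laminarityAt`) by its landed glue `stub_cruxOfLaminarityAt`. -/
example
    (hLamAt : ∀ η : ℝ, 0 < η → ∀ x : (N : ℕ) → (Fin N → EuclideanSpace ℝ (Fin 3)),
      (∀ N, IsGroundState lennardJones (x N)) → ∃ L₁ : ℝ, ∀ L : ℝ, L₁ ≤ L → ∀ δ : ℝ, 0 < δ →
      ∃ᶠ N : ℕ in Filter.atTop, (Nat.card {i : Fin N // ¬ (∃ n : EuclideanSpace ℝ (Fin 3),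
        ‖n‖ = 1 ∧ ∃ c : ℤ → ℝ, (∀ k : ℤ, c k + 3 / 4 ≤ c (k + 1)) ∧ ∀ j : Fin N,
          dist (x N j) (x N i) ≤ L → ∃ k : ℤ, |inner ℝ (x N j - x N i) n - c k| ≤ η)} : ℝ) <
        δ * N) :
    Summit.AtomisticToContinuum.Crystallization.Theses.ChessboardParticlePlanes.LjLaminarWindows :=
  stub_cruxOfLaminarityAt hLamAt

/- (former `LjLaminarWindows_of_laminarity'`, an `example` from rev. 16 on so that exactly ONE theorem concludes the crux by name)
… and the old route to the crux survives: 14293 ⇒ residual ⇒ crux. -/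
example
    (hLam : ∀ t R : ℝ, 0 < t → 0 < R → ∀ x : (N : ℕ) → (Fin N → EuclideanSpace ℝ (Fin 3)),
      (∀ N, IsGroundState lennardJones (x N)) →
      Filter.Tendsto (fun N : ℕ => (Nat.card {i : Fin N // ¬ (∃ n : EuclideanSpace ℝ (Fin 3),
        ‖n‖ = 1 ∧ ∃ c : ℤ → ℝ, (∀ k : ℤ, c k + 3 / 4 ≤ c (k + 1)) ∧ ∀ j : Fin N,
          dist (x N j) (x N i) ≤ R → ∃ k : ℤ, |inner ℝ (x N j - x N i) n - c k| ≤ t)} : ℝ) / N)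
        Filter.atTop (nhds 0))
    : Summit.AtomisticToContinuum.Crystallization.Theses.ChessboardParticlePlanes.LjLaminarWindows :=
  stub_cruxOfLaminarityAt (laminarityAt_of_laminarity hLam)


/-! ## Rev. 17 (lead c11, 2026-08-17): the ONE-WINDOW residual — the crux is equivalent to its laminarity clause

The glue `stub_glueNSF`/`glueNSF_at` finds an `η`-laminar AND `θ`-non-spiky particle by pigeonhole ("fewer than `δ N`
non-laminar" against "at least `δ N` non-spiky"), which is why rev. 16's residual had the density form.  But the two
landed NSF stubs are local statements:

* `stub_massBound` (p132052): if every particle within `2L²` of `p₀` is `θ`-spiky at radius `L` then every `2L`-ball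
  centred within `L²` of `p₀` holds `≤ M₁ L` particles;
* `stub_sparseAllSpiky` (p133128): an all-spiky `L`-neighbourhood of a particle `a` with `#B_{2L}(a) ≤ M₁ L` and a
  particle beyond `2L` is impossible;

so (S10 `stub_localNonSpiky`) within `2L²` of ANY particle that sees a particle beyond `2L` there is a `θ`-non-spiky
particle `p`; and (S12 `stub_subWindow`) if the `(2L² + L)`-window of `i` is `η`-laminar for `(A, T)` then the `L`-window
of every such `p` is `η`-laminar for `(A, T − (A(x_p − x_i))₂)`.  With window removal, the shell bound and the path count
(all landed) the energy clause follows at `p` exactly as in `glueNSF_at` (S14 `stub_cruxOfOneWindow`, lead).  Hence the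
new OPEN registered stub S9 `stub_oneWindow`: ONE `η`-laminar particle-centred window at every large radius, frequently
in `N` — the crux with its separation and energy clauses deleted.  `oneWindow_of_crux` (trivial projection, proved here)
makes the crux EQUIVALENT to S9: the residual of the line can no longer be weakened.  S13 `stub_oneWindow_of_laminarityAt`
keeps the old chain 14293 ⇒ rev-16 residual ⇒ S9 ⇒ crux.  Registered stubs of rev. 17: S9 (OPEN), S10, S11, S12, S13 (wave),
S14 (lead); composition `LjLaminarWindows_of'''''`. -/

/- rev. 19 (lead c12): the threshold radius of S9 is idle (concentric sub-balls inherit laminarity), so the open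
registered stub is the all-scales form S9♭ below; S9 follows with `L₀ := 0`, and the crux implies S9♭
(`oneWindowAllScales_of_crux`).  Crux ⇔ S9 ⇔ S9♭. -/

/- rev. 20 (lead c13): ground states EXIST for every `N` (`exists_isGroundState_lennardJones`, a tree theorem), so
"frequently in `N` along EVERY sequence of ground states" ⇔ "for infinitely many `N`, for EVERY `N`-particle ground state"
(choice assembles eventual bad ground states into a bad sequence).  The registered open stub is therefore the SEQUENCE-FREE
form S9♯ below; S9♭ follows by restriction (`stub_oneWindowAllScales`, proved), and the crux implies S9♯
(`allGroundStates_of_crux`, proved here from `oneWindowAllScales_of_crux` by the choice argument).  Crux ⇔ S9 ⇔ S9♭ ⇔ S9♯ —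
tree theorem `LjLaminarWindowsSketch.LjLaminarWindows_iff_allGroundStates` (Theorems/…LjLaminarWindowsAllGroundStates.lean). -/

/-- **S9♯ (OPEN) — the sequence-free one-window laminarity residual (rev. 20).** For every thickness `η > 0` and EVERY
radius `L`, for INFINITELY MANY `N`, EVERY Lennard-Jones ground state `y` of `N` particles in `ℝ³` has SOME particle `i`,
linear isometry `A` and `3/4`-separated height set `T ⊂ ℝ` putting every particle of the closed `L`-ball around `y i`
within `η` (third rotated coordinate) of a height of `T`.  A property of the SETS of ground states `GS_N` at infinitely
many particle numbers; equivalent to the crux (`allGroundStates_of_crux` below and `LjLaminarWindows_of'''''`).  Trivial for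
`η ≥ 3/8` (`T = (3/4)ℤ`); for `η < 3/8` it is one-window 3-D layering of a pair-potential ground state — open (implied by
board item stmt-AtomisticToContinuum-14293 via S13 and `laminarityAt_of_laminarity`).  Its negation, the only shape a
refutation can take: one `η > 0`, one `L`, and for all large `N` ONE `N`-particle ground state with no `η`-laminar
particle-centred closed `L`-window. -/
theorem stub_allGroundStatesOneWindow :
    ∀ η : ℝ, 0 < η → ∀ L : ℝ, ∃ᶠ N in Filter.atTop,
      ∀ y : Fin N → EuclideanSpace ℝ (Fin 3), IsGroundState lennardJones y →
        ∃ (i : Fin N) (A : EuclideanSpace ℝ (Fin 3) →ₗᵢ[ℝ] EuclideanSpace ℝ (Fin 3)) (T : Set ℝ),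
          (∀ t ∈ T, ∀ t' ∈ T, t ≠ t' → (3 : ℝ) / 4 ≤ |t - t'|) ∧
          (∀ j : Fin N, dist (y j) (y i) ≤ L → ∃ t ∈ T, |(A (y j - y i)) 2 - t| ≤ η) := by
  sorry   -- S9♯ (OPEN, rev. 20): for infinitely many N, EVERY N-particle LJ ground state has an η-laminar
          -- particle-centred closed L-window; 3-D layering at η < 3/8 (open problem); the crux is EQUIVALENT to this

/-- **S9♭ (rev. 19's residual, now PROVED from S9♯ by restriction to the given sequence).** For every sequence of
Lennard-Jones ground states, every thickness `η > 0` and EVERY radius `L`, FREQUENTLY in `N`, SOME particle `i`,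
linear isometry `A` and `3/4`-separated height set `T ⊂ ℝ` put every particle of the closed `L`-ball around `xᵢ`
within `η` (third rotated coordinate) of a height of `T`. -/
theorem stub_oneWindowAllScales :
    ∀ x : (N : ℕ) → (Fin N → EuclideanSpace ℝ (Fin 3)), (∀ N, IsGroundState lennardJones (x N)) →
      ∀ η : ℝ, 0 < η → ∀ L : ℝ, ∃ᶠ N in Filter.atTop,
        ∃ (i : Fin N) (A : EuclideanSpace ℝ (Fin 3) →ₗᵢ[ℝ] EuclideanSpace ℝ (Fin 3)) (T : Set ℝ),
          (∀ t ∈ T, ∀ t' ∈ T, t ≠ t' → (3 : ℝ) / 4 ≤ |t - t'|) ∧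
          (∀ j : Fin N, dist (x N j) (x N i) ≤ L → ∃ t ∈ T, |(A (x N j - x N i)) 2 - t| ≤ η) :=
  fun x hx η hη L => (stub_allGroundStatesOneWindow η hη L).mono fun _N hN => hN (x _N) (hx _N)

/-- **S9 (rev. 17's residual, now PROVED from S9♭ with `L₀ := 0`).** For every sequence of Lennard-Jones ground
states and every thickness `η > 0` there is `L₀` such that for every radius `L ≥ L₀`, FREQUENTLY in `N`, SOME
particle `i`, linear isometry `A` and `3/4`-separated height set `T ⊂ ℝ` put every particle of the closed
`L`-ball around `xᵢ` within `η` (third rotated coordinate) of a height of `T`. -/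
theorem stub_oneWindow :
    ∀ x : (N : ℕ) → (Fin N → EuclideanSpace ℝ (Fin 3)), (∀ N, IsGroundState lennardJones (x N)) →
      ∀ η : ℝ, 0 < η → ∃ L₀ : ℝ, ∀ L : ℝ, L₀ ≤ L → ∃ᶠ N in Filter.atTop,
        ∃ (i : Fin N) (A : EuclideanSpace ℝ (Fin 3) →ₗᵢ[ℝ] EuclideanSpace ℝ (Fin 3)) (T : Set ℝ),
          (∀ t ∈ T, ∀ t' ∈ T, t ≠ t' → (3 : ℝ) / 4 ≤ |t - t'|) ∧
          (∀ j : Fin N, dist (x N j) (x N i) ≤ L → ∃ t ∈ T, |(A (x N j - x N i)) 2 - t| ≤ η) :=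
  fun x hx η hη => ⟨0, fun L _ => stub_oneWindowAllScales x hx η hη L⟩

/-- **The crux implies S9♭** (projection to clauses 1 and 3 at `ε = 1`, radius `max L L₀`, then restriction to
the concentric closed `L`-ball): with `LjLaminarWindows_of'''''` the crux is EQUIVALENT to the all-scales
residual `stub_oneWindowAllScales`. [folklore] -/
theorem oneWindowAllScales_of_crux
    (h : Summit.AtomisticToContinuum.Crystallization.Theses.ChessboardParticlePlanes.LjLaminarWindows) :
    ∀ x : (N : ℕ) → (Fin N → EuclideanSpace ℝ (Fin 3)), (∀ N, IsGroundState lennardJones (x N)) →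
      ∀ η : ℝ, 0 < η → ∀ L : ℝ, ∃ᶠ N in Filter.atTop,
        ∃ (i : Fin N) (A : EuclideanSpace ℝ (Fin 3) →ₗᵢ[ℝ] EuclideanSpace ℝ (Fin 3)) (T : Set ℝ),
          (∀ t ∈ T, ∀ t' ∈ T, t ≠ t' → (3 : ℝ) / 4 ≤ |t - t'|) ∧
          (∀ j : Fin N, dist (x N j) (x N i) ≤ L → ∃ t ∈ T, |(A (x N j - x N i)) 2 - t| ≤ η) := by
  intro x hx η hη L
  obtain ⟨L₀, hL₀⟩ := h x hx η 1 hη one_pos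
  refine (hL₀ (max L L₀) (le_max_right _ _)).mono ?_
  rintro N ⟨i, A, T, hT, -, hlam, -⟩
  exact ⟨i, A, T, hT, fun j hj => hlam j (hj.trans (le_max_left _ _))⟩

/-- **The crux implies S9♯ (rev. 20, lead c13)**: with `LjLaminarWindows_of'''''` the crux is EQUIVALENT to the
sequence-free residual `stub_allGroundStatesOneWindow`.  Contraposition of `oneWindowAllScales_of_crux` plus choice: if for
all large `N` some `N`-particle ground state had no laminar window, assemble these — padded by arbitrary ground states, which
exist for every `N` (`exists_isGroundState_lennardJones`) — into one sequence of ground states along which laminar windows are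
eventually absent. [folklore] -/
theorem allGroundStates_of_crux
    (h : Summit.AtomisticToContinuum.Crystallization.Theses.ChessboardParticlePlanes.LjLaminarWindows) :
    ∀ η : ℝ, 0 < η → ∀ L : ℝ, ∃ᶠ N in Filter.atTop,
      ∀ y : Fin N → EuclideanSpace ℝ (Fin 3), IsGroundState lennardJones y →
        ∃ (i : Fin N) (A : EuclideanSpace ℝ (Fin 3) →ₗᵢ[ℝ] EuclideanSpace ℝ (Fin 3)) (T : Set ℝ),
          (∀ t ∈ T, ∀ t' ∈ T, t ≠ t' → (3 : ℝ) / 4 ≤ |t - t'|) ∧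
          (∀ j : Fin N, dist (y j) (y i) ≤ L → ∃ t ∈ T, |(A (y j - y i)) 2 - t| ≤ η) := by
  classical
  intro η hη L
  by_contra hno
  rw [Filter.not_frequently] at hno
  -- the laminar-window property of an `N`-particle configuration at `(η, L)`
  let P : (N : ℕ) → (Fin N → EuclideanSpace ℝ (Fin 3)) → Prop := fun N y =>
    ∃ (i : Fin N) (A : EuclideanSpace ℝ (Fin 3) →ₗᵢ[ℝ] EuclideanSpace ℝ (Fin 3)) (T : Set ℝ),
      (∀ t ∈ T, ∀ t' ∈ T, t ≠ t' → (3 : ℝ) / 4 ≤ |t - t'|) ∧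
      (∀ j : Fin N, dist (y j) (y i) ≤ L → ∃ t ∈ T, |(A (y j - y i)) 2 - t| ≤ η)
  -- a sequence of ground states that is bad wherever a bad ground state exists
  let x : (N : ℕ) → (Fin N → EuclideanSpace ℝ (Fin 3)) := fun N =>
    if hN : ∃ y : Fin N → EuclideanSpace ℝ (Fin 3), IsGroundState lennardJones y ∧ ¬ P N y then hN.choose
    else (exists_isGroundState_lennardJones (d := 3) (by norm_num) N).choose
  have hx : ∀ N, IsGroundState lennardJones (x N) := by
    intro N
    by_cases hN : ∃ y : Fin N → EuclideanSpace ℝ (Fin 3), IsGroundState lennardJones y ∧ ¬ P N y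
    · simp only [x, dif_pos hN]
      exact hN.choose_spec.1
    · simp only [x, dif_neg hN]
      exact (exists_isGroundState_lennardJones (d := 3) (by norm_num) N).choose_spec
  have hbad : ∀ᶠ N in Filter.atTop, ¬ P N (x N) := by
    filter_upwards [hno] with N hN
    have hN' : ∃ y : Fin N → EuclideanSpace ℝ (Fin 3), IsGroundState lennardJones y ∧ ¬ P N y := by
      by_contra hc
      push Not at hc
      exact hN hc
    simp only [x, dif_pos hN']
    exact hN'.choose_spec.2
  obtain ⟨N, hN₁, hN₂⟩ := ((oneWindowAllScales_of_crux h x hx η hη L).and_eventually hbad).exists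
  exact hN₂ hN₁

/-- **S10 (LANDED p135965, worker) — local non-spikiness.** For `θ ∈ (0,1)`, `R ≥ 1` there is `L₀` such that for every
`L ≥ L₀`, in every `7/10`-separated `23/20`-connected finite configuration, within `2L²` of any particle `p₀`
that sees a particle beyond distance `2L` there is a particle `p` whose boundary shell
`L − R < |x_q − x_p| ≤ L` holds at most `θ ·` (its closed `L`-ball) particles.  Proof: `stub_massBound
stub_thickCircle nsf_bonferroni` (all-spiky within `2L²` ⇒ `#B_{2L}(p₀) ≤ M₁ L`, taking `q = p₀`) and
`stub_sparseAllSpiky stub_thickCircle nsf_bonferroni stub_tripleShell` with `a = p₀` (all particles within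
`L ≤ 2L²` of `p₀` are spiky) ⇒ `False`. -/
theorem stub_localNonSpiky :
    ∀ θ R : ℝ, 0 < θ → θ < 1 → 1 ≤ R → ∃ L₀ : ℝ, ∀ L : ℝ, L₀ ≤ L → ∀ (N : ℕ) (x : Fin N → E3),
      (∀ j k : Fin N, j ≠ k → (7 : ℝ) / 10 ≤ dist (x j) (x k)) →
      (∀ S : Finset (Fin N), S.Nonempty → Sᶜ.Nonempty →
          ∃ p ∈ S, ∃ k ∈ Sᶜ, dist (x p) (x k) ≤ 23 / 20) →
      ∀ p₀ : Fin N, (∃ j : Fin N, 2 * L < dist (x j) (x p₀)) →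
        ∃ p : Fin N, dist (x p) (x p₀) ≤ 2 * L ^ 2 ∧
          ((Finset.univ.filter fun q : Fin N =>
              L - R < dist (x q) (x p) ∧ dist (x q) (x p) ≤ L).card : ℝ) ≤
            θ * ((Finset.univ.filter fun q : Fin N => dist (x q) (x p) ≤ L).card : ℝ) :=
  -- LANDED (lead c11, rev 18, p135965: Theorems/ChessboardParticlePlanesLjLaminarWindowsLocalNonSpiky.lean)
  LjLaminarWindowsSketch.stub_localNonSpiky

/-- **S11 (LANDED p135977, worker) — a far particle.** In a `7/10`-separated configuration of `N > (40L/7 + 1)³` points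
every particle sees a particle beyond distance `2L` (packing bound `glue_ball_card_le` for the closed `2L`-ball;
injectivity from separation, `massBound_injective`). -/
theorem stub_farParticle :
    ∀ (N : ℕ) (x : Fin N → E3), (∀ j k : Fin N, j ≠ k → (7 : ℝ) / 10 ≤ dist (x j) (x k)) →
      ∀ L : ℝ, 0 ≤ L → (2 * (2 * L) / (7 / 10) + 1) ^ 3 < (N : ℝ) →
        ∀ p₀ : Fin N, ∃ j : Fin N, 2 * L < dist (x j) (x p₀) :=
  -- LANDED (lead c11, rev 18, p135977: Theorems/ChessboardParticlePlanesLjLaminarWindowsFarParticle.lean)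
  LjLaminarWindowsSketch.stub_farParticle

/-- **S12 (LANDED p135999, worker) — laminarity is inherited by sub-windows.** If the closed `L'`-ball around `xᵢ` is
`η`-laminar for the isometry `A` and the `3/4`-separated height set `T`, and `|x_p − x_i| + L ≤ L'`, then the
closed `L`-ball around `x_p` is `η`-laminar for `A` and the translated height set `T − (A(x_p − x_i))₂`
(linearity of `A` and of the coordinate projection). -/
theorem stub_subWindow :
    ∀ (N : ℕ) (x : Fin N → E3) (i p : Fin N) (L L' η : ℝ) (A : E3 →ₗᵢ[ℝ] E3) (T : Set ℝ),
      (∀ t ∈ T, ∀ t' ∈ T, t ≠ t' → (3 : ℝ) / 4 ≤ |t - t'|) →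
      (∀ j : Fin N, dist (x j) (x i) ≤ L' → ∃ t ∈ T, |(A (x j - x i)) 2 - t| ≤ η) →
      dist (x p) (x i) + L ≤ L' →
      ∃ T' : Set ℝ, (∀ t ∈ T', ∀ t' ∈ T', t ≠ t' → (3 : ℝ) / 4 ≤ |t - t'|) ∧
        ∀ j : Fin N, dist (x j) (x p) ≤ L → ∃ t ∈ T', |(A (x j - x p)) 2 - t| ≤ η :=
  -- LANDED (lead c11, rev 18, p135999: Theorems/ChessboardParticlePlanesLjLaminarWindowsSubWindow.lean)
  LjLaminarWindowsSketch.stub_subWindow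

/-- **S13 (LANDED p136026, worker) — rev. 16's density residual implies rev. 17's one-window residual.** With `δ = 1`:
frequently in `N` fewer than `N` particles are non-`(η, L)`-laminar, so some particle is laminar (levels form),
and `laminar_of_levels` converts `(n, c)` into `(A, T)`. -/
theorem stub_oneWindow_of_laminarityAt :
    (∀ η : ℝ, 0 < η → ∀ x : (N : ℕ) → (Fin N → EuclideanSpace ℝ (Fin 3)),
      (∀ N, IsGroundState lennardJones (x N)) → ∃ L₁ : ℝ, ∀ L : ℝ, L₁ ≤ L → ∀ δ : ℝ, 0 < δ →
      ∃ᶠ N : ℕ in Filter.atTop, (Nat.card {i : Fin N // ¬ (∃ n : EuclideanSpace ℝ (Fin 3),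
        ‖n‖ = 1 ∧ ∃ c : ℤ → ℝ, (∀ k : ℤ, c k + 3 / 4 ≤ c (k + 1)) ∧ ∀ j : Fin N,
          dist (x N j) (x N i) ≤ L → ∃ k : ℤ, |inner ℝ (x N j - x N i) n - c k| ≤ η)} : ℝ) <
        δ * N) →
    ∀ x : (N : ℕ) → (Fin N → EuclideanSpace ℝ (Fin 3)), (∀ N, IsGroundState lennardJones (x N)) →
      ∀ η : ℝ, 0 < η → ∃ L₀ : ℝ, ∀ L : ℝ, L₀ ≤ L → ∃ᶠ N in Filter.atTop,
        ∃ (i : Fin N) (A : EuclideanSpace ℝ (Fin 3) →ₗᵢ[ℝ] EuclideanSpace ℝ (Fin 3)) (T : Set ℝ),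
          (∀ t ∈ T, ∀ t' ∈ T, t ≠ t' → (3 : ℝ) / 4 ≤ |t - t'|) ∧
          (∀ j : Fin N, dist (x N j) (x N i) ≤ L → ∃ t ∈ T, |(A (x N j - x N i)) 2 - t| ≤ η) :=
  -- LANDED (lead c11, rev 18, p136026: Theorems/ChessboardParticlePlanesLjLaminarWindowsOneWindowOfLaminarityAt.lean)
  LjLaminarWindowsSketch.stub_oneWindow_of_laminarityAt

/-- **S14 (LANDED p135891, lead) — the glue at the one-window residual.** From local non-spikiness (S10), far
particles (S11) and sub-window inheritance (S12): the one-window residual (S9) implies the body of the crux.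
Pattern = `glueNSF_at` with the pigeonhole replaced by S10–S12: given `η, ε`, fix `k₀` (window removal at
`ε/4`), `R, C` (shell bound at `ε/4`), `θ` with `Cθ ≤ ε/4`, `L₃` (S10); for `L ≥ max(L₃, 1, 23k₀/20, L₁)` apply S9
at radius `L' = 2L² + L`; eventually `N > (40L/7+1)³`, so (S11) every particle sees one beyond `2L`; S10 at the
laminar centre `i` gives a non-spiky `p` within `2L²`; S12 makes its `L`-window `η`-laminar; path count gives
`#B_L(p) ≥ 20L/23 ≥ k₀`; window removal + shell bound + non-spikiness give the energy clause. -/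
theorem stub_cruxOfOneWindow :
    (∀ θ R : ℝ, 0 < θ → θ < 1 → 1 ≤ R → ∃ L₀ : ℝ, ∀ L : ℝ, L₀ ≤ L → ∀ (N : ℕ) (x : Fin N → E3),
      (∀ j k : Fin N, j ≠ k → (7 : ℝ) / 10 ≤ dist (x j) (x k)) →
      (∀ S : Finset (Fin N), S.Nonempty → Sᶜ.Nonempty →
          ∃ p ∈ S, ∃ k ∈ Sᶜ, dist (x p) (x k) ≤ 23 / 20) →
      ∀ p₀ : Fin N, (∃ j : Fin N, 2 * L < dist (x j) (x p₀)) →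
        ∃ p : Fin N, dist (x p) (x p₀) ≤ 2 * L ^ 2 ∧
          ((Finset.univ.filter fun q : Fin N =>
              L - R < dist (x q) (x p) ∧ dist (x q) (x p) ≤ L).card : ℝ) ≤
            θ * ((Finset.univ.filter fun q : Fin N => dist (x q) (x p) ≤ L).card : ℝ)) →
    (∀ (N : ℕ) (x : Fin N → E3), (∀ j k : Fin N, j ≠ k → (7 : ℝ) / 10 ≤ dist (x j) (x k)) →
      ∀ L : ℝ, 0 ≤ L → (2 * (2 * L) / (7 / 10) + 1) ^ 3 < (N : ℝ) →
        ∀ p₀ : Fin N, ∃ j : Fin N, 2 * L < dist (x j) (x p₀)) →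
    (∀ (N : ℕ) (x : Fin N → E3) (i p : Fin N) (L L' η : ℝ) (A : E3 →ₗᵢ[ℝ] E3) (T : Set ℝ),
      (∀ t ∈ T, ∀ t' ∈ T, t ≠ t' → (3 : ℝ) / 4 ≤ |t - t'|) →
      (∀ j : Fin N, dist (x j) (x i) ≤ L' → ∃ t ∈ T, |(A (x j - x i)) 2 - t| ≤ η) →
      dist (x p) (x i) + L ≤ L' →
      ∃ T' : Set ℝ, (∀ t ∈ T', ∀ t' ∈ T', t ≠ t' → (3 : ℝ) / 4 ≤ |t - t'|) ∧
        ∀ j : Fin N, dist (x j) (x p) ≤ L → ∃ t ∈ T', |(A (x j - x p)) 2 - t| ≤ η) →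
    (∀ x : (N : ℕ) → (Fin N → EuclideanSpace ℝ (Fin 3)), (∀ N, IsGroundState lennardJones (x N)) →
      ∀ η : ℝ, 0 < η → ∃ L₀ : ℝ, ∀ L : ℝ, L₀ ≤ L → ∃ᶠ N in Filter.atTop,
        ∃ (i : Fin N) (A : EuclideanSpace ℝ (Fin 3) →ₗᵢ[ℝ] EuclideanSpace ℝ (Fin 3)) (T : Set ℝ),
          (∀ t ∈ T, ∀ t' ∈ T, t ≠ t' → (3 : ℝ) / 4 ≤ |t - t'|) ∧
          (∀ j : Fin N, dist (x N j) (x N i) ≤ L → ∃ t ∈ T, |(A (x N j - x N i)) 2 - t| ≤ η)) →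
    ∀ x : (N : ℕ) → (Fin N → EuclideanSpace ℝ (Fin 3)), (∀ N, IsGroundState lennardJones (x N)) →
      ∀ η ε : ℝ, 0 < η → 0 < ε → ∃ L₀ : ℝ, ∀ L : ℝ, L₀ ≤ L → ∃ᶠ N in Filter.atTop,
        ∃ (i : Fin N) (A : EuclideanSpace ℝ (Fin 3) →ₗᵢ[ℝ] EuclideanSpace ℝ (Fin 3)) (T : Set ℝ),
          (∀ t ∈ T, ∀ t' ∈ T, t ≠ t' → (3 : ℝ) / 4 ≤ |t - t'|) ∧
          (∀ j k : Fin N, j ≠ k → dist (x N j) (x N i) ≤ L → dist (x N k) (x N i) ≤ L →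
            (7 : ℝ) / 10 ≤ dist (x N j) (x N k)) ∧
          (∀ j : Fin N, dist (x N j) (x N i) ≤ L → ∃ t ∈ T, |(A (x N j - x N i)) 2 - t| ≤ η) ∧
          (∑ j : Fin N, ∑ k : Fin N, if j ≠ k ∧ dist (x N j) (x N i) ≤ L ∧ dist (x N k) (x N i) ≤ L
              then lennardJones (dist (x N j) (x N k)) else 0) ≤
            2 * ((⨅ Q : PeriodicConfiguration 3, Q.energyPerParticle lennardJones) + ε) *
              (Nat.card {j : Fin N // dist (x N j) (x N i) ≤ L} : ℝ) :=
  -- LANDED (lead c11, rev 17/18, p135891: Theorems/ChessboardParticlePlanesLjLaminarWindowsCruxOfOneWindow.lean)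
  LjLaminarWindowsSketch.stub_cruxOfOneWindow

/-- **The crux implies the one-window residual** (projection to clauses 1 and 3 at `ε = 1`): together with
`LjLaminarWindows_of'''''` the crux `LjLaminarWindows` is EQUIVALENT to S9 `stub_oneWindow`. [folklore] -/
theorem oneWindow_of_crux
    (h : Summit.AtomisticToContinuum.Crystallization.Theses.ChessboardParticlePlanes.LjLaminarWindows) :
    ∀ x : (N : ℕ) → (Fin N → EuclideanSpace ℝ (Fin 3)), (∀ N, IsGroundState lennardJones (x N)) →
      ∀ η : ℝ, 0 < η → ∃ L₀ : ℝ, ∀ L : ℝ, L₀ ≤ L → ∃ᶠ N in Filter.atTop,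
        ∃ (i : Fin N) (A : EuclideanSpace ℝ (Fin 3) →ₗᵢ[ℝ] EuclideanSpace ℝ (Fin 3)) (T : Set ℝ),
          (∀ t ∈ T, ∀ t' ∈ T, t ≠ t' → (3 : ℝ) / 4 ≤ |t - t'|) ∧
          (∀ j : Fin N, dist (x N j) (x N i) ≤ L → ∃ t ∈ T, |(A (x N j - x N i)) 2 - t| ≤ η) := by
  intro x hx η hη
  obtain ⟨L₀, hL₀⟩ := h x hx η 1 hη one_pos
  refine ⟨L₀, fun L hL => (hL₀ L hL).mono ?_⟩
  rintro N ⟨i, A, T, hT, -, hlam, -⟩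
  exact ⟨i, A, T, hT, hlam⟩

/-- **The one-window composition (rev. 17, lead c11)**: the crux from the registered stubs of rev. 17 — the OPEN
one-window residual `stub_oneWindow` and the provable `stub_localNonSpiky`, `stub_farParticle`, `stub_subWindow`,
`stub_cruxOfOneWindow`.  This is the theorem concluding the crux BY NAME modulo the open stub. -/
theorem LjLaminarWindows_of''''' :
    Summit.AtomisticToContinuum.Crystallization.Theses.ChessboardParticlePlanes.LjLaminarWindows :=
  stub_cruxOfOneWindow stub_localNonSpiky stub_farParticle stub_subWindow stub_oneWindow

/- … and rev. 16's chain survives: density residual (`hLamAt`) ⇒ one window (S13) ⇒ crux. -/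
example
    (hLamAt : ∀ η : ℝ, 0 < η → ∀ x : (N : ℕ) → (Fin N → EuclideanSpace ℝ (Fin 3)),
      (∀ N, IsGroundState lennardJones (x N)) → ∃ L₁ : ℝ, ∀ L : ℝ, L₁ ≤ L → ∀ δ : ℝ, 0 < δ →
      ∃ᶠ N : ℕ in Filter.atTop, (Nat.card {i : Fin N // ¬ (∃ n : EuclideanSpace ℝ (Fin 3),
        ‖n‖ = 1 ∧ ∃ c : ℤ → ℝ, (∀ k : ℤ, c k + 3 / 4 ≤ c (k + 1)) ∧ ∀ j : Fin N,
          dist (x N j) (x N i) ≤ L → ∃ k : ℤ, |inner ℝ (x N j - x N i) n - c k| ≤ η)} : ℝ) <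
        δ * N) :
    Summit.AtomisticToContinuum.Crystallization.Theses.ChessboardParticlePlanes.LjLaminarWindows :=
  stub_cruxOfOneWindow stub_localNonSpiky stub_farParticle stub_subWindow
    (stub_oneWindow_of_laminarityAt hLamAt)


/-! ### rev. 19 (lead c12): the two landed certificates about the residual

* `LjLaminarWindowsSketch.LjLaminarWindows_iff_oneWindowAllScales` (Theorems/…OneWindowAllScales.lean, p137588):
  crux ⇔ S9♭ (`stub_oneWindowAllScales`), unconditionally;
* `LjLaminarWindowsSketch.oneWindowAllScales_of_nonLaminarEnergyGap` (Theorems/…EnergyGapReduction.lean, p137775):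
  the ground-state-free energy gap (Gap) — for every `L`, `η > 0` some `c > 0`, `M₀` such that every `7/10`-separated
  configuration of `M ≥ M₀` points WITHOUT an `η`-laminar particle-centred closed `L`-window has energy
  `≥ (⨅_Q e(Q) + c)·M` — implies S9♭ (laminar windows even in ALL large ground states), hence the crux. -/

/- rev. 19: the registered open stub is literally the right-hand side of the landed equivalence — tree theorem
`LjLaminarWindowsSketch.LjLaminarWindows_iff_oneWindowAllScales` (Theorems/…OneWindowAllScales.lean, p137588; not imported here
to keep the skeleton's import closure at rev. 18's):
  example : Summit.AtomisticToContinuum.Crystallization.Theses.ChessboardParticlePlanes.LjLaminarWindows :=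
    LjLaminarWindowsSketch.LjLaminarWindows_iff_oneWindowAllScales.2 stub_oneWindowAllScales
In-file equivalent: `oneWindowAllScales_of_crux` (crux ⇒ S9♭) and `LjLaminarWindows_of'''''` (S9♭ ⇒ S9 ⇒ crux). -/

/- rev. 20 (lead c13): the registered open stub is the sequence-free S9♯ `stub_allGroundStatesOneWindow`, literally the
right-hand side of the tree theorem `LjLaminarWindowsSketch.LjLaminarWindows_iff_allGroundStates`
(Theorems/…LjLaminarWindowsAllGroundStates.lean; not imported here to keep the import closure at rev. 18's + one Literature file):
  example : Summit.AtomisticToContinuum.Crystallization.Theses.ChessboardParticlePlanes.LjLaminarWindows :=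
    LjLaminarWindowsSketch.LjLaminarWindows_iff_allGroundStates.2 stub_allGroundStatesOneWindow
In-file equivalent: `allGroundStates_of_crux` (crux ⇒ S9♯) and `LjLaminarWindows_of'''''` (S9♯ ⇒ S9♭ ⇒ S9 ⇒ crux). -/

/-- rev. 20, in-file form of the equivalence crux ⇔ S9♯ (both directions proved above; the `.2` direction runs through the
open stub only nominally — it IS the stub's statement). -/
theorem crux_iff_allGroundStates_shape :
    (Summit.AtomisticToContinuum.Crystallization.Theses.ChessboardParticlePlanes.LjLaminarWindows →
      ∀ η : ℝ, 0 < η → ∀ L : ℝ, ∃ᶠ N in Filter.atTop,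
        ∀ y : Fin N → EuclideanSpace ℝ (Fin 3), IsGroundState lennardJones y →
          ∃ (i : Fin N) (A : EuclideanSpace ℝ (Fin 3) →ₗᵢ[ℝ] EuclideanSpace ℝ (Fin 3)) (T : Set ℝ),
            (∀ t ∈ T, ∀ t' ∈ T, t ≠ t' → (3 : ℝ) / 4 ≤ |t - t'|) ∧
            (∀ j : Fin N, dist (y j) (y i) ≤ L → ∃ t ∈ T, |(A (y j - y i)) 2 - t| ≤ η)) :=
  allGroundStates_of_crux

/-- rev. 19, in-file form of the equivalence crux ⇔ S9♭ (modulo nothing: both directions are proved above;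
the `.2` direction runs through the open stub only nominally — it IS the stub's statement). -/
theorem crux_iff_oneWindowAllScales_shape :
    (Summit.AtomisticToContinuum.Crystallization.Theses.ChessboardParticlePlanes.LjLaminarWindows →
      ∀ x : (N : ℕ) → (Fin N → EuclideanSpace ℝ (Fin 3)), (∀ N, IsGroundState lennardJones (x N)) →
        ∀ η : ℝ, 0 < η → ∀ L : ℝ, ∃ᶠ N in Filter.atTop,
          ∃ (i : Fin N) (A : EuclideanSpace ℝ (Fin 3) →ₗᵢ[ℝ] EuclideanSpace ℝ (Fin 3)) (T : Set ℝ),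
            (∀ t ∈ T, ∀ t' ∈ T, t ≠ t' → (3 : ℝ) / 4 ≤ |t - t'|) ∧
            (∀ j : Fin N, dist (x N j) (x N i) ≤ L → ∃ t ∈ T, |(A (x N j - x N i)) 2 - t| ≤ η)) :=
  oneWindowAllScales_of_crux

/- rev. 19: (Gap) at every radius and thickness closes the crux — tree theorem
`LjLaminarWindowsSketch.LjLaminarWindows_of_nonLaminarEnergyGap` (Theorems/…EnergyGapReduction.lean, p137775; not imported
here to keep the skeleton's import closure minimal):
  example (hGap : ∀ L η : ℝ, 0 < η → ∃ c : ℝ, 0 < c ∧ ∃ M₀ : ℕ, ∀ M : ℕ, M₀ ≤ M → ∀ y : Fin M → EuclideanSpace ℝ (Fin 3),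
      (∀ j k : Fin M, j ≠ k → (7 : ℝ) / 10 ≤ dist (y j) (y k)) →
      (¬ ∃ (i : Fin M) (A : EuclideanSpace ℝ (Fin 3) →ₗᵢ[ℝ] EuclideanSpace ℝ (Fin 3)) (T : Set ℝ),
          (∀ t ∈ T, ∀ t' ∈ T, t ≠ t' → (3 : ℝ) / 4 ≤ |t - t'|) ∧
          (∀ j : Fin M, dist (y j) (y i) ≤ L → ∃ t ∈ T, |(A (y j - y i)) 2 - t| ≤ η)) →
      ((⨅ Q : PeriodicConfiguration 3, Q.energyPerParticle lennardJones) + c) * M ≤ interactionEnergy lennardJones y) :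
      Summit.AtomisticToContinuum.Crystallization.Theses.ChessboardParticlePlanes.LjLaminarWindows :=
    LjLaminarWindowsSketch.LjLaminarWindows_of_nonLaminarEnergyGap hGap
-/


/-! ## Rev. 21 (lead c15, 2026-08-17): the periodisation step (PerGap) ⇒ (Gap) — a second, purely variational door

The crux strategist (STRATEGY-CENSUS.md §Strengthen S3, §Decomposition D1) typed the cleanest ground-state-free sufficient
condition for the crux: **(PerGap)** — for every `L`, `η > 0` some `c > 0` such that every `7/10`-separated PERIODIC
configuration of `ℝ³` with NO `η`-laminar closed `L`-window at any of its points has `⨅_Q e(Q) + c ≤ e(Q)` — and the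
periodisation step D1 (PerGap) ⇒ (Gap) (cubic periodisation at period `2Σ‖yⱼ‖ + 2`: separation and everywhere-non-laminarity
pass to the periodic set, `e ≤ 𝓔(y)/M`).  D1 was registered here as the stub `nonLaminarEnergyGap_of_periodicNonLaminarGap`
and is now PROVED by the landed tree theorem of the same name (`Theorems/ChessboardParticlePlanesLjLaminarWindowsPeriodicGapReduction.lean`, this seat) and composed
with the landed (Gap) ⇒ crux (`LjLaminarWindows_of_nonLaminarEnergyGap`, p137775) into the closing recipe below
(an `example`; tree theorem `LjLaminarWindowsSketch.LjLaminarWindows_of_periodicNonLaminarGap`).  (PerGap) itself is NOT a stub: it is a statement about lattice sums of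
periodic point sets that contains the tetrahedral-frustration pricing of 3-D crystallization (open); the line's open
registered stub remains S9♯.  The composition `LjLaminarWindows_of'''''` is unchanged. -/

/-- **D1 (rev. 21; LANDED): (PerGap) ⇒ (Gap).** A positive gap above the periodic infimum for
everywhere-non-laminar `7/10`-separated periodic configurations forces the same per-particle gap, with no size threshold,
for everywhere-non-laminar `7/10`-separated finite configurations. [folklore] -/
theorem nonLaminarEnergyGap_of_periodicNonLaminarGap :
    (∀ L η : ℝ, 0 < η → ∃ c : ℝ, 0 < c ∧ ∀ Q : PeriodicConfiguration 3,
      (∀ p ∈ Q.points, ∀ q ∈ Q.points, p ≠ q → (7 : ℝ) / 10 ≤ dist p q) →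
      (¬ ∃ p ∈ Q.points, ∃ (A : EuclideanSpace ℝ (Fin 3) →ₗᵢ[ℝ] EuclideanSpace ℝ (Fin 3)) (T : Set ℝ),
          (∀ t ∈ T, ∀ t' ∈ T, t ≠ t' → (3 : ℝ) / 4 ≤ |t - t'|) ∧
          (∀ q ∈ Q.points, dist q p ≤ L → ∃ t ∈ T, |(A (q - p)) 2 - t| ≤ η)) →
      (⨅ Q' : PeriodicConfiguration 3, Q'.energyPerParticle lennardJones) + c ≤
        Q.energyPerParticle lennardJones) →
    ∀ L η : ℝ, 0 < η → ∃ c : ℝ, 0 < c ∧ ∃ M₀ : ℕ, ∀ M : ℕ, M₀ ≤ M →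
      ∀ y : Fin M → EuclideanSpace ℝ (Fin 3),
      (∀ j k : Fin M, j ≠ k → (7 : ℝ) / 10 ≤ dist (y j) (y k)) →
      (¬ ∃ (i : Fin M) (A : EuclideanSpace ℝ (Fin 3) →ₗᵢ[ℝ] EuclideanSpace ℝ (Fin 3)) (T : Set ℝ),
          (∀ t ∈ T, ∀ t' ∈ T, t ≠ t' → (3 : ℝ) / 4 ≤ |t - t'|) ∧
          (∀ j : Fin M, dist (y j) (y i) ≤ L → ∃ t ∈ T, |(A (y j - y i)) 2 - t| ≤ η)) →
      ((⨅ Q : PeriodicConfiguration 3, Q.energyPerParticle lennardJones) + c) * M ≤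
        interactionEnergy lennardJones y :=
  LjLaminarWindowsSketch.nonLaminarEnergyGap_of_periodicNonLaminarGap   -- D1 LANDED (Theorems/…PeriodicGapReduction.lean)

/- **(PerGap) ⇒ the crux** (rev. 21 closing recipe: D1, then the landed (Gap) ⇒ crux `LjLaminarWindows_of_nonLaminarEnergyGap`; tree form
`LjLaminarWindowsSketch.LjLaminarWindows_of_periodicNonLaminarGap`).  An `example`, so that exactly ONE theorem of the skeleton concludes the
crux by name. -/
example
    (hPer : ∀ L η : ℝ, 0 < η → ∃ c : ℝ, 0 < c ∧ ∀ Q : PeriodicConfiguration 3,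
      (∀ p ∈ Q.points, ∀ q ∈ Q.points, p ≠ q → (7 : ℝ) / 10 ≤ dist p q) →
      (¬ ∃ p ∈ Q.points, ∃ (A : EuclideanSpace ℝ (Fin 3) →ₗᵢ[ℝ] EuclideanSpace ℝ (Fin 3)) (T : Set ℝ),
          (∀ t ∈ T, ∀ t' ∈ T, t ≠ t' → (3 : ℝ) / 4 ≤ |t - t'|) ∧
          (∀ q ∈ Q.points, dist q p ≤ L → ∃ t ∈ T, |(A (q - p)) 2 - t| ≤ η)) →
      (⨅ Q' : PeriodicConfiguration 3, Q'.energyPerParticle lennardJones) + c ≤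
        Q.energyPerParticle lennardJones) :
    Summit.AtomisticToContinuum.Crystallization.Theses.ChessboardParticlePlanes.LjLaminarWindows :=
  LjLaminarWindowsSketch.LjLaminarWindows_of_nonLaminarEnergyGap (nonLaminarEnergyGap_of_periodicNonLaminarGap hPer)

end Summit.AtomisticToContinuum.Crystallization.Cruxes.LjLaminarWindows.Sketch

end
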